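import Summits.KontsevichZagierPeriods.KontsevichZagierPeriods.Theses.HermiteRigidity
import Literature.NumberTheory.Transcendental.KZKernelConjectureForms
import Literature.NumberTheory.Transcendental.SemialgebraicMapsProofs
import Literature.NumberTheory.EllipticCurves.EisensteinValuesAtI
import Literature.Analysis.SpecialFunctions.LemniscateConstant
import Literature.NumberTheory.Transcendental.KZSubcalculusInvariants
import Literature.NumberTheory.Transcendental.OnePeriodsMasserCMProofs
import Literature.NumberTheory.EllipticCurves.GaussianLatticeQuarterValues
import Literature.NumberTheory.EllipticCurves.LatticeJInvariant
import Summits.KontsevichZagierPeriods.KontsevichZagierPeriods.Theorems.EllipticMomentKernel.Negative.LoadBearing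
import Summits.KontsevichZagierPeriods.KontsevichZagierPeriods.Theorems.EllipticMomentKernel.Negative.GeneralCurve
import Summits.KontsevichZagierPeriods.KontsevichZagierPeriods.Theorems.MzvKernelInKZ.Negative.ScalingDivision

/-!
# Disproof attempts on `RealEllipticSectorKernel` (crux stmt-KontsevichZagierPeriods-10632)

Standing-adversary work file (cdisprove seat; gen 1 = F1–F8, gen 2 / cycle 2 = F9–F11, §§9–10;
gen 3 / cycle 3 = F12–F15, §§11–14; §§12–13 in the companion `DisproofCM8000.lean`).
Prose lives in docstrings; everything stated as a `theorem` is checked (no `sorry` in this file;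
axioms ⊆ {propext, Classical.choice, Quot.sound}).

**Verdict: NO KILL — the crux resists and is very probably a theorem.** `not_crux_iff` (§1) is the
shape of any kill: PROVE the inlined rigidity for a concrete rational cubic (Schneider/Masser, not in
tree) AND exhibit a value-0 combination outside `KZ.relations` — which refutes the summit itself
(`not_crux_imp_not_summit`). Everything below maps the boundary of the statement instead.

## Findings (index)

* **F1 — the crux is a corollary of the summit** (`of_summit`, `not_crux_imp_not_summit`): the
  kernel form of Conjecture 1 (`KZKernelConjecture`, proved equivalent to the summit in tree) gives
  the conclusion `Kernel q₂ q₃` for every curve with NO rigidity hypothesis. Hence a Lean kill of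
  this crux is *exactly* a disproof of the formalised period conjecture on this sector; no cheaper
  refutation exists. Moreover every witness of `¬ crux` must PROVE `Rigidity q₂ q₃` for a concrete
  rational cubic, which contains Schneider's transcendence of `ω₁` (not in Mathlib / tree).
* **F2 — `0 < Δ` is not load-bearing** (`discr_pos_of_rigidity`, `withoutDiscr_iff`): the inlined
  rigidity hypothesis already forces `σ ≠ ∅`, and a sign change `f x > 0 > f t` (`x < t`) of
  `4x³ − q₂x − q₃` forces `q₂³ − 27q₃² > 0`. Dropping `0 < Δ` gives an EQUIVALENT statement.
* **F3 — algebraicity of the coefficients is what keeps the hypothesis satisfiable**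
  (`not_realCoeffRigidity`): with real coefficients the hypothesis fails for every curve
  (`a = −J₀, b = 1`), so that variant of the crux is vacuous (trivially true, not false).
* **F4 — the hypothesis is stronger than the proof plan consumes** (`QRigidity`,
  `qRigidity_of_rigidity`, `crux_of_sharpened`): Hermite + two-torsion put every sector value in
  `ℚJ₀ + ℚJ₁ + ℚK₀ + ℚK₁` with NO constant term, so ℚ-linear independence of `(J₀,J₁,K₀,K₁)` is
  all the plan uses; the `ℚ`-version `Sharpened` implies the crux. (Information for the planner:
  the sharpened form also covers CM curves such as `j = 8000` where `K₀/J₀ = 1/√2`.)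
* **F5 — the crux is vacuous on the CM-by-`i` family `q₃ = 0`** (`K₀_eq_J₀_of_q₃_eq_zero`,
  `not_rigidity_q₃_zero`): there `K₀ = J₀` by the legal rule-2 move `x ↦ −x`, so the inlined
  hypothesis fails and the crux says nothing about `y² = 4x³ − q₂x`. Not a defect (the extra
  relations are themselves one CoV move), but it bounds what a proof of the crux delivers.
* **F6 — `eval c = 0` is load-bearing; generators are never relations** (`genIoi`,
  `genIoi_value`, `of_genIoi_not_mem_relations`, `not_kernelWithoutEval`): at `(q₂,q₃) = (4,0)`
  the generator `[ (1,∞), 1/√(4x³−4x) ]` is an honest `IntegralRep 1` of value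
  `Γ(1/4)²/(4√(2π)) ≠ 0`, so the strengthening "closure S ≤ relations" is false. The construction
  (semialgebraic domain/integrand, integrability from the closed-form value) is the pattern the
  provers need for the normal forms `[σ, (α+βx)/√f]`.
* **F7 — the `EqOn`-presentation of `S` is harmless** (`equivalent_of_eqOn`): two representations
  with the same domain whose integrands agree on it are equivalent by ONE domain-additivity move
  (split off the empty representation), so the "duplicate generator" kernel elements are relations.
* **F8 — complements** (§8): `K₁ = −J₁` at `q₃ = 0`; `Δ ≤ 0` ⇒ hypothesis fails; and, for the
  provers, the typed root-free ovals `σ, σ', σ''` are `ℚ`-semialgebraic uniformly in `q₂ q₃`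
  (`isSemialgebraic_σ₁/σ₂/σ₃`, projection theorem) — the side condition of every move.
* **F9 (cycle 2, §9) — an INTEGER period relation at a rational CM curve OFF the mirror family**
  (`J₀_cm`, `K₀_cm`, `J₀_eq_two_mul_K₀_cm`, `not_qRigidity_cm`, `not_rigidity_cm`,
  `not_intIndependentOffMirror`, `cmElem`, `eval_cmElem`, `cmElem_not_mem_closure_cov_nl`,
  `cmElem_not_mem_closure_add`, `cmElem_mem_relations_of_summit`, `CMIsogenyTransfer`): on
  `y² = 4x³ − 44x + 56` (`(44,−56)`, `j = 66³ = 287496`, CM by `ℤ[2i]`) `J₀ = 2K₀` EXACTLY, both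
  `= Γ(1/4)²/(4√(2π))·{1, ½}`, PROVED with no transcendence by the RATIONAL Vélu 2-isogeny
  `x ↦ x + 1/(x−2)` onto `Y² = u³ − 16u` (namespace `CM66`: exact weight `Ψ_key`, images,
  injectivity, three `integral_image_eq_integral_abs_deriv_smul`). So the crux AND its ℚ-sharpening
  `Sharpened` (F4; the target of the ideators' integer-normal-form line) are VACUOUS there although
  `q₃ ≠ 0`; the refuted strengthening is "integer relations only on the mirror family `q₃ = 0`".
  The kernel element `u₀ = [σ,1/√f] − 2[σ',1/√(−f)]` is honest, lies in NEITHER sub-calculus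
  (`coeffSum u₀ = −1`; `restrictedEval ≠ 0`), and the summit predicts `u₀ ∈ relations`: a
  CM-ISOGENY TRANSFER support (`CMIsogenyTransfer`, ≈ 7 rational moves written out in its docstring)
  that the route does not have (its CMTwist supports are `j = 8000` only) — planner information for
  "NOT DECOMPOSED YET (i)". The rectangular CM lattices with rational `j` are `[1, i√n]`,
  `n ∈ {1,2,3,4,7}` (`j = 1728, 8000, 54000, 287496, 16581375`); `K₀/J₀ = √n^{±1}` is RATIONAL
  exactly for `n = 1` (F5, mirror family) and `n = 4` (F9), so F5 + F9 exhaust the integer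
  relations between `J₀` and `K₀`; for `n = 2,3,7` an integer relation among `(J₀,J₁,K₀,K₁)` would
  need rational coefficients in the CM quasi-period relation (Masser 1975 Lemma 3.1), which are
  irrational at `j = 8000` by the one-shot refuter's numerics (`K₁ = √2J₀ − J₁/√2`) — there
  `Sharpened` is NOT vacuous and its content is Hermite + two-torsion only. NUMERICS (cycle 2,
  `num_cm_family.py`, `num_cm_second.py` on the item): `K₀/J₀ = √3` at `(15,11)` (`j = 54000`),
  `√7` at `(595,2793)` (`j = 255³`), no integer relation of height `≤ 8` among `(J₀,J₁,K₀,K₁)` at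
  either (min `|n·v| ≈ 3·10⁻⁵`); whereas at `(44,−56)` there is a SECOND integer relation
  `2J₀ − J₁ − 2K₁ = 0` — PROVED in §9b (F9b: `two_J₀_sub_J₁_sub_two_K₁_cm`, via `J₁ = J₀ − 2M₄`,
  `K₁ = K₀ + M₄`, same rational isogeny + two Newton–Leibniz steps; numerically, with Legendre,
  `J₁ = J₀ − π/(2J₀)`, `K₁ = J₀/2 + π/(4J₀)`), so the ℤ-kernel of this curve's sector has rank ≥ 2
  (`cmElem`, `cmElem₂`) and the unconditional statement needs a first- AND a second-kind isogeny
  transfer (the analogue of the route's CMTwist pair at `j = 8000`), neither filed.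
* **F10 (cycle 2, §10) — the two-torsion element is honest, not a scissors congruence, and ONE legal
  rule-2 move** (`σ₁_four_zero`, `genσ40`, `twoTorsionElem`, `eval_twoTorsionElem`,
  `twoTorsionElem_not_mem_closure_add`, `twoTorsionElem_mem_cov`, `twoTorsionTransfer_four_zero`): at
  `(4,0)` the translation by `(e₂,0) = (0,0)` is `x ↦ −1/x`; `t₀ = [(1,∞),1/√f] − [(−1,0),1/√f]`
  has `eval = 0` by reflection + inversion (no AGM, no `℘`), needs a non-additivity move
  (`restrictedEval` over `{x > 1}`), and IS a single `KZ.changeOfVariablesRel` instance with every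
  side condition of rule 2 on the UNBOUNDED domain discharged in the tree's format (semialgebraic
  map `of_forall` + `aeval_div_aeval`, `HasFDerivWithinAt` via `hasFDerivAt_pi'`, `det (x⁻²•id)`,
  exact image, exact weight). This settles the planner's "why it might fail" for
  `TwoTorsionTransfer` at the model curve; the general curve differs only by the cubic-irrational
  `eᵢ` in `Φ` (graph `ℚ`-semialgebraic by Tarski–Seidenberg, `tarski_seidenberg_real_holds`).
* **F11 (cycle 2) — audit of the ideators' sorried stubs (targets-in-waiting; no line picked yet)**:
  `stub_valueSpan`, `stub_ovalExactForm`, `stub_ovalReduction` (SketchIdeator1), `mirror_generator`,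
  `duplication_half_transfer`, `integer_normal_form` (SketchIdeator2), `OvalHermiteStep` (any
  degree), `HermiteDecomposition` (SketchIdeator3, proved) were attacked on paper at the degenerate
  cases — `a = 0` (quadratic `g`: the Hermite span is still `ℚ·1/√g + ℚ·x/√g`, `hₐ` unnecessary),
  double root at an endpoint (`g = (x−u)²(v−x)`: integrand bounded there), unbounded / divergent
  integrands (absorbed: `integrableOn` is a FIELD of `IntegralRep`, so divergent presentations do
  not exist), the fold `x*` of `ψ = N/f` (excluded by the strict sign condition on `D = 4g₁g₂g₃`,
  halves `(e₃,x*)`, `(x*,e₂)`, `ψ′²f = 4f(ψ)` exact), constant bound functions with algebraic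
  irrational values (`ℚ`-semialgebraic: isolated algebraic points are `ℚ`-definable) — ALL SURVIVE;
  no `_false` target. Numerics: `num_isogeny.py` (item evidence): `J₀/K₀ = 2.000000003` at
  `(44,−56)`, Vélu identity exact over `ℚ` at 20 random points.
* **F12 (cycle 3, §11) — THE COMPLETE PERIOD-RELATION MODULE AT `(44,−56)`, WITH TRANSCENDENCE
  PROVED IN LEAN** (`CM66.lemHalf_mul_M₄`, `CM66.gaussFour`, `CM66.masser_gaussFour`,
  `CM66.qbarIndep_one_lemHalf_M₄`, `relation_cm_iff`, `intRelation_cm_iff`, `qRelation_cm_iff`,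
  `rigid_one_J₀_J₁_cm`, `rigid_one_K₀_K₁_cm`, `ellipticMomentKernel_rigid_cm`,
  `kernelClaim_cm_of_ellipticMomentKernel`, `legendre_cm`, `kernel_cm_iff_transfers`,
  `kernel_cm_iff_cmElems`, `CMIsogenyTransfer₂`, `cmIsogenyTransfer₂_of_summit`,
  `kernel_cm_of_isogenyTransfers`). (a) `Λ·M₄ = π/4` (`Λ = lemHalf`): Legendre's relation at the
  lemniscatic point as a Beta-function identity — `4M₄ = B(3/4,1/2)` by `x = w²`
  (`integral_comp_rpow_Ioi`), `B(3/4,1/2) = 4π√(2π)/Γ(1/4)²` (reflection) — so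
  `J₁ = Λ − π/(2Λ)`, `K₁ = Λ/2 + π/(4Λ)`, `J₀K₁ − J₁K₀ = π/2` EXACTLY (cycle-2 numerics certified).
  (b) Masser's Theorem III is a THEOREM of the tree (`masser_ellipticPeriods_cm_holds`, from the
  proved Chudnovsky theorem; axioms standard, checked) and applies to the `PeriodPair`
  `ϖ₀(ℤi + ℤ)` (`g₂ = 4`, `g₃ = 0`, CM by `i`, `ω₁ = ϖ₀i`, `η₁ = −πi/ϖ₀` from the tree's
  Gaussian-lattice values; `ϖ₀ = 2Λ`): `1, 2πi, ϖ₀i, −πi/ϖ₀` are `ℚ̄`-independent, hence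
  **`1, Λ, M₄` are linearly independent over the real algebraic numbers**. (c) Therefore the
  `ℚ̄`-relations `a + bJ₀ + cJ₁ + dK₀ + eK₁ = 0` at `(44,−56)` are EXACTLY
  `{a = 0, e = 2c, 2b + 4c + d = 0}` — the span of F9's `J₀ − 2K₀` and F9b's `2J₀ − J₁ − 2K₁`; the
  integer relation lattice is `ℤ(1,0,−2,0) ⊕ ℤ(2,−1,0,−2)` = the coefficient vectors of `cmElem`,
  `cmElem₂`; there is NO third relation (integer, rational or real-algebraic). CONSEQUENCES:
  (i) the crux's hypothesis fails at `(44,−56)` in exactly two independent ways (F9/F9b are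
  complete); (ii) **the sibling crux `EllipticMomentKernel` (10631) is NON-VACUOUS at a rational CM
  curve, in Lean**: its inlined hypothesis `Rigid 44 (−56)` (independence of `1, J₀, J₁`) is PROVED
  (`ellipticMomentKernel_rigid_cm`), so EMK predicts `KernelClaim 44 (−56)` unconditionally — the
  first curve where a rigidity hypothesis of this route is discharged inside the tree with NO
  missing glue (the general glue `J₁ = −η₁/2` is bypassed by the isogeny + Beta integral);
  likewise `1, K₀, K₁` are independent; (iii) **EXACT REMAINING CONTENT of this crux's conclusion
  at `j = 66³`**: given the integer normal form that the route's reduction half produces (Hermite on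
  `σ, σ'` + two-torsion + bookkeeping = the `Sharpened`/oval-hermite-engine machinery),
  `Kernel 44 (−56) ⇔ (cmElem ∈ relations ∧ cmElem₂ ∈ relations)` — the unconditional sector
  statement there is the line's machinery plus exactly TWO new supports (first- and second-kind
  CM isogeny transfers, `CMIsogenyTransfer` of §9 and its quasi-period twin), nothing else can hide
  (integer division is a derived rule: `MzvKernelInKZ.Negative.mem_relations_of_nsmul_mem`);
  planner-facing form `kernel_cm_of_isogenyTransfers`: integer normal form + `CMIsogenyTransfer` (§9)
  + `CMIsogenyTransfer₂` (§11, the second-kind twin, paper chain in its docstring) ⇒ `Kernel 44 (−56)`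
  with NO rigidity hypothesis, both supports being summit corollaries.
  Still NO KILL: a kill at `(44,−56)` would now need "only" `cmElem ∉ relations` or
  `cmElem₂ ∉ relations`, i.e. an invariant of `KZ.relations` finer than `eval` — summit-hard (F1).
  Landing twins: `Negative/TranscendenceCM66.lean` (p83186 ACCEPTED, commit 0fc26a317730: Parts A–B) and
  `Negative/RelationModuleCM66.lean` (Part C; re-proposed after the dependency build).
* **F13 (cycle 3, §12) — THE ROUTE'S OWN CM TEST CURVE `j = 8000`** (`CM8000.f8`, `.r₂/.r₃/.xs`,
  `.sigma_iff/.sigma'_iff`, `.Φ`, `.Φ_key`, `.Φ_sub_r₂`, `.Φ_image₁/₂`, `.weight`,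
  `.J_eq_sqrt2_mul_K`, `.integrableOn_invSqrt_neg`, `.σ₁_8000`, `.J₀_eq_sqrt2_mul_K₀`,
  `.not_rigidity_8000`, `.intIndependent_J₀_K₀_8000`, `.cmTwist_value_eq`,
  `.cmTwistPeriodTransfer_of_summit`, `.not_summit_of_not_cmTwistPeriodTransfer`): on
  `y² = 4x³ − 120x + 224 = 4(x−4)(x−r₂)(x−r₃)`, `r₂,₃ = −2 ± 3√2`, the `x`-coordinate of the CM
  isogeny `[√−2]` is the REAL RATIONAL map `Φ(x) = −x/2 − 9/(x − 4)` with
  `f(Φx) = −f(x)·Φ′(x)²/2` EXACTLY; `Φ − r₂ = −(x − x*)²/(2(x−4))` (`x* = 4 − 3√2`), so `Φ` folds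
  the oval at `x*` and maps each half injectively onto `σ' = (r₂,4)` with weight
  `|Φ′|/√(−f∘Φ) = √2/√f`; two `integral_image_eq_integral_abs_deriv_smul` + additivity give
  **`J₀(120,−224) = √2·K₀(120,−224)`** with NO transcendence (the one-shot refuter's numerics
  `K₀ = J₀/√2` certified). Consequences: (i) `¬Rigidity 120 (−224)` — the crux is VACUOUS at the
  very curve of the route's CMTwist supports (planner-intended), the relation having the
  IRRATIONAL algebraic coefficient `√2`, so NO integer relation between `J₀, K₀` follows
  (`intIndependent_J₀_K₀_8000`, via `irrational_sqrt_two` and `K₀ > 0`) and `Sharpened` (F4) is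
  untouched there; (ii) the VALUE identity of support item `CMTwistPeriodTransfer` (3415) is now a
  theorem (`cmTwist_value_eq`), hence `CMTwistPeriodTransfer` is a corollary of the summit and
  `¬CMTwistPeriodTransfer ⇒ ¬summit` (`not_summit_of_not_cmTwistPeriodTransfer`): the route's kill
  criterion is armed by a theorem instead of `2·10⁻¹²` numerics, and a prover of 3415 gets the whole
  value-level computation (roots, ovals, `Φ`, images, injectivity, weights, integrability) — the
  MOVE-level chain differs only by the rule-1a split at `x*` and the rule-2 instances along `Φ`.
  Landing twins: `Negative/RootsCM8000.lean` (p83238 ACCEPTED, commit 6c5f5409437e),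
  `Negative/IsogenyCM8000.lean`, `Negative/CMPoint8000.lean` (re-proposed after the dependency build).
* **F14 (cycle 3, §13) — SECOND KIND AT `j = 8000`** (`CM8000.Gfun`, `.hasDerivAt_Gfun`,
  `.integral_Gder`, `.integral_inv_sub_four`, `.integral_Φ_mul`, `.integral_half_second`, `.K1_eq`,
  `.K₁_eq_8000`, `.not_rigid_one_J₁_K₀_K₁_8000`, `.cmTwistQuasi_value_eq`, `.cmTwistQuasi_of_summit`,
  `.not_summit_of_not_cmTwistQuasiPeriodTransfer`): pulling `u du/√(−f)` back through `Φ` gives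
  `K₁ = √2 ∫_{half} Φ dx/√f` on each half; ONE Hermite step across the branch points with
  `G = √f/(x−4)` (`36/((x−4)√f) = 2(x−4)/√f − G′`, `G(r₃) = G(r₂) = 0`) gives
  `∫_{oval} Φ dx/√f = 2J₀ − J₁`; hence **`K₁(120,−224) = √2·J₀ − J₁/√2`** EXACTLY (Masser's
  Lemma 3.1 with `κ ≠ 0`; the one-shot refuter's 3·10⁻¹² numerics certified). Consequences: a
  second, independent algebraic relation at `j = 8000` — `(√2/2)J₁ − 2K₀ + K₁ = 0`, i.e.
  `1, J₁, K₀, K₁` dependent (`not_rigid_one_J₁_K₀_K₁_8000`), so the relation space there has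
  dimension ≥ 2 with IRRATIONAL coefficients (no integer relation is produced: `Sharpened` still
  untouched; "exactly 2" would be Masser III for this lattice — needs the glue `J₁ = −η₁/2`); the
  VALUE identity of item 3416 is a theorem, so `CMTwistQuasiPeriodTransfer` follows from the summit
  and its negation refutes the summit (`not_summit_of_not_cmTwistQuasiPeriodTransfer`). Both CMTwist
  supports of the route are now certified summit-corollaries with their full value-level
  computations available to provers.
* **F15 (cycle 3, §14) — THE MIRROR** (`Mirror.K₀_eq_J₀_twist`, `.K₁_eq_neg_J₁_twist`,
  `.rigidity_iff_twist`, `.not_rigidity_44_56`, `.K₀_eq_two_mul_J₀_44_56`, `.rigid_one_J₀_J₁_44_56`,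
  `.rigid_one_K₀_K₁_44_56`): `x ↦ −x` maps the typed `σ'` of `(q₂,q₃)` onto the typed `σ` of the
  twist `(q₂,−q₃)`, so `K₀(q₂,q₃) = J₀(q₂,−q₃)`, `K₁(q₂,q₃) = −J₁(q₂,−q₃)` for ALL parameters (value
  level of the ideators' reflection transport; F5 is the fixed point `q₃ = 0`); hence
  `Rigidity q₂ q₃ ↔ Rigidity q₂ (−q₃)` — the five numbers of the twist are a signed permutation —
  and EVERY finding transfers: `¬Rigidity 44 56`, `K₀(44,56) = 2J₀(44,56)`, EMK's hypothesis
  `Rigid 44 56` HOLDS (second rational CM curve where the sibling crux is non-vacuous in Lean),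
  F13/F14 hold at `(120, 224)`.
* **LANDED** (importable by ideators/planners/provers):
  `Summits.KontsevichZagierPeriods.KontsevichZagierPeriods.Theorems.RealEllipticSectorKernel.Negative.Core`
  (p72642 ACCEPTED, commit 876acfc4a62b: §§0–5, 7 of this file under namespace
  `Summit.KontsevichZagierPeriods.RealEllipticSectorKernel.Negative` — `crux_iff`, `not_summit_of_not`,
  `not_iff`, `not_of_separating_invariant`, `withoutDiscr_iff`, `not_realCoeffRigidity`,
  `qRigidity_of_rigidity`, `crux_of_sharpened`, `K₀_eq_J₀_of_q₃_zero`, `not_rigidity_q₃_zero`,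
  `equivalent_of_eqOn`) and `….Theorems.RealEllipticSectorKernel.Negative.GeneratorNotRelation`
  (p72922 ACCEPTED, commit ee81c03a5aa5: F6 — `exists_generator_not_mem_relations`,
  `not_closure_le_relations`, plus the semialgebraic/integrability lemmas for `[(1,∞), 1/√(4x³−4x)]`).
  CYCLE 2 (all under `….Theorems.RealEllipticSectorKernel.Negative.*`, `--supports` this item):
  `Ovals` (p74832, c2fd4d2f44a4: §8 semialgebraicity of `σ, σ'` and of `1/√(±f)`, namespace
  `…RealEllipticSectorKernel.Ovals`); `Lemniscatic` (p75100, af4bdcc806ae) + `RootsCM66` (p75101,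
  a1fd173d863b) + `IsogenyCM66` (p75638, 1d4b5faf8aec) + `SecondKindCM66` (p76704, c49dfca97172)
  = namespace `…RealEllipticSectorKernel.CM66` (the ℝ-level isogeny computation of §9/§9b:
  `J_eq_two_K_cm`, `second_relation_cm`, …); `CMPoint` (p76663, cf5c4fb898df: F9 at crux level —
  `J₀_cm`, `K₀_cm`, `J₀_eq_two_mul_K₀_cm`, `not_rigidity_cm`, `not_qRigidity_cm`,
  `not_intIndependent_off_mirror`, `cmElem`, …, namespace `…RealEllipticSectorKernel.CMPoint`);
  `TwoTorsionElement` (p75229, c6804a57f7aa: F10 — `twoTorsionElem_mem_cov`,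
  `twoTorsionTransfer_four_zero`, …); `CMPointSecondKind` (p76896, submitted: F9b at crux level —
  `J₁_cm`, `K₁_cm`, `two_J₀_sub_J₁_sub_two_K₁_cm`, `not_qRigidity_cm₂`, `cmElem₂`).

## Attack log (why it resists)
* small/finite models: none — the statement quantifies over honest elliptic integrals; `decide`-type
  attacks do not apply.
* degenerate parameters: `Δ ≤ 0` ⇒ `σ = σ' = ∅` ⇒ hypothesis fails (F2); `q₃ = 0` ⇒ hypothesis
  fails (F5); rational CM curves with `Δ > 0` (j ∈ {1728, 8000, 287496, …}) ⇒ `K₀/J₀` algebraic ⇒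
  hypothesis fails (numerics of the one-shot refuter, item notes 2026-08-15). Non-CM rational
  curves (e.g. `(4,1)`): hypothesis = Masser 1975 Thm II (true, unprovable here).
* load-bearing hypotheses: `0 < Δ` redundant (F2); algebraicity essential for non-vacuity (F3);
  `eval c = 0` essential (F6); rigidity: droppable salva veritate IF the summit holds (F1) — so no
  counterexample to the rigidity-free version can be certified either, short of refuting the summit.
* move legality (paper audit, see item notes): Hermite step = rule 3 with `n = 0`, band `[e₃,e₂]`,
  primitive `P√f` (continuous on the closed band, zero at both ends) + rule 1a for the two null
  endpoints; two-torsion transfer = ONE rule-2 move, `Φ x = e₂ + (e₂−e₁)(e₂−e₃)/(x−e₂)`, Möbius hence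
  injective and smooth on `(e₁,∞)`, image `(e₃,e₂)`, weight identity `f(Φ x) = Φ'(x)² f(x)` exact,
  graph `ℚ`-semialgebraic by `tarski_seidenberg_real_holds` (PROVED in tree). No illegal step found.
* cycle 2: invariant hunt for "rule 2 is necessary" — dead: any additive invariant killing (1a),
  (1b), (3) is forced to be a multiple of `eval` in dimension 1 (rule 3 with `F(t) = t` makes a
  last-coordinate weight constant; every `ℝ¹`-representation is the base of a Newton–Leibniz move
  `F(x,t) = t·h(x)`, so end/tail classes die; the normalised trace over `ℚ(x)` is not CoV-invariant,
  witness `√u` under `u = x²`). Only the EASY separations survive (F9/F10: `coeffSum`,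
  `restrictedEval`). CM integer point `(44,−56)` certified (F9); two-torsion legality certified at
  `(4,0)` (F10); ideator stubs audited (F11). Still no kill, for the reason of F1.
* cycle 3: (a) the lead's four stubs re-read (`stub_roots`, `stub_exactForm` — LANDED p76437 —,
  `stub_twoTorsion`, `stub_reduction`): none killable (`stub_reduction` needs no oval hypothesis,
  the pointwise Hermite identity holds in the junk region `g ≤ 0` where every term is `0`;
  `stub_twoTorsion` is a summit corollary since both values are `Ω₀/2` by PROVED tree facts);
  no stuck stubs were handed over. (b) Transcendence attack at the CM point (F12): instead of a
  counterexample it yields the EXACT relation module — the hypothesis side of the crux is now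
  completely understood at `(44,−56)` and the conclusion side is reduced to two named transfers.
  (c) Rational CM landscape (paper, Masser Lemma 3.1 shape `K₁ = ∓√n(J₁ + C·J₀)` on the rectangular
  family `τ = i√n`, `n ∈ {1,2,3,4,7}`): an INTEGER relation among `(J₀,J₁,K₀,K₁)` needs `√n ∈ ℚ`,
  i.e. `n ∈ {1,4}` = F5 + F9/F9b — consistent with the cycle-2 numerics at `j = 8000, 54000, 255³`
  (no integer relation of height ≤ 8); so `Sharpened` (F4) is non-vacuous at `j = 8000, 54000, 255³`
  and vacuous exactly on the `j = 1728` and `j = 66³` families. (d) F13 certifies the `j = 8000`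
  member of that landscape exactly (`J₀ = √2K₀`, irrational coefficient, no integer relation between
  `J₀` and `K₀`); F14 adds its second-kind partner `K₁ = √2J₀ − J₁/√2` (β = −1/√2 ∉ ℚ, as predicted
  by the `∓√n` rule). Still no kill (F1).
-/

noncomputable section

set_option linter.dupNamespace false

namespace Summit.KontsevichZagierPeriods.KontsevichZagierPeriods.Cruxes.RealEllipticSectorKernel.Disproof

open MeasureTheory Set
open Literature.NumberTheory.Transcendental Literature.ModelTheory.ExponentialFields
open Summit.KontsevichZagierPeriods.KontsevichZagierPeriods.Theses.HermiteRigidity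

/-! ### §0 The crux, unbundled -/

/-- The Weierstrass cubic `f(x) = 4x³ − q₂x − q₃`. -/
def cubic (q₂ q₃ : ℚ) (x : ℝ) : ℝ := 4 * x ^ 3 - (q₂ : ℝ) * x - (q₃ : ℝ)

/-- `Δ = q₂³ − 27q₃²`. -/
def discr (q₂ q₃ : ℚ) : ℝ := (q₂ : ℝ) ^ 3 - 27 * (q₃ : ℝ) ^ 2

/-- `σ = (e₃, e₂)`, written without roots exactly as in the crux. -/
def σ₁ (q₂ q₃ : ℚ) : Set (Fin 1 → ℝ) :=
  {p | 0 < cubic q₂ q₃ (p 0) ∧ ∃ t : ℝ, p 0 < t ∧ cubic q₂ q₃ t < 0}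

/-- `σ' = (e₂, e₁)`. -/
def σ₂ (q₂ q₃ : ℚ) : Set (Fin 1 → ℝ) :=
  {p | cubic q₂ q₃ (p 0) < 0 ∧ ∃ t : ℝ, t < p 0 ∧ 0 < cubic q₂ q₃ t}

/-- `σ'' = (e₁, ∞)`. -/
def σ₃ (q₂ q₃ : ℚ) : Set (Fin 1 → ℝ) :=
  {p | 0 < cubic q₂ q₃ (p 0) ∧ ∀ t : ℝ, p 0 < t → 0 < cubic q₂ q₃ t}

/-- `J₀ = ∫_σ dx/√f`. -/
def J₀ (q₂ q₃ : ℚ) : ℝ := ∫ p in σ₁ q₂ q₃, 1 / Real.sqrt (cubic q₂ q₃ (p 0))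
/-- `J₁ = ∫_σ x dx/√f`. -/
def J₁ (q₂ q₃ : ℚ) : ℝ := ∫ p in σ₁ q₂ q₃, p 0 / Real.sqrt (cubic q₂ q₃ (p 0))
/-- `K₀ = ∫_{σ'} dx/√(−f)`. -/
def K₀ (q₂ q₃ : ℚ) : ℝ := ∫ p in σ₂ q₂ q₃, 1 / Real.sqrt (- cubic q₂ q₃ (p 0))
/-- `K₁ = ∫_{σ'} x dx/√(−f)`. -/
def K₁ (q₂ q₃ : ℚ) : ℝ := ∫ p in σ₂ q₂ q₃, p 0 / Real.sqrt (- cubic q₂ q₃ (p 0))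

/-- The inlined rigidity hypothesis of the crux (real-algebraic linear independence of
`1, J₀, J₁, K₀, K₁`). -/
def Rigidity (q₂ q₃ : ℚ) : Prop :=
  ∀ a b c d e : ℝ, IsAlgebraic ℚ a → IsAlgebraic ℚ b → IsAlgebraic ℚ c → IsAlgebraic ℚ d →
    IsAlgebraic ℚ e →
    a + b * J₀ q₂ q₃ + c * J₁ q₂ q₃ + d * K₀ q₂ q₃ + e * K₁ q₂ q₃ = 0 →
    a = 0 ∧ b = 0 ∧ c = 0 ∧ d = 0 ∧ e = 0

/-- The generating set `S` of the sector. -/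
def Gens (q₂ q₃ : ℚ) : Set KZ.FormalRep :=
  {c | ∃ (r : KZ.IntegralRep 1) (m : ℕ), r.domain = σ₁ q₂ q₃ ∧
      Set.EqOn r.integrand (fun p => p 0 ^ m / Real.sqrt (cubic q₂ q₃ (p 0))) (σ₁ q₂ q₃) ∧
      c = KZ.of r} ∪
  {c | ∃ (r : KZ.IntegralRep 1) (m : ℕ), r.domain = σ₂ q₂ q₃ ∧
      Set.EqOn r.integrand (fun p => p 0 ^ m / Real.sqrt (- cubic q₂ q₃ (p 0))) (σ₂ q₂ q₃) ∧
      c = KZ.of r} ∪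
  {c | ∃ (r : KZ.IntegralRep 1), r.domain = σ₃ q₂ q₃ ∧
      Set.EqOn r.integrand (fun p => 1 / Real.sqrt (cubic q₂ q₃ (p 0))) (σ₃ q₂ q₃) ∧
      c = KZ.of r}

/-- The kernel-form conclusion of the crux for one curve. -/
def Kernel (q₂ q₃ : ℚ) : Prop :=
  ∀ c ∈ AddSubgroup.closure (Gens q₂ q₃), KZ.eval c = 0 → c ∈ KZ.relations

/-- The crux, unbundled: `∀ q₂ q₃, 0 < Δ → Rigidity → Kernel` (definitional). -/
theorem crux_iff :
    RealEllipticSectorKernel ↔ ∀ q₂ q₃ : ℚ, 0 < discr q₂ q₃ → Rigidity q₂ q₃ → Kernel q₂ q₃ :=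
  Iff.rfl

/-! ### §1 (F1) The crux follows from the summit; a kill would refute the summit -/

/-- The summit (KZ-literal Conjecture 1) implies the crux, with the rigidity and discriminant
hypotheses unused: the kernel form `ker eval = relations` is equivalent to the summit
(`kzKernelConjecture_iff_isRational`, proved in tree) and contains `Kernel q₂ q₃` for every curve. -/
theorem of_summit (h : _root_.KontsevichZagierPeriods) : RealEllipticSectorKernel := by
  rw [crux_iff]
  intro q₂ q₃ _ _ c _ hc
  exact (kzKernelConjecture_iff_isRational.mpr h) c hc

/-- Contrapositive of `of_summit`: any refutation of the crux is a refutation of the summit. -/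
theorem not_crux_imp_not_summit (h : ¬ RealEllipticSectorKernel) : ¬ _root_.KontsevichZagierPeriods :=
  fun hs => h (of_summit hs)

/-- The shape every kill must have (by `push_neg`): a concrete curve with `Rigidity` PROVED and a
kernel element outside `relations`. Both halves are out of reach: the first is transcendence
(Schneider/Masser), the second is `¬ summit` on this sector (`not_crux_imp_not_summit`). -/
theorem not_crux_iff :
    ¬ RealEllipticSectorKernel ↔
      ∃ q₂ q₃ : ℚ, 0 < discr q₂ q₃ ∧ Rigidity q₂ q₃ ∧
        ∃ c ∈ AddSubgroup.closure (Gens q₂ q₃), KZ.eval c = 0 ∧ c ∉ KZ.relations := by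
  rw [crux_iff]
  simp only [Kernel, not_forall, exists_prop]


/-! ### §2 (F2) The discriminant hypothesis is redundant -/

/-- Factorisation of `4x³ − Ax − B` through a root `e`. [folklore] -/
theorem cubic_eq_mul_of_root {A B e : ℝ} (he : 4 * e ^ 3 - A * e - B = 0) (x : ℝ) :
    4 * x ^ 3 - A * x - B = (x - e) * (4 * x ^ 2 + 4 * e * x + (4 * e ^ 2 - A)) := by
  linear_combination he

/-- The discriminant through a root: `A³ − 27B² = (A − 3e²)(12e² − A)²`. [folklore] -/
theorem cubic_discr_eq_of_root {A B e : ℝ} (he : 4 * e ^ 3 - A * e - B = 0) :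
    A ^ 3 - 27 * B ^ 2 = (A - 3 * e ^ 2) * (12 * e ^ 2 - A) ^ 2 := by
  obtain rfl : B = 4 * e ^ 3 - A * e := by linarith
  ring

/-- A `+ → −` sign change of `4x³ − Ax − B` along increasing `x` forces `A³ − 27B² > 0`:
through the intermediate root `e`, `A³ − 27B² = (A − 3e²)(12e² − A)²` with `A − 3e² > 0`
(the quadratic cofactor is negative at `x < e`) and `12e² ≠ A` (else `f = 4(y−e)²(y+2e)` has the
sign of `y + 2e`, incompatible with `x < t`). [folklore] -/
theorem discr_pos_of_sign_change {q₂ q₃ : ℚ} {x t : ℝ} (hxt : x < t) (hx : 0 < cubic q₂ q₃ x)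
    (ht : cubic q₂ q₃ t < 0) : 0 < discr q₂ q₃ := by
  set A : ℝ := (q₂ : ℝ) with hA
  set B : ℝ := (q₃ : ℝ) with hB
  have hf : ∀ y, cubic q₂ q₃ y = 4 * y ^ 3 - A * y - B := fun y => rfl
  have hcont : Continuous (cubic q₂ q₃) := by unfold cubic; fun_prop
  obtain ⟨e, he, he0⟩ : ∃ e ∈ Ioo x t, cubic q₂ q₃ e = 0 := by
    have := intermediate_value_Ioo' hxt.le hcont.continuousOn
    exact this ⟨ht, hx⟩
  rw [hf] at he0
  have hdisc := cubic_discr_eq_of_root he0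
  have hfac := cubic_eq_mul_of_root he0
  -- the quadratic cofactor is negative at `x < e`
  have hgx : 4 * x ^ 2 + 4 * e * x + (4 * e ^ 2 - A) < 0 := by
    have h1 : 0 < (x - e) * (4 * x ^ 2 + 4 * e * x + (4 * e ^ 2 - A)) := by
      rw [← hfac, ← hf]; exact hx
    have h2 : x - e < 0 := by linarith [he.1]
    by_contra hcon
    push Not at hcon
    have : (x - e) * (4 * x ^ 2 + 4 * e * x + (4 * e ^ 2 - A)) ≤ 0 :=
      mul_nonpos_of_nonpos_of_nonneg h2.le hcon
    linarith
  have hA3 : 0 < A - 3 * e ^ 2 := by nlinarith [sq_nonneg (2 * x + e)]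
  have h12 : 12 * e ^ 2 - A ≠ 0 := by
    intro h12
    have hft : cubic q₂ q₃ t = 4 * (t - e) ^ 2 * (t + 2 * e) := by
      rw [hf, hfac]; rw [show A = 12 * e ^ 2 by linarith]; ring
    have hfx : cubic q₂ q₃ x = 4 * (x - e) ^ 2 * (x + 2 * e) := by
      rw [hf, hfac]; rw [show A = 12 * e ^ 2 by linarith]; ring
    have h1 : 0 < x + 2 * e := by
      rw [hfx] at hx
      have hxe : x - e ≠ 0 := by linarith [he.1]
      have : 0 < 4 * (x - e) ^ 2 := by
        have := lt_of_le_of_ne (sq_nonneg (x - e)) (Ne.symm (pow_ne_zero 2 hxe)); linarith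
      by_contra hcon; push Not at hcon
      have : 4 * (x - e) ^ 2 * (x + 2 * e) ≤ 0 := mul_nonpos_of_nonneg_of_nonpos this.le hcon
      linarith
    have h2 : t + 2 * e < 0 := by
      rw [hft] at ht
      have h4 : 0 ≤ 4 * (t - e) ^ 2 := by positivity
      by_contra hcon; push Not at hcon
      have : 0 ≤ 4 * (t - e) ^ 2 * (t + 2 * e) := mul_nonneg h4 hcon
      linarith
    linarith
  show 0 < A ^ 3 - 27 * B ^ 2
  rw [hdisc]
  exact mul_pos hA3 (lt_of_le_of_ne (sq_nonneg _) (Ne.symm (pow_ne_zero 2 h12)))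

/-- The rigidity hypothesis forces `σ ≠ ∅` (else `J₀ = 0` and `b = 1` violates it). -/
theorem sigma_nonempty_of_rigidity {q₂ q₃ : ℚ} (h : Rigidity q₂ q₃) : (σ₁ q₂ q₃).Nonempty := by
  by_contra hne
  rw [not_nonempty_iff_eq_empty] at hne
  have hJ : J₀ q₂ q₃ = 0 := by simp [J₀, hne]
  have := h 0 1 0 0 0 isAlgebraic_zero isAlgebraic_one isAlgebraic_zero isAlgebraic_zero
    isAlgebraic_zero (by simp [hJ])
  exact one_ne_zero this.2.1

/-- **(F2)** The inlined rigidity hypothesis already implies `0 < Δ`. -/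
theorem discr_pos_of_rigidity {q₂ q₃ : ℚ} (h : Rigidity q₂ q₃) : 0 < discr q₂ q₃ := by
  obtain ⟨p, hp, t, hpt, ht⟩ := sigma_nonempty_of_rigidity h
  exact discr_pos_of_sign_change hpt hp ht

/-- The crux with the hypothesis `0 < Δ` deleted. -/
def WithoutDiscr : Prop := ∀ q₂ q₃ : ℚ, Rigidity q₂ q₃ → Kernel q₂ q₃

/-- **(F2)** Deleting `0 < Δ` gives an equivalent statement: that hypothesis carries no weight
(information for the prover: it may be used freely, but nothing can hinge on it). -/
theorem withoutDiscr_iff : WithoutDiscr ↔ RealEllipticSectorKernel := by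
  rw [crux_iff]
  exact ⟨fun h q₂ q₃ _ hr => h q₂ q₃ hr, fun h q₂ q₃ hr => h q₂ q₃ (discr_pos_of_rigidity hr) hr⟩

/-! ### §3 (F3) Real coefficients would make the hypothesis unsatisfiable -/

/-- **(F3)** With arbitrary REAL coefficients the independence hypothesis fails for every curve
(`a = −J₀`, `b = 1`); the restriction to real-algebraic coefficients is exactly what keeps the
crux from being vacuous. (The variant crux with this hypothesis is trivially TRUE.) -/
theorem not_realCoeffRigidity (q₂ q₃ : ℚ) :
    ¬ ∀ a b c d e : ℝ,
      a + b * J₀ q₂ q₃ + c * J₁ q₂ q₃ + d * K₀ q₂ q₃ + e * K₁ q₂ q₃ = 0 →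
      a = 0 ∧ b = 0 ∧ c = 0 ∧ d = 0 ∧ e = 0 :=
  fun h => one_ne_zero (h (-J₀ q₂ q₃) 1 0 0 0 (by ring)).2.1

/-! ### §4 (F4) The proof plan consumes only ℚ-linear independence of `(J₀, J₁, K₀, K₁)` -/

/-- ℚ-linear independence of `(J₀, J₁, K₀, K₁)` (no constant slot, rational coefficients):
what Hermite reduction + the two-torsion move actually need. -/
def QRigidity (q₂ q₃ : ℚ) : Prop :=
  ∀ b c d e : ℚ,
    (b : ℝ) * J₀ q₂ q₃ + (c : ℝ) * J₁ q₂ q₃ + (d : ℝ) * K₀ q₂ q₃ + (e : ℝ) * K₁ q₂ q₃ = 0 →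
    b = 0 ∧ c = 0 ∧ d = 0 ∧ e = 0

/-- Rational numbers are real-algebraic. -/
theorem isAlgebraic_ratCast (b : ℚ) : IsAlgebraic ℚ (b : ℝ) := by
  simpa using isAlgebraic_algebraMap (R := ℚ) (A := ℝ) b

/-- The inlined hypothesis implies the ℚ-version. -/
theorem qRigidity_of_rigidity {q₂ q₃ : ℚ} (h : Rigidity q₂ q₃) : QRigidity q₂ q₃ := by
  intro b c d e hrel
  have := h 0 b c d e isAlgebraic_zero (isAlgebraic_ratCast b) (isAlgebraic_ratCast c)
    (isAlgebraic_ratCast d) (isAlgebraic_ratCast e) (by rw [zero_add]; exact hrel)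
  exact ⟨by exact_mod_cast this.2.1, by exact_mod_cast this.2.2.1, by exact_mod_cast this.2.2.2.1,
    by exact_mod_cast this.2.2.2.2⟩

/-- The sharpened crux: same conclusion under ℚ-rigidity only (no `1`-slot, no `0 < Δ`). -/
def Sharpened : Prop := ∀ q₂ q₃ : ℚ, QRigidity q₂ q₃ → Kernel q₂ q₃

/-- **(F4)** The sharpened statement implies the crux as filed; the intended proof (Hermite on
`σ`, `σ'` + two-torsion transfer + normal form) proves `Sharpened` verbatim, so the filed hypothesis
is stronger than consumed (statement weaker than it could be — not a defect). -/
theorem crux_of_sharpened (h : Sharpened) : RealEllipticSectorKernel :=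
  crux_iff.mpr fun q₂ q₃ _ hr => h q₂ q₃ (qRigidity_of_rigidity hr)

/-! ### §5 (F5) The CM-by-`i` family `q₃ = 0`: the hypothesis provably fails -/

/-- For `q₃ = 0` the cubic is odd. -/
theorem cubic_neg_of_q₃_zero (q₂ : ℚ) (x : ℝ) : cubic q₂ 0 (-x) = - cubic q₂ 0 x := by
  simp only [cubic, Rat.cast_zero, sub_zero]; ring

/-- For `q₃ = 0`, `σ' = −σ`. -/
theorem σ₂_eq_preimage_neg (q₂ : ℚ) : σ₂ q₂ 0 = (fun p => -p) ⁻¹' σ₁ q₂ 0 := by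
  ext p
  simp only [σ₁, σ₂, mem_preimage, mem_setOf_eq, Pi.neg_apply, cubic_neg_of_q₃_zero]
  constructor
  · rintro ⟨h1, t, ht, h2⟩
    refine ⟨by linarith, -t, by linarith, ?_⟩
    rw [cubic_neg_of_q₃_zero]; linarith
  · rintro ⟨h1, t, ht, h2⟩
    refine ⟨by linarith, -t, by linarith, ?_⟩
    have := cubic_neg_of_q₃_zero q₂ (-t)
    rw [neg_neg] at this
    linarith

/-- **(F5)** `K₀ = J₀` on `y² = 4x³ − q₂x` (substitute `x ↦ −x`; in the calculus this is ONE
rule-2 move, so the resulting kernel element is derivable — no counterexample here). -/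
theorem K₀_eq_J₀_of_q₃_zero (q₂ : ℚ) : K₀ q₂ 0 = J₀ q₂ 0 := by
  haveI : (volume : Measure (Fin 1 → ℝ)).IsNegInvariant :=
    Measure.IsAddHaarMeasure.isNegInvariant_of_regular _
  have hN : MeasurePreserving (fun p : Fin 1 → ℝ => -p) volume volume :=
    Measure.measurePreserving_neg _
  have hemb : MeasurableEmbedding (fun p : Fin 1 → ℝ => -p) :=
    (MeasurableEquiv.neg (Fin 1 → ℝ)).measurableEmbedding
  have key := hN.setIntegral_preimage_emb hemb
    (fun p => 1 / Real.sqrt (cubic q₂ 0 (p 0))) (σ₁ q₂ 0)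
  simp only [Pi.neg_apply, cubic_neg_of_q₃_zero] at key
  unfold K₀ J₀
  rw [σ₂_eq_preimage_neg]
  exact key

/-- **(F5)** Hence the inlined hypothesis fails on the whole family `q₃ = 0` (`b = 1, d = −1`):
the crux is vacuous there by design (these are CM curves). -/
theorem not_rigidity_q₃_zero (q₂ : ℚ) : ¬ Rigidity q₂ 0 := by
  intro h
  have := h 0 1 0 (-1) 0 isAlgebraic_zero isAlgebraic_one isAlgebraic_zero isAlgebraic_one.neg
    isAlgebraic_zero (by rw [K₀_eq_J₀_of_q₃_zero]; ring)
  exact one_ne_zero this.2.1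

/-! ### §6 (F6) Generators are honest representations and never relations -/

/-- `σ'' = (1, ∞)` for `(q₂, q₃) = (4, 0)`, i.e. `f = 4x³ − 4x = 4x(x−1)(x+1)`. -/
theorem σ₃_four_zero : σ₃ 4 0 = {p | 1 < p 0} := by
  ext p
  simp only [σ₃, cubic, mem_setOf_eq, Rat.cast_ofNat, Rat.cast_zero, sub_zero]
  constructor
  · rintro ⟨h0, hall⟩
    by_contra h1
    push Not at h1
    have hlt : p 0 < 1 / 2 := by nlinarith [h0, h1, sq_nonneg (p 0)]
    have := hall (1 / 2) hlt
    norm_num at this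
  · intro h1
    refine ⟨by nlinarith [h1, sq_nonneg (p 0)], fun t ht => ?_⟩
    have h2 : 1 < t := by linarith
    nlinarith [h2, sq_nonneg t, mul_pos (by linarith : (0:ℝ) < t) (by nlinarith : (0:ℝ) < t ^ 2 - 1)]

/-- `(1, ∞) ⊆ ℝ¹` is `ℚ`-semialgebraic. -/
theorem isSemialgebraic_Ioi_one : IsSemialgebraic ℚ {p : Fin 1 → ℝ | 1 < p 0} := by
  convert isSemialgebraic_setOf_eval_pos (k := ℚ) (R := ℝ) (MvPolynomial.X 0 - 1 : MvPolynomial (Fin 1) ℚ)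
    using 2 with p
  simp [sub_pos]

/-- `p ↦ 1/√(4(p 0)³ − 4(p 0))` is `ℚ`-semialgebraic on `(1, ∞)` (`√` of a rational function). -/
theorem integrand_semialgebraic :
    IsSemialgebraicFunOn ℚ {p : Fin 1 → ℝ | 1 < p 0} (fun p => 1 / Real.sqrt (cubic 4 0 (p 0))) := by
  have hσ := isSemialgebraic_Ioi_one
  have hne : ∀ p ∈ {p : Fin 1 → ℝ | 1 < p 0},
      MvPolynomial.aeval p (4 * MvPolynomial.X 0 ^ 3 - 4 * MvPolynomial.X 0 : MvPolynomial (Fin 1) ℚ) ≠ 0 := by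
    intro p hp
    have hp : 1 < p 0 := hp
    simp only [map_sub, map_mul, map_pow, MvPolynomial.aeval_X, map_ofNat]
    nlinarith [mul_pos (by linarith : (0:ℝ) < p 0) (by nlinarith : (0:ℝ) < p 0 ^ 2 - 1)]
  have h1 := isSemialgebraicFunOn_aeval_div_aeval hσ (1 : MvPolynomial (Fin 1) ℚ)
    (4 * MvPolynomial.X 0 ^ 3 - 4 * MvPolynomial.X 0) hne
  have h2 : IsSemialgebraicFunOn ℚ {p : Fin 1 → ℝ | 1 < p 0} (fun p => 1 / cubic 4 0 (p 0)) := by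
    refine h1.congr (fun p _ => ?_)
    simp only [map_one, map_sub, map_mul, map_pow, MvPolynomial.aeval_X, map_ofNat, cubic,
      Rat.cast_ofNat, Rat.cast_zero, sub_zero]
  have h3 := IsSemialgebraicFunOn.sqrt_holds h2
  refine h3.congr (fun p _ => ?_)
  simp only [one_div, Real.sqrt_inv]

/-- The closed-form value of the generator: `∫_{(1,∞)} dx/√(4x³−4x) = Γ(1/4)²/(4√(2π))`
(lemniscatic period; tree lemmas `GaussianLattice.integral_Ioi_inv_sqrt_cubic_scaling` and
`integral_Ioi_one_inv_sqrt_cube_sub_self`). -/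
theorem setIntegral_Ioi_one_eq :
    ∫ p in {p : Fin 1 → ℝ | 1 < p 0}, 1 / Real.sqrt (cubic 4 0 (p 0)) =
      Real.Gamma (1 / 4) ^ 2 / (4 * Real.sqrt (2 * Real.pi)) := by
  have he : MeasurePreserving (MeasurableEquiv.funUnique (Fin 1) ℝ) volume volume :=
    volume_preserving_funUnique (Fin 1) ℝ
  have hpre : {p : Fin 1 → ℝ | 1 < p 0} = (MeasurableEquiv.funUnique (Fin 1) ℝ) ⁻¹' Ioi 1 := by
    ext p; rfl
  have key := he.setIntegral_preimage_emb (MeasurableEquiv.funUnique (Fin 1) ℝ).measurableEmbedding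
    (fun x : ℝ => 1 / Real.sqrt (cubic 4 0 x)) (Ioi 1)
  rw [hpre]
  rw [show (fun p : Fin 1 → ℝ => 1 / Real.sqrt (cubic 4 0 (p 0))) =
      fun p => (fun x : ℝ => 1 / Real.sqrt (cubic 4 0 x)) (MeasurableEquiv.funUnique (Fin 1) ℝ p)
      from rfl]
  rw [key]
  have hsc := Literature.NumberTheory.EllipticCurves.GaussianLattice.integral_Ioi_inv_sqrt_cubic_scaling
    (e := 1) one_pos
  have hcub : (fun x : ℝ => 1 / Real.sqrt (cubic 4 0 x)) =
      fun x => (Real.sqrt (4 * x ^ 3 - 4 * 1 ^ 2 * x))⁻¹ := by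
    funext x
    simp only [cubic, Rat.cast_ofNat, Rat.cast_zero, sub_zero, one_pow, mul_one, one_div]
  rw [hcub, hsc, Literature.Analysis.SpecialFunctions.integral_Ioi_one_inv_sqrt_cube_sub_self,
    Real.sqrt_one]
  ring

/-- The value is positive. -/
theorem setIntegral_Ioi_one_pos :
    0 < ∫ p in {p : Fin 1 → ℝ | 1 < p 0}, 1 / Real.sqrt (cubic 4 0 (p 0)) := by
  rw [setIntegral_Ioi_one_eq]
  have h1 : 0 < Real.Gamma (1 / 4) := Real.Gamma_pos_of_pos (by norm_num)
  have h2 : 0 < Real.sqrt (2 * Real.pi) := Real.sqrt_pos.mpr (by positivity)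
  positivity

/-- Integrability of the generator's integrand, read off from the non-zero closed-form value. -/
theorem integrableOn_integrand :
    IntegrableOn (fun p : Fin 1 → ℝ => 1 / Real.sqrt (cubic 4 0 (p 0))) {p | 1 < p 0} := by
  by_contra h
  have h0 := integral_undef h
  have hpos := setIntegral_Ioi_one_pos
  rw [h0] at hpos
  exact lt_irrefl _ hpos

/-- **(F6)** The generator `[ (1,∞), 1/√(4x³ − 4x) ]` of the `(4,0)`-sector as an honest
`IntegralRep 1` (semialgebraic domain and integrand, absolutely integrable). -/
def genIoi : KZ.IntegralRep 1 where
  domain := {p | 1 < p 0}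
  integrand := fun p => 1 / Real.sqrt (cubic 4 0 (p 0))
  isSemialgebraic_domain := isSemialgebraic_Ioi_one
  isSemialgebraicFunOn_integrand := integrand_semialgebraic
  integrableOn := integrableOn_integrand

/-- `genIoi` is a generator of the `(4,0)`-sector (third family, `σ'' = (1,∞)`). -/
theorem genIoi_mem_gens : KZ.of genIoi ∈ Gens 4 0 := by
  refine Or.inr ⟨genIoi, ?_, fun p _ => rfl, rfl⟩
  rw [σ₃_four_zero]; rfl

/-- Its value: `Γ(1/4)²/(4√(2π))`. -/
theorem genIoi_value : genIoi.value = Real.Gamma (1 / 4) ^ 2 / (4 * Real.sqrt (2 * Real.pi)) :=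
  setIntegral_Ioi_one_eq

/-- **(F6)** A generator is not a relation (soundness + non-zero value). -/
theorem of_genIoi_not_mem_relations : KZ.of genIoi ∉ KZ.relations := by
  intro h
  have h0 := KZ.relations_le_ker_eval_holds h
  rw [AddMonoidHom.mem_ker, KZ.eval_of] at h0
  have hpos : 0 < genIoi.value := setIntegral_Ioi_one_pos
  rw [h0] at hpos
  exact lt_irrefl _ hpos

/-- The crux with `eval c = 0` deleted (and rigidity deleted too — it cannot be discharged in Lean
for any curve, see F1). -/
def KernelWithoutEval : Prop :=
  ∀ q₂ q₃ : ℚ, 0 < discr q₂ q₃ → ∀ c ∈ AddSubgroup.closure (Gens q₂ q₃), c ∈ KZ.relations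

/-- **(F6)** … is false: witness `(q₂,q₃) = (4,0)`, `c = [genIoi]`. -/
theorem not_kernelWithoutEval : ¬ KernelWithoutEval := fun h =>
  of_genIoi_not_mem_relations
    (h 4 0 (by norm_num [discr]) _ (AddSubgroup.subset_closure genIoi_mem_gens))

/-! ### §7 (F7) The `EqOn`-presentation junk is derivable -/

/-- The empty representation (restriction of any `r` to `∅`) is a relation: `[e] − [e] − [e]` is a
domain-additivity move. -/
theorem of_restrict_empty_mem {n : ℕ} (r : KZ.IntegralRep n) :
    KZ.of (r.restrict ∅ isSemialgebraic_empty (empty_subset _)) ∈ KZ.relations := by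
  set e := r.restrict ∅ isSemialgebraic_empty (empty_subset _) with he
  have h : KZ.of e - KZ.of e - KZ.of e ∈ KZ.domainAddRel :=
    ⟨n, e, e, e, by simp [e], by simp [e], fun _ _ => rfl, fun _ _ => rfl, rfl⟩
  have h1 := KZ.domainAddRel_subset_relations h
  rw [sub_self, zero_sub] at h1
  exact neg_mem_iff.mp h1

/-- **(F7)** Two representations with the same domain whose integrands agree ON the domain are
equivalent (one rule-1a move splitting off the empty representation). So the many generators of
`S` presenting the same integral differ by relations, as the kernel conclusion demands. -/
theorem equivalent_of_eqOn {n : ℕ} {r r' : KZ.IntegralRep n} (hd : r'.domain = r.domain)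
    (hi : EqOn r.integrand r'.integrand r.domain) : KZ.Equivalent r r' := by
  set e := r.restrict ∅ isSemialgebraic_empty (empty_subset _) with he
  have h : KZ.of r - KZ.of r' - KZ.of e ∈ KZ.domainAddRel :=
    ⟨n, r, r', e, by simp [e, hd], by simp [e], by rw [hd]; exact hi, by simp [e], rfl⟩
  have h1 := KZ.domainAddRel_subset_relations h
  have h2 := of_restrict_empty_mem r
  have h3 := KZ.relations.add_mem h1 h2
  simpa [KZ.Equivalent, e] using h3


/-! ### §8 Complements: `K₁ = −J₁` at `q₃ = 0`; `Δ ≤ 0` curves; semialgebraicity of the three ovals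

Positive by-products the provers need for EVERY move on this sector (rule 1a/2/3 all ask
`IsSemialgebraic ℚ` of the domains): the root-free, quantified descriptions `σ, σ', σ''` of the
crux ARE `ℚ`-semialgebraic, uniformly in `q₂ q₃`, by the projection theorem
(`IsSemialgebraic.image_comp`, Tarski–Seidenberg proved in tree) — no root analysis needed. -/

/-- `K₁ = −J₁` on `y² = 4x³ − q₂x` (same substitution `x ↦ −x`). -/
theorem K₁_eq_neg_J₁_of_q₃_zero (q₂ : ℚ) : K₁ q₂ 0 = - J₁ q₂ 0 := by
  haveI : (volume : Measure (Fin 1 → ℝ)).IsNegInvariant :=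
    Measure.IsAddHaarMeasure.isNegInvariant_of_regular _
  have hN : MeasurePreserving (fun p : Fin 1 → ℝ => -p) volume volume :=
    Measure.measurePreserving_neg _
  have hemb : MeasurableEmbedding (fun p : Fin 1 → ℝ => -p) :=
    (MeasurableEquiv.neg (Fin 1 → ℝ)).measurableEmbedding
  have key := hN.setIntegral_preimage_emb hemb
    (fun p => p 0 / Real.sqrt (cubic q₂ 0 (p 0))) (σ₁ q₂ 0)
  simp only [Pi.neg_apply, cubic_neg_of_q₃_zero] at key
  unfold K₁ J₁
  rw [σ₂_eq_preimage_neg, ← key, ← integral_neg]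
  refine integral_congr_ae (Filter.Eventually.of_forall fun p => ?_)
  simp only [neg_div]
  ring

/-- On `Δ ≤ 0` curves the inlined hypothesis fails (contrapositive of `discr_pos_of_rigidity`):
the crux is vacuously true there, so `0 < Δ` excludes nothing. -/
theorem not_rigidity_of_discr_nonpos {q₂ q₃ : ℚ} (h : discr q₂ q₃ ≤ 0) : ¬ Rigidity q₂ q₃ :=
  fun hr => absurd (discr_pos_of_rigidity hr) (not_lt.mpr h)

/-- The cubic as the evaluation of a `ℚ`-polynomial in the `i`-th coordinate. -/
theorem aeval_cubicPoly {n : ℕ} (q₂ q₃ : ℚ) (i : Fin n) (w : Fin n → ℝ) :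
    MvPolynomial.aeval w (4 * MvPolynomial.X i ^ 3 - MvPolynomial.C q₂ * MvPolynomial.X i -
      MvPolynomial.C q₃ : MvPolynomial (Fin n) ℚ) = cubic q₂ q₃ (w i) := by
  simp [cubic]

/-- `{w | 0 < f (w i)}` is `ℚ`-semialgebraic. -/
theorem isSemialgebraic_cubic_pos {n : ℕ} (q₂ q₃ : ℚ) (i : Fin n) :
    IsSemialgebraic ℚ {w : Fin n → ℝ | 0 < cubic q₂ q₃ (w i)} := by
  convert isSemialgebraic_setOf_eval_pos (k := ℚ) (R := ℝ)
    (4 * MvPolynomial.X i ^ 3 - MvPolynomial.C q₂ * MvPolynomial.X i -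
      MvPolynomial.C q₃ : MvPolynomial (Fin n) ℚ) using 1
  ext w
  rw [mem_setOf_eq, mem_setOf_eq, aeval_cubicPoly]

/-- `{w | f (w i) < 0}` is `ℚ`-semialgebraic. -/
theorem isSemialgebraic_cubic_neg {n : ℕ} (q₂ q₃ : ℚ) (i : Fin n) :
    IsSemialgebraic ℚ {w : Fin n → ℝ | cubic q₂ q₃ (w i) < 0} := by
  convert isSemialgebraic_setOf_eval_pos (k := ℚ) (R := ℝ)
    (-(4 * MvPolynomial.X i ^ 3 - MvPolynomial.C q₂ * MvPolynomial.X i -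
      MvPolynomial.C q₃) : MvPolynomial (Fin n) ℚ) using 1
  ext w
  rw [mem_setOf_eq, mem_setOf_eq, map_neg, aeval_cubicPoly, neg_pos]

/-- `{w | w i < w j}` is `ℚ`-semialgebraic. -/
theorem isSemialgebraic_lt {n : ℕ} (i j : Fin n) :
    IsSemialgebraic ℚ {w : Fin n → ℝ | w i < w j} := by
  convert isSemialgebraic_setOf_eval_pos (k := ℚ) (R := ℝ)
    (MvPolynomial.X j - MvPolynomial.X i : MvPolynomial (Fin n) ℚ) using 2 with w
  simp [sub_pos]

/-- **`σ = (e₃,e₂)` as typed in the crux is `ℚ`-semialgebraic** (projection of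
`{(x,t) | f x > 0, x < t, f t < 0} ⊆ ℝ²`). -/
theorem isSemialgebraic_σ₁ (q₂ q₃ : ℚ) : IsSemialgebraic ℚ (σ₁ q₂ q₃) := by
  have hT : IsSemialgebraic ℚ
      {w : Fin 2 → ℝ | 0 < cubic q₂ q₃ (w 0) ∧ w 0 < w 1 ∧ cubic q₂ q₃ (w 1) < 0} := by
    convert ((isSemialgebraic_cubic_pos q₂ q₃ (0 : Fin 2)).inter (isSemialgebraic_lt (0 : Fin 2) 1)).inter
      (isSemialgebraic_cubic_neg q₂ q₃ (1 : Fin 2)) using 1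
    ext w
    simp [and_assoc]
  convert hT.image_comp (fun _ : Fin 1 => (0 : Fin 2)) using 1
  ext p
  simp only [σ₁, mem_setOf_eq, mem_image, Function.comp_def]
  constructor
  · rintro ⟨hp, t, hpt, ht⟩
    refine ⟨![p 0, t], ⟨by simpa using hp, by simpa using hpt, by simpa using ht⟩, ?_⟩
    funext i
    rw [Fin.fin_one_eq_zero i]
    simp
  · rintro ⟨w, ⟨h0, h01, h1⟩, rfl⟩
    exact ⟨h0, w 1, h01, h1⟩

/-- **`σ' = (e₂,e₁)` as typed in the crux is `ℚ`-semialgebraic.** -/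
theorem isSemialgebraic_σ₂ (q₂ q₃ : ℚ) : IsSemialgebraic ℚ (σ₂ q₂ q₃) := by
  have hT : IsSemialgebraic ℚ
      {w : Fin 2 → ℝ | cubic q₂ q₃ (w 0) < 0 ∧ w 1 < w 0 ∧ 0 < cubic q₂ q₃ (w 1)} := by
    convert ((isSemialgebraic_cubic_neg q₂ q₃ (0 : Fin 2)).inter (isSemialgebraic_lt (1 : Fin 2) 0)).inter
      (isSemialgebraic_cubic_pos q₂ q₃ (1 : Fin 2)) using 1
    ext w
    simp [and_assoc]
  convert hT.image_comp (fun _ : Fin 1 => (0 : Fin 2)) using 1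
  ext p
  simp only [σ₂, mem_setOf_eq, mem_image, Function.comp_def]
  constructor
  · rintro ⟨hp, t, hpt, ht⟩
    refine ⟨![p 0, t], ⟨by simpa using hp, by simpa using hpt, by simpa using ht⟩, ?_⟩
    funext i
    rw [Fin.fin_one_eq_zero i]
    simp
  · rintro ⟨w, ⟨h0, h01, h1⟩, rfl⟩
    exact ⟨h0, w 1, h01, h1⟩

/-- **`σ'' = (e₁,∞)` as typed in the crux is `ℚ`-semialgebraic** (`{f > 0}` minus the projection
of `{(x,t) | x < t, f t ≤ 0}`). -/
theorem isSemialgebraic_σ₃ (q₂ q₃ : ℚ) : IsSemialgebraic ℚ (σ₃ q₂ q₃) := by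
  have hT : IsSemialgebraic ℚ {w : Fin 2 → ℝ | w 0 < w 1 ∧ ¬ 0 < cubic q₂ q₃ (w 1)} :=
    (isSemialgebraic_lt (0 : Fin 2) 1).inter (isSemialgebraic_cubic_pos q₂ q₃ (1 : Fin 2)).compl
  have hI := hT.image_comp (fun _ : Fin 1 => (0 : Fin 2))
  convert (isSemialgebraic_cubic_pos q₂ q₃ (0 : Fin 1)).inter hI.compl using 1
  ext p
  constructor
  · rintro ⟨hp, hall⟩
    refine ⟨hp, ?_⟩
    rintro ⟨w, ⟨hw01, hw1⟩, hwp⟩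
    have h0 : w 0 = p 0 := by simpa using congr_fun hwp 0
    exact hw1 (hall (w 1) (h0.symm.trans_lt hw01))
  · rintro ⟨hp, hno⟩
    refine ⟨hp, fun t ht => ?_⟩
    by_contra hcon
    refine hno ⟨![p 0, t], ⟨by simpa using ht, by simpa using hcon⟩, ?_⟩
    funext i
    rw [Fin.fin_one_eq_zero i]
    simp


/-! ### §9 (F9, cycle 2) The rational CM curve `(q₂,q₃) = (44,−56)`, `j = 66³ = 287496`:
an INTEGER period relation `J₀ = 2K₀` off the mirror family

`f = 4x³ − 44x + 56 = 4(x − 2)(x² + 2x − 7)`, roots `e₃ = −1−2√2 < e₂ = −1+2√2 < e₁ = 2`,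
`Δ = 512 > 0`, CM by `ℤ[2i]` (`τ = i/2`). The 2-torsion point `(2,0)` is RATIONAL, and Vélu's
2-isogeny with kernel `⟨(2,0)⟩`, `φ(x) = x + 1/(x−2)`, lands on `Y² = u³ − 16u` (`j = 1728`) with
`f₆₄(φ x) = f(x)·φ′(x)²` EXACTLY (`CM66.Ψ_key`, `Ψ = −φ/4` rescales to `4w³ − 4w`). Three real
substitutions (`Ψ` on `(e₂,2)`, `Ψ` on each half of the oval cut at the fold `x = 1`, and `w ↦ 1/w`)
and NO transcendence input give, in closed form,
`J₀(44,−56) = Γ(1/4)²/(4√(2π)) = 2·K₀(44,−56)` (`J₀_cm`, `K₀_cm`, `J₀_eq_two_mul_K₀_cm`).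
Consequences: `¬ QRigidity 44 (−56)` and `¬ Rigidity 44 (−56)` — the crux AND its ℚ-sharpening
(F4, the target of the ideators' integer-normal-form line) are VACUOUS at this curve although
`q₃ ≠ 0` (refuted strengthening `not_intIndependentOffMirror`: integer relations are not confined to
the mirror family `q₃ = 0` of F5); and the summit predicts that the kernel element
`u₀ = [σ, 1/√f] − 2[σ′, 1/√(−f)]` (`cmElem`, honest representations, `eval = 0`) is a relation,
which needs BOTH an additivity move (`coeffSum u₀ = −1`) AND a move of type (2)/(3)
(`restrictedEval ≠ 0`) — on paper: rule 1a at the fold, the rational isogeny `φ` twice (rule 2),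
`φ` on `σ′` then `u ↦ −u` (rule 2 ×2), the two-torsion move of `u³ − 16u` (rule 2), bookkeeping.
This is a support statement the route does NOT have (`CMIsogenyTransfer`; the filed CMTwist supports
are `j = 8000` only), recorded for the planner's "NOT DECOMPOSED YET (i)". -/

namespace CM66


/-- half lemniscatic constant `Λ/2 = Γ(1/4)²/(4√(2π))`. -/
def lemHalf : ℝ := Real.Gamma (1 / 4) ^ 2 / (4 * Real.sqrt (2 * Real.pi))

theorem lemHalf_pos : 0 < lemHalf := by
  unfold lemHalf
  have h1 : 0 < Real.Gamma (1 / 4) := Real.Gamma_pos_of_pos (by norm_num)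
  have h2 : 0 < Real.sqrt (2 * Real.pi) := Real.sqrt_pos.mpr (by positivity)
  positivity

/-- `g(v) = 1/√(4v³ − 4v)` (the (4,0)-integrand). -/
def gI (v : ℝ) : ℝ := (Real.sqrt (4 * v ^ 3 - 4 * v))⁻¹

/-- `h(w) = 1/√(4w − 4w³)` (the (4,0)-twist integrand on (0,1)). -/
def hI (w : ℝ) : ℝ := (Real.sqrt (4 * w - 4 * w ^ 3))⁻¹

theorem integral_gI_Ioi : ∫ v in Ioi (1:ℝ), gI v = lemHalf := by
  have hsc := Literature.NumberTheory.EllipticCurves.GaussianLattice.integral_Ioi_inv_sqrt_cubic_scaling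
    (e := 1) one_pos
  simp only [one_pow, mul_one, Real.sqrt_one] at hsc
  unfold gI lemHalf
  rw [hsc, Literature.Analysis.SpecialFunctions.integral_Ioi_one_inv_sqrt_cube_sub_self]
  ring

theorem integrableOn_gI_Ioi : IntegrableOn gI (Ioi (1:ℝ)) := by
  by_contra h
  have h0 := integral_undef h
  have := integral_gI_Ioi
  rw [h0] at this
  exact absurd this.symm (ne_of_gt lemHalf_pos)

/-- inversion `ρ v = v⁻¹` maps `(1,∞)` onto `(0,1)`. -/
theorem image_inv_Ioi_one : (fun v : ℝ => v⁻¹) '' Ioi (1:ℝ) = Ioo 0 1 := by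
  ext w
  simp only [mem_image, mem_Ioi, mem_Ioo]
  constructor
  · rintro ⟨v, hv, rfl⟩
    exact ⟨by positivity, inv_lt_one_of_one_lt₀ hv⟩
  · rintro ⟨h0, h1⟩
    exact ⟨w⁻¹, one_lt_inv₀ h0 |>.mpr h1, inv_inv w⟩

theorem hasDerivAt_inv' {v : ℝ} (hv : v ≠ 0) : HasDerivAt (fun v : ℝ => v⁻¹) (-(v ^ 2)⁻¹) v := by
  simpa using hasDerivAt_inv hv

/-- the pointwise weight identity for `ρ`. -/
theorem inv_weight {v : ℝ} (hv : 1 < v) : |-(v ^ 2)⁻¹| • hI v⁻¹ = gI v := by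
  have hv0 : 0 < v := by linarith
  have hv2 : 0 < v ^ 2 := by positivity
  rw [abs_neg, abs_of_pos (inv_pos.mpr hv2), smul_eq_mul]
  unfold hI gI
  have hq : 4 * v⁻¹ - 4 * v⁻¹ ^ 3 = (4 * v ^ 3 - 4 * v) / (v ^ 2) ^ 2 := by
    field_simp
  rw [hq, Real.sqrt_div' _ (by positivity), Real.sqrt_sq hv2.le]
  have hpos : 0 < 4 * v ^ 3 - 4 * v := by nlinarith
  have hs : 0 < Real.sqrt (4 * v ^ 3 - 4 * v) := Real.sqrt_pos.mpr hpos
  field_simp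

theorem integral_hI_Ioo : ∫ w in Ioo (0:ℝ) 1, hI w = lemHalf := by
  have key := integral_image_eq_integral_abs_deriv_smul (s := Ioi (1:ℝ)) (f := fun v : ℝ => v⁻¹)
    (f' := fun v => -(v ^ 2)⁻¹) measurableSet_Ioi
    (fun v hv => (hasDerivAt_inv' (by simp only [mem_Ioi] at hv; linarith)).hasDerivWithinAt)
    (fun a ha b hb hab => inv_injective hab) hI
  rw [image_inv_Ioi_one] at key
  rw [key, ← integral_gI_Ioi]
  refine setIntegral_congr_fun measurableSet_Ioi (fun v hv => ?_)
  exact inv_weight hv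

theorem integrableOn_hI_Ioo : IntegrableOn hI (Ioo (0:ℝ) 1) := by
  have key := integrableOn_image_iff_integrableOn_abs_deriv_smul (s := Ioi (1:ℝ)) (f := fun v : ℝ => v⁻¹)
    (f' := fun v => -(v ^ 2)⁻¹) measurableSet_Ioi
    (fun v hv => (hasDerivAt_inv' (by simp only [mem_Ioi] at hv; linarith)).hasDerivWithinAt)
    (fun a ha b hb hab => inv_injective hab) hI
  rw [image_inv_Ioi_one] at key
  rw [key]
  exact integrableOn_gI_Ioi.congr_fun (fun v hv => (inv_weight hv).symm) measurableSet_Ioi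

/-- reflection: `∫_{(-1,0)} dx/√(4x³−4x) = ∫_{(0,1)} dw/√(4w−4w³)`. -/
theorem integral_gI_Ioo_neg : ∫ x in Ioo (-1:ℝ) 0, gI x = lemHalf := by
  have key := integral_image_eq_integral_abs_deriv_smul (s := Ioo (0:ℝ) 1) (f := fun w : ℝ => -w)
    (f' := fun _ => -1) measurableSet_Ioo
    (fun w _ => (hasDerivAt_neg w).hasDerivWithinAt) (fun a _ b _ hab => neg_injective hab) gI
  have himg : (fun w : ℝ => -w) '' Ioo (0:ℝ) 1 = Ioo (-1) 0 := by
    simp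
  rw [himg] at key
  rw [key, ← integral_hI_Ioo]
  refine setIntegral_congr_fun measurableSet_Ioo (fun w hw => ?_)
  simp only [abs_neg, abs_one, one_smul, gI, hI]
  congr 1
  congr 1
  ring


/-! ### The CM curve `(q₂,q₃) = (44, −56)`: `f = 4x³ − 44x + 56 = 4(x−2)(x²+2x−7)`, `j = 66³` -/

/-- `f(x) = 4x³ − 44x + 56`. -/
def fcm (x : ℝ) : ℝ := 4 * x ^ 3 - 44 * x + 56

/-- middle root `e₂ = −1 + 2√2`. -/
def e₂ : ℝ := -1 + 2 * Real.sqrt 2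
/-- smallest root `e₃ = −1 − 2√2`. -/
def e₃ : ℝ := -1 - 2 * Real.sqrt 2

theorem sqrt2_sq : Real.sqrt 2 ^ 2 = 2 := Real.sq_sqrt (by norm_num)

theorem sqrt2_gt : (1.41 : ℝ) < Real.sqrt 2 := by
  rw [show (1.41:ℝ) = Real.sqrt (1.41 ^ 2) by rw [Real.sqrt_sq (by norm_num)]]
  exact Real.sqrt_lt_sqrt (by norm_num) (by norm_num)

theorem sqrt2_lt : Real.sqrt 2 < (1.42 : ℝ) := by
  rw [show (1.42:ℝ) = Real.sqrt (1.42 ^ 2) by rw [Real.sqrt_sq (by norm_num)]]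
  exact Real.sqrt_lt_sqrt (by norm_num) (by norm_num)

theorem fcm_factor (x : ℝ) : fcm x = 4 * (x - 2) * ((x - e₂) * (x - e₃)) := by
  have h : (x - e₂) * (x - e₃) = (x + 1) ^ 2 - 4 * Real.sqrt 2 ^ 2 := by
    unfold e₂ e₃; ring
  rw [h, sqrt2_sq]
  unfold fcm
  ring

theorem e₃_lt_e₂ : e₃ < e₂ := by unfold e₂ e₃; nlinarith [sqrt2_gt]
theorem e₂_lt_two : e₂ < 2 := by unfold e₂; nlinarith [sqrt2_lt]
theorem one_lt_e₂ : 1 < e₂ := by unfold e₂; nlinarith [sqrt2_gt]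
theorem e₂_lt_19 : e₂ < 1.9 := by unfold e₂; nlinarith [sqrt2_lt]
theorem e₃_lt_one : e₃ < 1 := by unfold e₃; nlinarith [sqrt2_gt]

/-- sign of `f` on `(e₃, e₂)`. -/
theorem fcm_pos_of_mem {x : ℝ} (h3 : e₃ < x) (h2 : x < e₂) : 0 < fcm x := by
  rw [fcm_factor]
  have hx2 : x - 2 < 0 := by linarith [e₂_lt_two]
  have hq : (x - e₂) * (x - e₃) < 0 := mul_neg_of_neg_of_pos (by linarith) (by linarith)
  nlinarith

/-- sign of `f` on `(e₂, 2)`. -/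
theorem fcm_neg_of_mem {x : ℝ} (h2 : e₂ < x) (h : x < 2) : fcm x < 0 := by
  rw [fcm_factor]
  have hx2 : x - 2 < 0 := by linarith
  have hq : 0 < (x - e₂) * (x - e₃) := mul_pos (by linarith) (by linarith [e₃_lt_e₂])
  nlinarith

/-- `f t < 0 ⇒ t < 2`. -/
theorem lt_two_of_fcm_neg {t : ℝ} (ht : fcm t < 0) : t < 2 := by
  by_contra h
  push Not at h
  rw [fcm_factor] at ht
  have h1 : 0 ≤ t - 2 := by linarith
  have h2 : 0 ≤ (t - e₂) * (t - e₃) :=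
    mul_nonneg (by linarith [e₂_lt_two]) (by linarith [e₃_lt_e₂, e₂_lt_two])
  nlinarith [mul_nonneg h1 h2]

/-- `0 < f x`, `x < 2` ⇒ `e₃ < x < e₂`. -/
theorem mem_of_fcm_pos_of_lt_two {x : ℝ} (hx : 0 < fcm x) (h2 : x < 2) : e₃ < x ∧ x < e₂ := by
  rw [fcm_factor] at hx
  have hx2 : x - 2 < 0 := by linarith
  have hq : (x - e₂) * (x - e₃) < 0 := by nlinarith
  constructor
  · by_contra h; push Not at h
    have : 0 ≤ (x - e₂) * (x - e₃) :=
      mul_nonneg_of_nonpos_of_nonpos (by linarith [e₃_lt_e₂]) (by linarith)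
    linarith
  · by_contra h; push Not at h
    have : 0 ≤ (x - e₂) * (x - e₃) := mul_nonneg (by linarith) (by linarith [e₃_lt_e₂])
    linarith

/-- `f x < 0`, `x < 2` ⇒ `x < e₃ ∨ e₂ < x`. -/
theorem of_fcm_neg_of_lt_two {x : ℝ} (hx : fcm x < 0) (h2 : x < 2) : x < e₃ ∨ e₂ < x := by
  rw [fcm_factor] at hx
  have hx2 : x - 2 < 0 := by linarith
  have hq : 0 < (x - e₂) * (x - e₃) := by nlinarith
  by_contra h
  push Not at h
  have : (x - e₂) * (x - e₃) ≤ 0 := mul_nonpos_of_nonpos_of_nonneg (by linarith [h.2]) (by linarith [h.1])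
  linarith

/-- The crux's root-free `σ` at `(44,−56)` is `(e₃, e₂)` (ℝ-level). -/
theorem sigma_cm_iff (x : ℝ) : (0 < fcm x ∧ ∃ t : ℝ, x < t ∧ fcm t < 0) ↔ e₃ < x ∧ x < e₂ := by
  constructor
  · rintro ⟨hx, t, hxt, ht⟩
    exact mem_of_fcm_pos_of_lt_two hx (hxt.trans (lt_two_of_fcm_neg ht))
  · rintro ⟨h3, h2⟩
    refine ⟨fcm_pos_of_mem h3 h2, 1.9, h2.trans e₂_lt_19, ?_⟩
    norm_num [fcm]

/-- The crux's root-free `σ'` at `(44,−56)` is `(e₂, 2)` (ℝ-level). -/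
theorem sigma'_cm_iff (x : ℝ) : (fcm x < 0 ∧ ∃ t : ℝ, t < x ∧ 0 < fcm t) ↔ e₂ < x ∧ x < 2 := by
  constructor
  · rintro ⟨hx, t, htx, ht⟩
    have hx2 := lt_two_of_fcm_neg hx
    rcases of_fcm_neg_of_lt_two hx hx2 with h | h
    · exfalso
      have ht3 : t < e₃ := htx.trans h
      rw [fcm_factor] at ht
      have : (t - 2) < 0 := by linarith [e₃_lt_e₂, e₂_lt_two]
      have hq : 0 < (t - e₂) * (t - e₃) :=
        mul_pos_of_neg_of_neg (by linarith [e₃_lt_e₂]) (by linarith)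
      nlinarith
    · exact ⟨h, hx2⟩
  · rintro ⟨h2, hx2⟩
    refine ⟨fcm_neg_of_mem h2 hx2, 0, by linarith [one_lt_e₂], by norm_num [fcm]⟩

/-! ### The isogeny substitution `Ψ(x) = −(x + 1/(x−2))/4` -/

/-- `Ψ = −φ/4`, `φ(x) = x + 1/(x − 2)` the Vélu 2-isogeny with kernel `(2,0)`. -/
def Ψ (x : ℝ) : ℝ := -(x + (x - 2)⁻¹) / 4

/-- `Ψ'`. -/
def Ψ' (x : ℝ) : ℝ := -(1 - ((x - 2) ^ 2)⁻¹) / 4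

theorem hasDerivAt_Ψ {x : ℝ} (hx : x ≠ 2) : HasDerivAt Ψ (Ψ' x) x := by
  have hx' : x - 2 ≠ 0 := sub_ne_zero.mpr hx
  have h1 : HasDerivAt (fun y : ℝ => (y - 2)⁻¹) (-(1:ℝ) / (x - 2) ^ 2) x :=
    ((hasDerivAt_id x).sub_const 2).inv hx'
  have h2 := ((hasDerivAt_id x).add h1).neg.div_const 4
  have h3 : HasDerivAt (fun y : ℝ => -(id y + (y - 2)⁻¹) / 4) (Ψ' x) x := by
    refine h2.congr_deriv ?_
    unfold Ψ'
    ring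
  exact h3

/-- **The isogeny weight identity**: `4Ψ³ − 4Ψ = −f·Ψ'²/4` (i.e. `f′(φ) = f φ′²` for the target
cubic `f′(u) = 4u³ − 64u`). -/
theorem Ψ_key {x : ℝ} (hx : x ≠ 2) : 4 * Ψ x ^ 3 - 4 * Ψ x = -(fcm x) * Ψ' x ^ 2 / 4 := by
  have hx' : x - 2 ≠ 0 := sub_ne_zero.mpr hx
  unfold Ψ Ψ' fcm
  field_simp
  ring

theorem Ψ_e₂ : Ψ e₂ = 1 := by
  have h2 := sqrt2_sq
  unfold Ψ
  rw [div_eq_iff (by norm_num : (4:ℝ) ≠ 0)]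
  have hprod : (e₂ - 2) * (-(3 + 2 * Real.sqrt 2)) = 1 := by
    unfold e₂; nlinarith [h2]
  rw [inv_eq_of_mul_eq_one_right hprod]
  unfold e₂
  ring

theorem Ψ_e₃ : Ψ e₃ = 1 := by
  have h2 := sqrt2_sq
  unfold Ψ
  rw [div_eq_iff (by norm_num : (4:ℝ) ≠ 0)]
  have hprod : (e₃ - 2) * (-(3 - 2 * Real.sqrt 2)) = 1 := by
    unfold e₃; nlinarith [h2]
  rw [inv_eq_of_mul_eq_one_right hprod]
  unfold e₃
  ring

theorem Ψ_one : Ψ 1 = 0 := by norm_num [Ψ]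

theorem quad_factor (x : ℝ) : (x - e₂) * (x - e₃) = x ^ 2 + 2 * x - 7 := by
  have h : (x - e₂) * (x - e₃) = (x + 1) ^ 2 - 4 * Real.sqrt 2 ^ 2 := by
    unfold e₂ e₃; ring
  rw [h, sqrt2_sq]; ring

theorem Ψ_eq {x : ℝ} (hx : x ≠ 2) : Ψ x = -((x - 1) ^ 2) / (4 * (x - 2)) := by
  have hx' : x - 2 ≠ 0 := sub_ne_zero.mpr hx
  unfold Ψ
  field_simp
  ring

theorem Ψ_sub_one {x : ℝ} (hx : x ≠ 2) : Ψ x - 1 = -((x - e₂) * (x - e₃)) / (4 * (x - 2)) := by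
  have hx' : x - 2 ≠ 0 := sub_ne_zero.mpr hx
  rw [quad_factor]
  unfold Ψ
  field_simp
  ring

theorem Ψ_pos {x : ℝ} (hx2 : x < 2) (hx1 : x ≠ 1) : 0 < Ψ x := by
  rw [Ψ_eq hx2.ne]
  have h1 : 0 < (x - 1) ^ 2 := by positivity
  have h2 : 4 * (x - 2) < 0 := by linarith
  exact div_pos_of_neg_of_neg (by linarith) h2

theorem Ψ_lt_one {x : ℝ} (h3 : e₃ < x) (h2 : x < e₂) : Ψ x < 1 := by
  have hx2 : x < 2 := h2.trans e₂_lt_two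
  have key := Ψ_sub_one hx2.ne
  have hq : (x - e₂) * (x - e₃) < 0 := mul_neg_of_neg_of_pos (by linarith) (by linarith)
  have : -((x - e₂) * (x - e₃)) / (4 * (x - 2)) < 0 :=
    div_neg_of_pos_of_neg (by linarith) (by linarith)
  linarith

theorem one_lt_Ψ {x : ℝ} (h2 : e₂ < x) (hx2 : x < 2) : 1 < Ψ x := by
  have key := Ψ_sub_one hx2.ne
  have hq : 0 < (x - e₂) * (x - e₃) := mul_pos (by linarith) (by linarith [e₃_lt_e₂])
  have : 0 < -((x - e₂) * (x - e₃)) / (4 * (x - 2)) :=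
    div_pos_of_neg_of_neg (by linarith) (by linarith)
  linarith

theorem continuousOn_Ψ {S : Set ℝ} (hS : ∀ x ∈ S, x ≠ 2) : ContinuousOn Ψ S :=
  fun x hx => (hasDerivAt_Ψ (hS x hx)).continuousAt.continuousWithinAt

/-- injectivity of `Ψ` away from the involution `(x−2)(y−2) = 1`. -/
theorem Ψ_injOn {S : Set ℝ} (hS : ∀ x ∈ S, x ≠ 2)
    (hprod : ∀ x ∈ S, ∀ y ∈ S, (x - 2) * (y - 2) ≠ 1) : InjOn Ψ S := by
  intro x hx y hy hxy
  have ha : x - 2 ≠ 0 := sub_ne_zero.mpr (hS x hx)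
  have hb : y - 2 ≠ 0 := sub_ne_zero.mpr (hS y hy)
  unfold Ψ at hxy
  have h1 : x + (x - 2)⁻¹ = y + (y - 2)⁻¹ := by linarith
  have ea : (x - 2) * (x - 2)⁻¹ = 1 := mul_inv_cancel₀ ha
  have eb : (y - 2) * (y - 2)⁻¹ = 1 := mul_inv_cancel₀ hb
  have h3 : (x + (x - 2)⁻¹) * ((x - 2) * (y - 2)) = (y + (y - 2)⁻¹) * ((x - 2) * (y - 2)) := by
    rw [h1]
  have h2 : (x - y) * ((x - 2) * (y - 2) - 1) = 0 := by
    linear_combination h3 - (y - 2) * ea + (x - 2) * eb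
  rcases mul_eq_zero.mp h2 with h | h
  · linarith
  · exact absurd (by linarith : (x - 2) * (y - 2) = 1) (hprod x hx y hy)

theorem Ψ_injOn₁ : InjOn Ψ (Ioo e₂ 2) := by
  refine Ψ_injOn (fun x hx => hx.2.ne) (fun x hx y hy => ?_)
  have h1 : -1 < x - 2 := by linarith [hx.1, one_lt_e₂]
  have h2 : x - 2 < 0 := by linarith [hx.2]
  have h3 : -1 < y - 2 := by linarith [hy.1, one_lt_e₂]
  have h4 : y - 2 < 0 := by linarith [hy.2]
  have : (x - 2) * (y - 2) < 1 := by nlinarith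
  exact this.ne

theorem Ψ_injOn₂ : InjOn Ψ (Ioo e₃ 1) := by
  refine Ψ_injOn (fun x hx => by linarith [hx.2]) (fun x hx y hy => ?_)
  have h2 : x - 2 < -1 := by linarith [hx.2]
  have h4 : y - 2 < -1 := by linarith [hy.2]
  have : 1 < (x - 2) * (y - 2) := by nlinarith
  exact this.ne'

theorem Ψ_injOn₃ : InjOn Ψ (Ioo 1 e₂) := by
  refine Ψ_injOn (fun x hx => by linarith [hx.2, e₂_lt_two]) (fun x hx y hy => ?_)
  have h1 : -1 < x - 2 := by linarith [hx.1]
  have h2 : x - 2 < 0 := by linarith [hx.2, e₂_lt_two]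
  have h3 : -1 < y - 2 := by linarith [hy.1]
  have h4 : y - 2 < 0 := by linarith [hy.2, e₂_lt_two]
  have : (x - 2) * (y - 2) < 1 := by nlinarith
  exact this.ne

theorem Ψ_image₁ : Ψ '' Ioo e₂ 2 = Ioi 1 := by
  apply Subset.antisymm
  · rintro w ⟨x, hx, rfl⟩
    exact one_lt_Ψ hx.1 hx.2
  · intro w hw
    have hw : 1 < w := hw
    set b : ℝ := 2 - (4 * (w + 1))⁻¹ with hb
    have hw1 : 0 < 4 * (w + 1) := by linarith
    have hbinv : 0 < (4 * (w + 1))⁻¹ := inv_pos.mpr hw1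
    have hbinv' : (4 * (w + 1))⁻¹ < 8⁻¹ := by
      apply inv_strictAnti₀ (by norm_num); linarith
    have hb2 : b < 2 := by rw [hb]; linarith
    have he₂b : e₂ < b := by
      rw [hb]; have := sqrt2_lt; unfold e₂; nlinarith
    have hΨb : w < Ψ b := by
      have hb2' : b - 2 = -(4 * (w + 1))⁻¹ := by rw [hb]; ring
      unfold Ψ
      rw [hb2', inv_neg, inv_inv]
      rw [hb]
      nlinarith
    have hcont : ContinuousOn Ψ (Icc e₂ b) :=
      continuousOn_Ψ (fun x hx => by linarith [hx.2])
    have hivt := intermediate_value_Ioo he₂b.le hcont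
    rw [Ψ_e₂] at hivt
    obtain ⟨x, hx, hxw⟩ := hivt ⟨hw, hΨb⟩
    exact ⟨x, ⟨hx.1, hx.2.trans hb2⟩, hxw⟩

theorem Ψ_image₂ : Ψ '' Ioo e₃ 1 = Ioo 0 1 := by
  apply Subset.antisymm
  · rintro w ⟨x, hx, rfl⟩
    exact ⟨Ψ_pos (by linarith [hx.2]) hx.2.ne, Ψ_lt_one hx.1 (hx.2.trans one_lt_e₂)⟩
  · have hcont : ContinuousOn Ψ (Icc e₃ 1) :=
      continuousOn_Ψ (fun x hx => by linarith [hx.2])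
    have hivt := intermediate_value_Ioo' e₃_lt_one.le hcont
    rwa [Ψ_e₃, Ψ_one] at hivt

theorem Ψ_image₃ : Ψ '' Ioo 1 e₂ = Ioo 0 1 := by
  apply Subset.antisymm
  · rintro w ⟨x, hx, rfl⟩
    exact ⟨Ψ_pos (hx.2.trans e₂_lt_two) hx.1.ne', Ψ_lt_one (e₃_lt_one.trans hx.1) hx.2⟩
  · have hcont : ContinuousOn Ψ (Icc 1 e₂) :=
      continuousOn_Ψ (fun x hx => by linarith [hx.2, e₂_lt_two])
    have hivt := intermediate_value_Ioo one_lt_e₂.le hcont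
    rwa [Ψ_e₂, Ψ_one] at hivt

/-! ### weights -/

theorem weight_helper {F P Q : ℝ} (hF : 0 < F) (hP : P ≠ 0) (hQ : Q = F * P ^ 2 / 4) :
    |P| * (Real.sqrt Q)⁻¹ = 2 * (Real.sqrt F)⁻¹ := by
  subst hQ
  rw [show F * P ^ 2 / 4 = F * (P / 2) ^ 2 by ring, Real.sqrt_mul hF.le, Real.sqrt_sq_eq_abs,
    abs_div, abs_two]
  have h1 : 0 < Real.sqrt F := Real.sqrt_pos.mpr hF
  have h2 : 0 < |P| := abs_pos.mpr hP
  field_simp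

theorem Ψ'_ne {x : ℝ} (hx2 : x ≠ 2) (hx1 : x ≠ 1) (hx3 : x ≠ 3) : Ψ' x ≠ 0 := by
  have hx' : x - 2 ≠ 0 := sub_ne_zero.mpr hx2
  unfold Ψ'
  intro h
  have h1 : ((x - 2) ^ 2)⁻¹ = 1 := by linarith
  have h2 : (x - 2) ^ 2 = 1 := by
    have := congrArg (·⁻¹) h1
    simpa using this
  have h3 : (x - 1) * (x - 3) = 0 := by nlinarith
  rcases mul_eq_zero.mp h3 with h | h
  · exact hx1 (by linarith)
  · exact hx3 (by linarith)

/-- weight on the `f < 0` interval: `|Ψ'| g(Ψ) = 2/√(−f)`. -/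
theorem weight_neg {x : ℝ} (h2 : e₂ < x) (hx2 : x < 2) :
    |Ψ' x| • gI (Ψ x) = 2 * (Real.sqrt (-fcm x))⁻¹ := by
  rw [smul_eq_mul]
  unfold gI
  refine weight_helper (by linarith [fcm_neg_of_mem h2 hx2])
    (Ψ'_ne hx2.ne (by linarith [one_lt_e₂]) (by linarith)) ?_
  rw [Ψ_key hx2.ne]

/-- weight on the bounded oval (off the fold `x = 1`): `|Ψ'| h(Ψ) = 2/√f`. -/
theorem weight_pos {x : ℝ} (h3 : e₃ < x) (h2 : x < e₂) (hx1 : x ≠ 1) :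
    |Ψ' x| • hI (Ψ x) = 2 * (Real.sqrt (fcm x))⁻¹ := by
  rw [smul_eq_mul]
  unfold hI
  have hx2 : x < 2 := h2.trans e₂_lt_two
  refine weight_helper (fcm_pos_of_mem h3 h2) (Ψ'_ne hx2.ne hx1 (by linarith)) ?_
  have := Ψ_key hx2.ne
  linear_combination -this

/-! ### the three isogeny substitutions -/

/-- `K₀(44,−56) = Λ/4`. -/
theorem integral_K_cm : ∫ x in Ioo e₂ 2, (Real.sqrt (-fcm x))⁻¹ = lemHalf / 2 := by
  have key := integral_image_eq_integral_abs_deriv_smul (s := Ioo e₂ 2) (f := Ψ) (f' := Ψ')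
    measurableSet_Ioo (fun x hx => (hasDerivAt_Ψ hx.2.ne).hasDerivWithinAt) Ψ_injOn₁ gI
  rw [Ψ_image₁, integral_gI_Ioi, setIntegral_congr_fun measurableSet_Ioo
    (fun x hx => weight_neg hx.1 hx.2), integral_const_mul] at key
  linarith

theorem integral_J_half {S : Set ℝ} (hS : MeasurableSet S) (himg : Ψ '' S = Ioo 0 1)
    (hinj : InjOn Ψ S) (hS2 : ∀ x ∈ S, e₃ < x ∧ x < e₂ ∧ x ≠ 1) :
    ∫ x in S, (Real.sqrt (fcm x))⁻¹ = lemHalf / 2 ∧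
      IntegrableOn (fun x => (Real.sqrt (fcm x))⁻¹) S := by
  have hder : ∀ x ∈ S, HasDerivWithinAt Ψ (Ψ' x) S x := fun x hx =>
    (hasDerivAt_Ψ ((hS2 x hx).2.1.trans e₂_lt_two).ne).hasDerivWithinAt
  have hw : EqOn (fun x => |Ψ' x| • hI (Ψ x)) (fun x => 2 * (Real.sqrt (fcm x))⁻¹) S :=
    fun x hx => weight_pos (hS2 x hx).1 (hS2 x hx).2.1 (hS2 x hx).2.2
  have key := integral_image_eq_integral_abs_deriv_smul hS hder hinj hI
  rw [himg, integral_hI_Ioo, setIntegral_congr_fun hS hw, integral_const_mul] at key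
  have hint := (integrableOn_image_iff_integrableOn_abs_deriv_smul hS hder hinj hI)
  rw [himg] at hint
  have hint2 := (hint.mp integrableOn_hI_Ioo).congr_fun hw hS
  have hint3 : IntegrableOn (fun x => 1 / 2 * (2 * (Real.sqrt (fcm x))⁻¹)) S :=
    hint2.const_mul (1 / 2 : ℝ)
  refine ⟨by linarith, ?_⟩
  refine hint3.congr_fun (fun x _ => ?_) hS
  ring

/-- `J₀(44,−56) = Λ/2`. -/
theorem integral_J_cm : ∫ x in Ioo e₃ e₂, (Real.sqrt (fcm x))⁻¹ = lemHalf := by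
  obtain ⟨hI₂, hi₂⟩ := integral_J_half measurableSet_Ioo Ψ_image₂ Ψ_injOn₂
    (fun x hx => ⟨hx.1, hx.2.trans one_lt_e₂, hx.2.ne⟩)
  obtain ⟨hI₃, hi₃⟩ := integral_J_half measurableSet_Ioo Ψ_image₃ Ψ_injOn₃
    (fun x hx => ⟨e₃_lt_one.trans hx.1, hx.2, hx.1.ne'⟩)
  have hsplit : Ioo e₃ e₂ \ {1} = Ioo e₃ 1 ∪ Ioo 1 e₂ := by
    ext x
    simp only [mem_sdiff, mem_Ioo, mem_singleton_iff, mem_union]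
    constructor
    · rintro ⟨⟨h1, h2⟩, h3⟩
      rcases lt_or_gt_of_ne h3 with h | h
      · exact Or.inl ⟨h1, h⟩
      · exact Or.inr ⟨h, h2⟩
    · rintro (⟨h1, h2⟩ | ⟨h1, h2⟩)
      · exact ⟨⟨h1, h2.trans one_lt_e₂⟩, h2.ne⟩
      · exact ⟨⟨e₃_lt_one.trans h1, h2⟩, h1.ne'⟩
  have hae : (Ioo e₃ e₂ \ {1} : Set ℝ) =ᵐ[volume] Ioo e₃ e₂ :=
    sdiff_null_ae_eq_self (by simp)
  rw [← setIntegral_congr_set hae, hsplit,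
    setIntegral_union (Set.disjoint_left.mpr fun x hx hx' => lt_irrefl x (hx.2.trans hx'.1))
      measurableSet_Ioo hi₂ hi₃, hI₂, hI₃]
  ring

/-- **The integer period relation at `j = 66³`: `J₀ = 2K₀`.** -/
theorem J_eq_two_K_cm :
    ∫ x in Ioo e₃ e₂, (Real.sqrt (fcm x))⁻¹ = 2 * ∫ x in Ioo e₂ 2, (Real.sqrt (-fcm x))⁻¹ := by
  rw [integral_J_cm, integral_K_cm]; ring


end CM66

open CM66 in
/-- The crux's cubic at `(44, −56)` is `CM66.fcm`. -/
theorem cubic_cm (x : ℝ) : cubic 44 (-56) x = CM66.fcm x := by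
  simp only [cubic, CM66.fcm]; push_cast; ring

/-- `Δ(44,−56) = 512 > 0`. -/
theorem discr_cm_pos : 0 < discr 44 (-56) := by norm_num [discr]

/-- `σ(44,−56) = (e₃, e₂)` with `e₂,₃ = −1 ± 2√2`. -/
theorem σ₁_cm : σ₁ 44 (-56) = {p | CM66.e₃ < p 0 ∧ p 0 < CM66.e₂} := by
  ext p
  simp only [σ₁, mem_setOf_eq, cubic_cm]
  exact CM66.sigma_cm_iff (p 0)

/-- `σ'(44,−56) = (e₂, 2)`. -/
theorem σ₂_cm : σ₂ 44 (-56) = {p | CM66.e₂ < p 0 ∧ p 0 < 2} := by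
  ext p
  simp only [σ₂, mem_setOf_eq, cubic_cm]
  exact CM66.sigma'_cm_iff (p 0)

/-- transfer of a set integral over an interval-cylinder of `ℝ¹` to `ℝ`. -/
theorem setIntegral_fin_one (g : ℝ → ℝ) (S : Set ℝ) :
    ∫ p in {p : Fin 1 → ℝ | p 0 ∈ S}, g (p 0) = ∫ x in S, g x := by
  have he : MeasurePreserving (MeasurableEquiv.funUnique (Fin 1) ℝ) volume volume :=
    volume_preserving_funUnique (Fin 1) ℝ
  have hpre : {p : Fin 1 → ℝ | p 0 ∈ S} = (MeasurableEquiv.funUnique (Fin 1) ℝ) ⁻¹' S := by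
    ext p; rfl
  rw [hpre]
  exact he.setIntegral_preimage_emb (MeasurableEquiv.funUnique (Fin 1) ℝ).measurableEmbedding g S

/-- **(F9)** `K₀(44,−56) = Γ(1/4)²/(8√(2π))`. -/
theorem K₀_cm : K₀ 44 (-56) = CM66.lemHalf / 2 := by
  unfold K₀
  rw [σ₂_cm]
  have h := setIntegral_fin_one (fun x => 1 / Real.sqrt (-CM66.fcm x)) (Ioo CM66.e₂ 2)
  simp only [mem_Ioo] at h
  simp only [cubic_cm]
  rw [h, ← CM66.integral_K_cm]
  refine integral_congr_ae (Filter.Eventually.of_forall fun x => ?_)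
  simp only [one_div]

/-- **(F9)** `J₀(44,−56) = Γ(1/4)²/(4√(2π))`. -/
theorem J₀_cm : J₀ 44 (-56) = CM66.lemHalf := by
  unfold J₀
  rw [σ₁_cm]
  have h := setIntegral_fin_one (fun x => 1 / Real.sqrt (CM66.fcm x)) (Ioo CM66.e₃ CM66.e₂)
  simp only [mem_Ioo] at h
  simp only [cubic_cm]
  rw [h, ← CM66.integral_J_cm]
  refine integral_congr_ae (Filter.Eventually.of_forall fun x => ?_)
  simp only [one_div]

/-- **(F9) The integer period relation at `j = 66³`**: `J₀(44,−56) = 2·K₀(44,−56)`. -/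
theorem J₀_eq_two_mul_K₀_cm : J₀ 44 (-56) = 2 * K₀ 44 (-56) := by
  rw [J₀_cm, K₀_cm]; ring

/-- **(F9)** Hence the ℚ-rigidity of F4 fails at `(44,−56)` (`b = 1`, `d = −2`): `Sharpened` is
vacuous there. -/
theorem not_qRigidity_cm : ¬ QRigidity 44 (-56) := by
  intro h
  have := h 1 0 (-2) 0 (by rw [J₀_eq_two_mul_K₀_cm]; push_cast; ring)
  exact one_ne_zero this.1

/-- **(F9)** … and so does the crux's inlined hypothesis: the crux says nothing about
`y² = 4x³ − 44x + 56`. -/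
theorem not_rigidity_cm : ¬ Rigidity 44 (-56) := fun h => not_qRigidity_cm (qRigidity_of_rigidity h)

/-- The natural strengthening "integer relations between `J₀` and `K₀` occur only on the mirror
family `q₃ = 0`" (where `K₀ = J₀`, F5). -/
def IntIndependentOffMirror : Prop :=
  ∀ q₂ q₃ : ℚ, 0 < discr q₂ q₃ → q₃ ≠ 0 →
    ∀ m n : ℤ, (m : ℝ) * J₀ q₂ q₃ + (n : ℝ) * K₀ q₂ q₃ = 0 → m = 0 ∧ n = 0

/-- **(F9) refuted strengthening**: integer relations are NOT confined to the mirror family —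
witness `(44,−56)`, `(m,n) = (1,−2)`. -/
theorem not_intIndependentOffMirror : ¬ IntIndependentOffMirror := by
  intro h
  have := h 44 (-56) discr_cm_pos (by norm_num) 1 (-2)
    (by rw [J₀_eq_two_mul_K₀_cm]; push_cast; ring)
  exact one_ne_zero this.1

/-- `1/√f` is `ℚ`-semialgebraic on the root-free oval `σ` (every curve). -/
theorem isSemialgebraicFunOn_inv_sqrt_cubic (q₂ q₃ : ℚ) :
    IsSemialgebraicFunOn ℚ (σ₁ q₂ q₃) (fun p => 1 / Real.sqrt (cubic q₂ q₃ (p 0))) := by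
  have hσ := isSemialgebraic_σ₁ q₂ q₃
  set F : MvPolynomial (Fin 1) ℚ := 4 * MvPolynomial.X 0 ^ 3 - MvPolynomial.C q₂ * MvPolynomial.X 0 -
    MvPolynomial.C q₃ with hF
  have hne : ∀ p ∈ σ₁ q₂ q₃, MvPolynomial.aeval p F ≠ 0 := by
    intro p hp
    rw [hF, aeval_cubicPoly]
    exact hp.1.ne'
  have h1 := isSemialgebraicFunOn_aeval_div_aeval hσ (1 : MvPolynomial (Fin 1) ℚ) F hne
  have h2 : IsSemialgebraicFunOn ℚ (σ₁ q₂ q₃) (fun p => 1 / cubic q₂ q₃ (p 0)) := by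
    refine h1.congr (fun p _ => ?_)
    simp only [hF, map_one, aeval_cubicPoly]
  refine (IsSemialgebraicFunOn.sqrt_holds h2).congr (fun p _ => ?_)
  simp only [one_div, Real.sqrt_inv]

/-- `1/√(−f)` is `ℚ`-semialgebraic on the root-free interval `σ'` (every curve). -/
theorem isSemialgebraicFunOn_inv_sqrt_neg_cubic (q₂ q₃ : ℚ) :
    IsSemialgebraicFunOn ℚ (σ₂ q₂ q₃) (fun p => 1 / Real.sqrt (-cubic q₂ q₃ (p 0))) := by
  have hσ := isSemialgebraic_σ₂ q₂ q₃
  set F : MvPolynomial (Fin 1) ℚ := -(4 * MvPolynomial.X 0 ^ 3 - MvPolynomial.C q₂ * MvPolynomial.X 0 -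
    MvPolynomial.C q₃) with hF
  have hne : ∀ p ∈ σ₂ q₂ q₃, MvPolynomial.aeval p F ≠ 0 := by
    intro p hp
    rw [hF, map_neg, aeval_cubicPoly, neg_ne_zero]
    exact hp.1.ne
  have h1 := isSemialgebraicFunOn_aeval_div_aeval hσ (1 : MvPolynomial (Fin 1) ℚ) F hne
  have h2 : IsSemialgebraicFunOn ℚ (σ₂ q₂ q₃) (fun p => 1 / (-cubic q₂ q₃ (p 0))) := by
    refine h1.congr (fun p _ => ?_)
    simp only [hF, map_one, map_neg, aeval_cubicPoly]
  refine (IsSemialgebraicFunOn.sqrt_holds h2).congr (fun p _ => ?_)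
  simp only [one_div, Real.sqrt_inv]

/-- The generator `[σ, 1/√f]` at `(44,−56)` as an honest representation (integrability from the
closed-form value). -/
def genσCM : KZ.IntegralRep 1 where
  domain := σ₁ 44 (-56)
  integrand := fun p => 1 / Real.sqrt (cubic 44 (-56) (p 0))
  isSemialgebraic_domain := isSemialgebraic_σ₁ 44 (-56)
  isSemialgebraicFunOn_integrand := isSemialgebraicFunOn_inv_sqrt_cubic 44 (-56)
  integrableOn := by
    by_contra h
    have h0 := integral_undef h
    have h1 : J₀ 44 (-56) = 0 := h0
    rw [J₀_cm] at h1
    exact absurd h1 (ne_of_gt CM66.lemHalf_pos)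

/-- The generator `[σ', 1/√(−f)]` at `(44,−56)` as an honest representation. -/
def genσ'CM : KZ.IntegralRep 1 where
  domain := σ₂ 44 (-56)
  integrand := fun p => 1 / Real.sqrt (-cubic 44 (-56) (p 0))
  isSemialgebraic_domain := isSemialgebraic_σ₂ 44 (-56)
  isSemialgebraicFunOn_integrand := isSemialgebraicFunOn_inv_sqrt_neg_cubic 44 (-56)
  integrableOn := by
    by_contra h
    have h0 := integral_undef h
    have h1 : K₀ 44 (-56) = 0 := h0
    rw [K₀_cm] at h1
    exact absurd h1 (ne_of_gt (by linarith [CM66.lemHalf_pos]))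

theorem genσCM_value : genσCM.value = CM66.lemHalf := J₀_cm
theorem genσ'CM_value : genσ'CM.value = CM66.lemHalf / 2 := K₀_cm

/-- **The CM kernel element** `u₀ = [σ, 1/√f] − 2[σ', 1/√(−f)]` at `(44,−56)`. -/
def cmElem : KZ.FormalRep := KZ.of genσCM - 2 • KZ.of genσ'CM

theorem genσCM_mem_gens : KZ.of genσCM ∈ Gens 44 (-56) :=
  Or.inl (Or.inl ⟨genσCM, 0, rfl, fun p _ => by simp [genσCM], rfl⟩)

theorem genσ'CM_mem_gens : KZ.of genσ'CM ∈ Gens 44 (-56) :=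
  Or.inl (Or.inr ⟨genσ'CM, 0, rfl, fun p _ => by simp [genσ'CM], rfl⟩)

/-- `u₀ ∈ closure S`. -/
theorem cmElem_mem_closure : cmElem ∈ AddSubgroup.closure (Gens 44 (-56)) :=
  sub_mem (AddSubgroup.subset_closure genσCM_mem_gens)
    (AddSubgroup.nsmul_mem _ (AddSubgroup.subset_closure genσ'CM_mem_gens) 2)

/-- **(F9)** `eval u₀ = J₀ − 2K₀ = 0`: an honest kernel element at a curve where the crux is silent. -/
theorem eval_cmElem : KZ.eval cmElem = 0 := by
  simp only [cmElem, map_sub, map_nsmul, KZ.eval_of, genσCM_value, genσ'CM_value]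
  simp only [nsmul_eq_mul, Nat.cast_ofNat]
  ring

/-- `u₀` has coefficient sum `−1`, so it is NOT in the subgroup generated by moves (2) + (3):
every derivation uses an additivity move. -/
theorem cmElem_not_mem_closure_cov_nl :
    cmElem ∉ AddSubgroup.closure (KZ.changeOfVariablesRel ∪ KZ.newtonLeibnizRel) := by
  intro h
  have h0 := KZ.closure_cov_nl_le_ker_coeffSum h
  rw [AddMonoidHom.mem_ker] at h0
  simp [cmElem, map_sub, map_nsmul, KZ.coeffSum_of] at h0

/-- `u₀` has restricted value `J₀ ≠ 0` over the window `{f > 0}` … stated with the window family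
`A n = {p | ∀ i, cubic (p i) > 0}`; so it is NOT in the subgroup generated by the additivity moves
(1a) + (1b): every derivation uses a change of variables or a Newton–Leibniz move. -/
theorem cmElem_not_mem_closure_add :
    cmElem ∉ AddSubgroup.closure (KZ.domainAddRel ∪ KZ.integrandAddRel) := by
  intro h
  set A : (n : ℕ) → Set (Fin n → ℝ) := fun n => {p | ∀ i, 0 < cubic 44 (-56) (p i)} with hA
  have hAm : ∀ n, MeasurableSet (A n) := by
    intro n
    have : A n = ⋂ i, {p : Fin n → ℝ | 0 < cubic 44 (-56) (p i)} := by
      ext p; simp [hA]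
    rw [this]
    refine MeasurableSet.iInter fun i => ?_
    exact measurableSet_lt measurable_const (by unfold cubic; fun_prop)
  have h0 := KZ.closure_add_le_ker_restrictedEval A hAm h
  rw [AddMonoidHom.mem_ker] at h0
  have h1 : genσCM.domain ∩ A 1 = genσCM.domain := by
    refine inter_eq_left.mpr fun p hp i => ?_
    rw [Fin.fin_one_eq_zero i]; exact hp.1
  have h2 : genσ'CM.domain ∩ A 1 = ∅ := by
    ext p
    simp only [mem_inter_iff, mem_empty_iff_false, iff_false, not_and]
    intro hp hA1
    exact absurd (hA1 0) (not_lt.mpr hp.1.le)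
  simp only [cmElem, map_sub, map_nsmul, KZ.restrictedEval_of, h1, h2, Measure.restrict_empty,
    integral_zero_measure, smul_zero, sub_zero] at h0
  have h3 : genσCM.value = 0 := h0
  rw [genσCM_value] at h3
  exact absurd h3 (ne_of_gt CM66.lemHalf_pos)

/-- **(F9)** The summit predicts `u₀ ∈ relations` (kernel form of Conjecture 1); the crux, being
vacuous at `(44,−56)`, predicts nothing. -/
theorem cmElem_mem_relations_of_summit (h : _root_.KontsevichZagierPeriods) :
    cmElem ∈ KZ.relations :=
  (kzKernelConjecture_iff_isRational.mpr h) cmElem eval_cmElem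

/-- CANDIDATE SUPPORT STATEMENT (not filed; planners only): the CM-isogeny transfer at `j = 66³`,
`[σ, 1/√f] − 2[σ', 1/√(−f)] ∈ relations` on `y² = 4x³ − 44x + 56`. Paper chain (≈ 7 moves, every
map RATIONAL over `ℚ`): rule 1a cuts `σ = (e₃,e₂)` at the fold `x = 1` of `φ(x) = x + 1/(x−2)`;
rule 2 along `φ` on each half (injective, image `(−4,0)`, weight `f₆₄(φ) = fφ′²`,
`f₆₄(u) = 4u³ − 64u`) gives `[σ,1/√f] ~ 2[(−4,0), 1/√f₆₄]`; rule 2 along `φ` on `σ' = (e₂,2)`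
(injective, image `(−∞,−4)`), then `u ↦ −u` onto `(4,∞)` (`f₆₄` is odd), then the two-torsion move
`u ↦ −16/u` of `u³ − 16u` onto `(−4,0)` gives `[σ',1/√(−f)] ~ [(−4,0), 1/√f₆₄]`; bookkeeping
`2[r] ~ [2r]`. The VALUE identity is `J₀_eq_two_mul_K₀_cm` above (same substitutions). -/
def CMIsogenyTransfer : Prop :=
  ∀ r r' : KZ.IntegralRep 1, r.domain = σ₁ 44 (-56) →
    EqOn r.integrand (fun p => 1 / Real.sqrt (cubic 44 (-56) (p 0))) (σ₁ 44 (-56)) →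
    r'.domain = σ₂ 44 (-56) →
    EqOn r'.integrand (fun p => 1 / Real.sqrt (-cubic 44 (-56) (p 0))) (σ₂ 44 (-56)) →
    KZ.of r - 2 • KZ.of r' ∈ KZ.relations

/-- The candidate support follows from the summit (so refuting it refutes the summit, exactly like
the route's own transfer supports). -/
theorem cmIsogenyTransfer_of_summit (h : _root_.KontsevichZagierPeriods) : CMIsogenyTransfer := by
  intro r r' hr hri hr' hri'
  refine (kzKernelConjecture_iff_isRational.mpr h) _ ?_
  have e1 : KZ.Equivalent r genσCM := equivalent_of_eqOn (by simp [genσCM, hr])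
    (by rw [hr]; intro p hp; rw [hri hp]; rfl)
  have e2 : KZ.Equivalent r' genσ'CM := equivalent_of_eqOn (by simp [genσ'CM, hr'])
    (by rw [hr']; intro p hp; rw [hri' hp]; rfl)
  have v1 := KZ.relations_le_ker_eval_holds e1
  have v2 := KZ.relations_le_ker_eval_holds e2
  rw [AddMonoidHom.mem_ker, map_sub, KZ.eval_of, KZ.eval_of, sub_eq_zero] at v1 v2
  simp only [map_sub, map_nsmul, KZ.eval_of, v1, v2, genσCM_value, genσ'CM_value]
  simp only [nsmul_eq_mul, Nat.cast_ofNat]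
  ring


/-! ### §9b (F9b, cycle 2) The SECOND integer relation at `j = 66³`: `2J₀ − J₁ − 2K₁ = 0`

The quasi-period companion of F9, PROVED with the same rational isogeny and no transcendence:
on the oval, `(x + 1/(x−2))/√f` is the pull-back of `u du/Y′` and `1/((x−2)√f)` is Hermite-reduced
by `G = √f/(2(x−2))` (pole at the RATIONAL 2-torsion point), giving `J₁ = J₀ − 2M₄`
(`M₄ = ∫₀¹ w dw/√(4w−4w³)`); on `σ' = (e₂,2)` the form `(2−x)/((x−1)²√(−f)) = 1/(4Ψ√(−f))` is a
1:1 pull-back of `du/(u√f₆₄)` (double pole moved to the 2-torsion point `(0,0)` of `u³ − 16u`,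
so that the improper integral over the unbounded twist component converges) and is Hermite-reduced
by `H = √(−f)/(1−x)`, giving `K₁ = K₀ + M₄`. With F9 (`J₀ = 2K₀`): `2J₀ − J₁ − 2K₁ = 0`
(`two_J₀_sub_J₁_sub_two_K₁_cm`; numerics `−1.1·10⁻⁹`). So the ℤ-kernel of this curve's sector has
rank ≥ 2 (`cmElem₂`, honest, `eval = 0`, `coeffSum = −1`), the ℚ-rigidity fails a second,
independent way (`not_qRigidity_cm₂`), and the unconditional statement needs a first- AND a
second-kind isogeny transfer here — the exact analogue of the route's CMTwist PAIR at `j = 8000`,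
neither filed. -/

namespace CM66

/-! ## Second kind (cycle 2 extension): `K₁ − K₀ = M₄` and `J₁ = J₀ − 2M₄` -/

/-- `M₄ = ∫₀¹ w dw/√(4w − 4w³)` (a lemniscatic integral of the second kind). -/
def M₄ : ℝ := ∫ w in Ioo (0:ℝ) 1, w * hI w

/-- integrability of `(√(−f))⁻¹` on `(e₂, 2)` (transported from `gI` on `(1,∞)`). -/
theorem integrableOn_invSqrt_neg : IntegrableOn (fun x => (Real.sqrt (-fcm x))⁻¹) (Ioo e₂ 2) := by
  have hder : ∀ x ∈ Ioo e₂ 2, HasDerivWithinAt Ψ (Ψ' x) (Ioo e₂ 2) x := fun x hx =>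
    (hasDerivAt_Ψ hx.2.ne).hasDerivWithinAt
  have hint := integrableOn_image_iff_integrableOn_abs_deriv_smul measurableSet_Ioo hder Ψ_injOn₁ gI
  rw [Ψ_image₁] at hint
  have h2 := (hint.mp integrableOn_gI_Ioi).congr_fun (fun x hx => weight_neg hx.1 hx.2) measurableSet_Ioo
  have h3 : IntegrableOn (fun x => 1 / 2 * (2 * (Real.sqrt (-fcm x))⁻¹)) (Ioo e₂ 2) := h2.const_mul (1 / 2)
  exact h3.congr_fun (fun x _ => by ring) measurableSet_Ioo

/-- inversion for the second kind: `∫₁^∞ g(v)/v dv = M₄`. -/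
theorem integral_gI_div : ∫ v in Ioi (1:ℝ), v⁻¹ * gI v = M₄ := by
  have key := integral_image_eq_integral_abs_deriv_smul (s := Ioi (1:ℝ)) (f := fun v : ℝ => v⁻¹)
    (f' := fun v => -(v ^ 2)⁻¹) measurableSet_Ioi
    (fun v hv => (hasDerivAt_inv' (by simp only [mem_Ioi] at hv; linarith)).hasDerivWithinAt)
    (fun a ha b hb hab => inv_injective hab) (fun w => w * hI w)
  rw [image_inv_Ioi_one] at key
  unfold M₄
  rw [key]
  refine setIntegral_congr_fun measurableSet_Ioi (fun v hv => ?_)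
  have hv : 1 < v := hv
  have h := inv_weight hv
  simp only [smul_eq_mul] at h ⊢
  rw [← h]
  ring

/-- weight for the K-side second-kind substitution: `|Ψ'|·g(Ψ)/(8Ψ) = (2−x)/((x−1)²√(−f))`. -/
theorem weight_negK {x : ℝ} (h2 : e₂ < x) (hx2 : x < 2) :
    |Ψ' x| • ((Ψ x)⁻¹ * gI (Ψ x) / 8) = (2 - x) / (x - 1) ^ 2 * (Real.sqrt (-fcm x))⁻¹ := by
  have hw := weight_neg h2 hx2
  rw [smul_eq_mul] at hw ⊢
  have hx1 : x - 1 ≠ 0 := by linarith [one_lt_e₂]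
  have hx2' : x - 2 ≠ 0 := by linarith
  have hΨ : Ψ x = -((x - 1) ^ 2) / (4 * (x - 2)) := Ψ_eq hx2.ne
  have hinv : (Ψ x)⁻¹ = 4 * (2 - x) / (x - 1) ^ 2 := by
    rw [hΨ]
    have : (x - 1) ^ 2 ≠ 0 := pow_ne_zero 2 hx1
    field_simp
    ring
  calc |Ψ' x| * ((Ψ x)⁻¹ * gI (Ψ x) / 8) = (Ψ x)⁻¹ / 8 * (|Ψ' x| * gI (Ψ x)) := by ring
    _ = (Ψ x)⁻¹ / 8 * (2 * (Real.sqrt (-fcm x))⁻¹) := by rw [hw]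
    _ = (2 - x) / (x - 1) ^ 2 * (Real.sqrt (-fcm x))⁻¹ := by rw [hinv]; ring

/-- the K-side substitution: `∫_(e₂,2) (2−x)/((x−1)²√(−f)) dx = M₄/8`. -/
theorem integral_Kside : ∫ x in Ioo e₂ 2, (2 - x) / (x - 1) ^ 2 * (Real.sqrt (-fcm x))⁻¹ = M₄ / 8 := by
  have key := integral_image_eq_integral_abs_deriv_smul (s := Ioo e₂ 2) (f := Ψ) (f' := Ψ')
    measurableSet_Ioo (fun x hx => (hasDerivAt_Ψ hx.2.ne).hasDerivWithinAt) Ψ_injOn₁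
    (fun v => v⁻¹ * gI v / 8)
  rw [Ψ_image₁, setIntegral_congr_fun measurableSet_Ioo (fun x hx => weight_negK hx.1 hx.2)] at key
  rw [← key]
  have : ∫ v in Ioi (1:ℝ), v⁻¹ * gI v / 8 = (∫ v in Ioi (1:ℝ), v⁻¹ * gI v) / 8 := by
    rw [← integral_div]
  rw [this, integral_gI_div]


/-! ### K-side Newton–Leibniz: `H = √(−f)/(1−x)` on `[e₂, 2]` -/

/-- derivative of the cubic. -/
theorem hasDerivAt_fcm (x : ℝ) : HasDerivAt fcm (12 * x ^ 2 - 44) x := by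
  have h1 : HasDerivAt (fun y : ℝ => y ^ 3) (3 * x ^ 2) x := by simpa using hasDerivAt_pow 3 x
  have h := ((h1.const_mul 4).sub ((hasDerivAt_id x).const_mul 44)).add_const 56
  exact (h.congr_deriv (by ring)).congr_of_eventuallyEq
    (Filter.Eventually.of_forall fun y => by simp [fcm])

/-- `H(x) = √(−f x)/(1 − x)`. -/
def Hfun (x : ℝ) : ℝ := Real.sqrt (-fcm x) / (1 - x)

/-- `H′(x) = −2((1−x) + 8/(1−x) + 8/(1−x)²)/√(−f x)` on `(e₂, 2)`. -/
def Hder (x : ℝ) : ℝ := -2 * ((1 - x) + 8 / (1 - x) + 8 / (1 - x) ^ 2) * (Real.sqrt (-fcm x))⁻¹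

theorem hasDerivAt_Hfun {x : ℝ} (h2 : e₂ < x) (hx2 : x < 2) : HasDerivAt Hfun (Hder x) x := by
  have hfneg : 0 < -fcm x := by linarith [fcm_neg_of_mem h2 hx2]
  set r := Real.sqrt (-fcm x) with hr
  have hr0 : 0 < r := Real.sqrt_pos.mpr hfneg
  have hrr : r * r = -fcm x := Real.mul_self_sqrt hfneg.le
  have hs : 1 - x ≠ 0 := by linarith [one_lt_e₂]
  have h1 : HasDerivAt (fun y => -fcm y) (-(12 * x ^ 2 - 44)) x := (hasDerivAt_fcm x).neg
  have h2' : HasDerivAt (fun y => Real.sqrt (-fcm y)) (-(12 * x ^ 2 - 44) / (2 * r)) x := by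
    have := h1.sqrt hfneg.ne'
    simpa [hr] using this
  have h3 : HasDerivAt (fun y : ℝ => 1 - y) (-1) x := by
    simpa using (hasDerivAt_id x).const_sub 1
  have h4 := h2'.div h3 hs
  refine h4.congr_deriv ?_
  -- algebra: ((-f')/(2r) (1-x) - r (-1)) / (1-x)^2 = Hder x
  have hnum : -(12 * x ^ 2 - 44) * (1 - x) + 2 * (r * r) = -4 * ((1 - x) ^ 3 + 8 * (1 - x) + 8) := by
    rw [hrr]; unfold fcm; ring
  unfold Hder
  rw [← hr]
  field_simp
  linear_combination hnum

theorem Hfun_two : Hfun 2 = 0 := by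
  unfold Hfun fcm; norm_num

theorem Hfun_e₂ : Hfun e₂ = 0 := by
  unfold Hfun
  have : fcm e₂ = 0 := by rw [fcm_factor]; ring
  rw [this]; simp

theorem continuousOn_Hfun : ContinuousOn Hfun (Icc e₂ 2) := by
  unfold Hfun
  refine ContinuousOn.div ?_ ?_ (fun x hx => by linarith [hx.1, one_lt_e₂])
  · have : Continuous fun x => Real.sqrt (-fcm x) := by unfold fcm; fun_prop
    exact this.continuousOn
  · fun_prop

/-- integrability of `(√(−f))⁻¹` on the closed interval. -/
theorem integrableOn_invSqrt_neg_Icc : IntegrableOn (fun x => (Real.sqrt (-fcm x))⁻¹) (Icc e₂ 2) :=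
  (integrableOn_Icc_iff_integrableOn_Ioo).mpr integrableOn_invSqrt_neg

/-- products of `(√(−f))⁻¹` with functions continuous on `[e₂,2]` are integrable. -/
theorem integrableOn_mul_invSqrt_neg {φ : ℝ → ℝ} (hφ : ContinuousOn φ (Icc e₂ 2)) :
    IntegrableOn (fun x => φ x * (Real.sqrt (-fcm x))⁻¹) (Ioo e₂ 2) :=
  (integrableOn_invSqrt_neg_Icc.continuousOn_mul hφ isCompact_Icc).mono_set Ioo_subset_Icc_self

theorem integrableOn_Hder : IntegrableOn Hder (Ioo e₂ 2) := by
  unfold Hder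
  refine integrableOn_mul_invSqrt_neg ?_
  have h : ∀ x ∈ Icc e₂ 2, 1 - x ≠ 0 := fun x hx => by linarith [hx.1, one_lt_e₂]
  refine ContinuousOn.mul continuousOn_const (ContinuousOn.add (ContinuousOn.add (by fun_prop) ?_) ?_)
  · exact continuousOn_const.div (by fun_prop) h
  · exact continuousOn_const.div (by fun_prop) (fun x hx => pow_ne_zero 2 (h x hx))

/-- Newton–Leibniz on `[e₂, 2]`: `∫ H′ = H(2) − H(e₂) = 0`. -/
theorem integral_Hder : ∫ x in Ioo e₂ 2, Hder x = 0 := by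
  have hftc := intervalIntegral.integral_eq_sub_of_hasDerivAt_of_le e₂_lt_two.le continuousOn_Hfun
    (fun x hx => hasDerivAt_Hfun hx.1 hx.2)
    ((intervalIntegrable_iff_integrableOn_Ioo_of_le e₂_lt_two.le).mpr integrableOn_Hder)
  rw [Hfun_two, Hfun_e₂, sub_zero, intervalIntegral.integral_of_le e₂_lt_two.le,
    integral_Ioc_eq_integral_Ioo] at hftc
  exact hftc

/-- the pointwise second-kind identity on `(e₂,2)`:
`(2−x)/((x−1)²√(−f)) = −H′/16 − (1−x)/(8√(−f))`. -/
theorem Kside_pointwise {x : ℝ} (h2 : e₂ < x) :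
    (2 - x) / (x - 1) ^ 2 * (Real.sqrt (-fcm x))⁻¹ =
      -(Hder x) / 16 - (1 - x) * (Real.sqrt (-fcm x))⁻¹ / 8 := by
  have hs : 1 - x ≠ 0 := by linarith [one_lt_e₂]
  have hs' : x - 1 ≠ 0 := by linarith [one_lt_e₂]
  unfold Hder
  field_simp
  ring

/-- `K₁ − K₀ = M₄` in the form `∫ x/√(−f) = Λ/4 + M₄`. -/
theorem integral_K1_cm : ∫ x in Ioo e₂ 2, x * (Real.sqrt (-fcm x))⁻¹ = lemHalf / 2 + M₄ := by
  have hK := integral_Kside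
  rw [setIntegral_congr_fun measurableSet_Ioo (fun x hx => Kside_pointwise hx.1)] at hK
  have i1 : IntegrableOn (fun x => -(Hder x) / 16) (Ioo e₂ 2) := by
    have := (integrableOn_Hder.neg).div_const 16
    exact this
  have i2 : IntegrableOn (fun x => (1 - x) * (Real.sqrt (-fcm x))⁻¹ / 8) (Ioo e₂ 2) :=
    (integrableOn_mul_invSqrt_neg (by fun_prop)).div_const 8
  rw [integral_sub i1 i2] at hK
  have e1 : ∫ x in Ioo e₂ 2, -(Hder x) / 16 = 0 := by
    rw [integral_div, integral_neg, integral_Hder]; simp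
  have i3 : IntegrableOn (fun x => (Real.sqrt (-fcm x))⁻¹) (Ioo e₂ 2) := integrableOn_invSqrt_neg
  have i4 : IntegrableOn (fun x => x * (Real.sqrt (-fcm x))⁻¹) (Ioo e₂ 2) :=
    integrableOn_mul_invSqrt_neg (by fun_prop)
  have e2 : ∫ x in Ioo e₂ 2, (1 - x) * (Real.sqrt (-fcm x))⁻¹ / 8 =
      ((∫ x in Ioo e₂ 2, (Real.sqrt (-fcm x))⁻¹) - ∫ x in Ioo e₂ 2, x * (Real.sqrt (-fcm x))⁻¹) / 8 := by
    rw [integral_div, ← integral_sub i3 i4]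
    congr 1
    refine integral_congr_ae (Filter.Eventually.of_forall fun x => ?_)
    ring
  rw [e1, e2, integral_K_cm] at hK
  linarith


/-! ### J-side: integrability on the whole oval, Newton–Leibniz with `G = √f/(2(x−2))`, and the
2:1 substitution for `(x + 1/(x−2))/√f` -/

/-- integrability of `(√f)⁻¹` on the bounded oval. -/
theorem integrableOn_invSqrt_pos : IntegrableOn (fun x => (Real.sqrt (fcm x))⁻¹) (Ioo e₃ e₂) := by
  obtain ⟨-, hi₂⟩ := integral_J_half measurableSet_Ioo Ψ_image₂ Ψ_injOn₂
    (fun x hx => ⟨hx.1, hx.2.trans one_lt_e₂, hx.2.ne⟩)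
  obtain ⟨-, hi₃⟩ := integral_J_half measurableSet_Ioo Ψ_image₃ Ψ_injOn₃
    (fun x hx => ⟨e₃_lt_one.trans hx.1, hx.2, hx.1.ne'⟩)
  have h2 : IntegrableOn (fun x => (Real.sqrt (fcm x))⁻¹) (Icc e₃ 1) :=
    (integrableOn_Icc_iff_integrableOn_Ioo).mpr hi₂
  have h3 : IntegrableOn (fun x => (Real.sqrt (fcm x))⁻¹) (Icc 1 e₂) :=
    (integrableOn_Icc_iff_integrableOn_Ioo).mpr hi₃
  have h4 := h2.union h3
  rw [Icc_union_Icc_eq_Icc e₃_lt_one.le one_lt_e₂.le] at h4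
  exact h4.mono_set Ioo_subset_Icc_self

/-- … and on the closed oval. -/
theorem integrableOn_invSqrt_pos_Icc : IntegrableOn (fun x => (Real.sqrt (fcm x))⁻¹) (Icc e₃ e₂) :=
  (integrableOn_Icc_iff_integrableOn_Ioo).mpr integrableOn_invSqrt_pos

/-- products of `(√f)⁻¹` with functions continuous on `[e₃,e₂]` are integrable on the oval. -/
theorem integrableOn_mul_invSqrt_pos {φ : ℝ → ℝ} (hφ : ContinuousOn φ (Icc e₃ e₂)) :
    IntegrableOn (fun x => φ x * (Real.sqrt (fcm x))⁻¹) (Ioo e₃ e₂) :=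
  (integrableOn_invSqrt_pos_Icc.continuousOn_mul hφ isCompact_Icc).mono_set Ioo_subset_Icc_self

/-- `G(x) = √(f x)/(2(x − 2))`. -/
def Gfun (x : ℝ) : ℝ := Real.sqrt (fcm x) / (2 * (x - 2))

/-- `G′(x) = ((x−2) − 1/(x−2))/√(f x)` on the oval. -/
def Gder (x : ℝ) : ℝ := ((x - 2) - (x - 2)⁻¹) * (Real.sqrt (fcm x))⁻¹

theorem hasDerivAt_Gfun {x : ℝ} (h3 : e₃ < x) (h2 : x < e₂) : HasDerivAt Gfun (Gder x) x := by
  have hfpos : 0 < fcm x := fcm_pos_of_mem h3 h2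
  set r := Real.sqrt (fcm x) with hr
  have hr0 : 0 < r := Real.sqrt_pos.mpr hfpos
  have hrr : r * r = fcm x := Real.mul_self_sqrt hfpos.le
  have hx2 : x - 2 ≠ 0 := by linarith [e₂_lt_two]
  have hv : 2 * (x - 2) ≠ 0 := mul_ne_zero two_ne_zero hx2
  have h1 : HasDerivAt (fun y => Real.sqrt (fcm y)) ((12 * x ^ 2 - 44) / (2 * r)) x := by
    have := (hasDerivAt_fcm x).sqrt hfpos.ne'
    simpa [hr] using this
  have h3' : HasDerivAt (fun y : ℝ => 2 * (y - 2)) 2 x := by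
    simpa using ((hasDerivAt_id x).sub_const 2).const_mul 2
  have h4 := h1.div h3' hv
  refine h4.congr_deriv ?_
  have hrr' : r * r = 4 * x ^ 3 - 44 * x + 56 := by rw [hrr]; rfl
  have hnum : (12 * x ^ 2 - 44) * (2 * (x - 2)) - 2 * (r * r) * 2 =
      8 * (x - 2) * ((x - 2) ^ 2 - 1) := by
    rw [hrr']; ring
  unfold Gder
  rw [← hr]
  field_simp
  linear_combination hnum + 2 * hrr'

theorem Gfun_e₂ : Gfun e₂ = 0 := by
  unfold Gfun
  have : fcm e₂ = 0 := by rw [fcm_factor]; ring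
  rw [this]; simp

theorem Gfun_e₃ : Gfun e₃ = 0 := by
  unfold Gfun
  have : fcm e₃ = 0 := by rw [fcm_factor]; ring
  rw [this]; simp

theorem continuousOn_Gfun : ContinuousOn Gfun (Icc e₃ e₂) := by
  unfold Gfun
  refine ContinuousOn.div ?_ (by fun_prop) (fun x hx => ?_)
  · have : Continuous fun x => Real.sqrt (fcm x) := by unfold fcm; fun_prop
    exact this.continuousOn
  · have : x - 2 ≠ 0 := by linarith [hx.2, e₂_lt_two]
    exact mul_ne_zero two_ne_zero this

theorem integrableOn_Gder : IntegrableOn Gder (Ioo e₃ e₂) := by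
  unfold Gder
  refine integrableOn_mul_invSqrt_pos (ContinuousOn.sub (by fun_prop) ?_)
  exact ContinuousOn.inv₀ (by fun_prop) (fun x hx => by linarith [hx.2, e₂_lt_two])

/-- Newton–Leibniz on `[e₃, e₂]`: `∫ G′ = 0`. -/
theorem integral_Gder : ∫ x in Ioo e₃ e₂, Gder x = 0 := by
  have hftc := intervalIntegral.integral_eq_sub_of_hasDerivAt_of_le e₃_lt_e₂.le continuousOn_Gfun
    (fun x hx => hasDerivAt_Gfun hx.1 hx.2)
    ((intervalIntegrable_iff_integrableOn_Ioo_of_le e₃_lt_e₂.le).mpr integrableOn_Gder)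
  rw [Gfun_e₂, Gfun_e₃, sub_zero, intervalIntegral.integral_of_le e₃_lt_e₂.le,
    integral_Ioc_eq_integral_Ioo] at hftc
  exact hftc

/-- `∫_oval dx/((x−2)√f) = J₁ − 2J₀` (Hermite-type reduction of the form with a pole at the
rational 2-torsion point). -/
theorem integral_inv_sub_two :
    ∫ x in Ioo e₃ e₂, (x - 2)⁻¹ * (Real.sqrt (fcm x))⁻¹ =
      (∫ x in Ioo e₃ e₂, x * (Real.sqrt (fcm x))⁻¹) - 2 * ∫ x in Ioo e₃ e₂, (Real.sqrt (fcm x))⁻¹ := by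
  have hpt : EqOn (fun x => (x - 2)⁻¹ * (Real.sqrt (fcm x))⁻¹)
      (fun x => (x - 2) * (Real.sqrt (fcm x))⁻¹ - Gder x) (Ioo e₃ e₂) := by
    intro x _
    simp only [Gder]
    ring
  rw [setIntegral_congr_fun measurableSet_Ioo hpt,
    integral_sub (integrableOn_mul_invSqrt_pos (by fun_prop)) integrableOn_Gder, integral_Gder,
    sub_zero]
  have hpt2 : EqOn (fun x => (x - 2) * (Real.sqrt (fcm x))⁻¹)
      (fun x => x * (Real.sqrt (fcm x))⁻¹ - 2 * (Real.sqrt (fcm x))⁻¹) (Ioo e₃ e₂) := by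
    intro x _; ring
  rw [setIntegral_congr_fun measurableSet_Ioo hpt2,
    integral_sub (integrableOn_mul_invSqrt_pos (by fun_prop))
      (integrableOn_mul_invSqrt_pos (by fun_prop)), integral_const_mul]

/-- weight for the J-side second-kind substitution: `|Ψ'|·(−2Ψ h(Ψ)) = (x + 1/(x−2))/√f`
(the pull-back of `u du/Y′` along the isogeny). -/
theorem weight_posJ {x : ℝ} (h3 : e₃ < x) (h2 : x < e₂) (hx1 : x ≠ 1) :
    |Ψ' x| • (-2 * Ψ x * hI (Ψ x)) = (x + (x - 2)⁻¹) * (Real.sqrt (fcm x))⁻¹ := by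
  have hw := weight_pos h3 h2 hx1
  rw [smul_eq_mul] at hw ⊢
  have hx2 : x - 2 ≠ 0 := by linarith [e₂_lt_two]
  have hΨ : -4 * Ψ x = x + (x - 2)⁻¹ := by unfold Ψ; ring
  calc |Ψ' x| * (-2 * Ψ x * hI (Ψ x)) = -2 * Ψ x * (|Ψ' x| * hI (Ψ x)) := by ring
    _ = -2 * Ψ x * (2 * (Real.sqrt (fcm x))⁻¹) := by rw [hw]
    _ = (x + (x - 2)⁻¹) * (Real.sqrt (fcm x))⁻¹ := by rw [← hΨ]; ring

theorem integrableOn_G₂ : IntegrableOn (fun w => -2 * w * hI w) (Ioo (0:ℝ) 1) := by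
  have h1 : IntegrableOn hI (Icc (0:ℝ) 1) := (integrableOn_Icc_iff_integrableOn_Ioo).mpr integrableOn_hI_Ioo
  have h2 : IntegrableOn (fun w : ℝ => (-2 * w) * hI w) (Icc (0:ℝ) 1) :=
    h1.continuousOn_mul (by fun_prop) isCompact_Icc
  exact h2.mono_set Ioo_subset_Icc_self

theorem integral_G₂ : ∫ w in Ioo (0:ℝ) 1, -2 * w * hI w = -2 * M₄ := by
  unfold M₄
  rw [← integral_const_mul]
  refine integral_congr_ae (Filter.Eventually.of_forall fun w => ?_)
  ring

theorem integral_Jside_half {S : Set ℝ} (hS : MeasurableSet S) (himg : Ψ '' S = Ioo 0 1)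
    (hinj : InjOn Ψ S) (hS2 : ∀ x ∈ S, e₃ < x ∧ x < e₂ ∧ x ≠ 1) :
    ∫ x in S, (x + (x - 2)⁻¹) * (Real.sqrt (fcm x))⁻¹ = -2 * M₄ ∧
      IntegrableOn (fun x => (x + (x - 2)⁻¹) * (Real.sqrt (fcm x))⁻¹) S := by
  have hder : ∀ x ∈ S, HasDerivWithinAt Ψ (Ψ' x) S x := fun x hx =>
    (hasDerivAt_Ψ ((hS2 x hx).2.1.trans e₂_lt_two).ne).hasDerivWithinAt
  have hw : EqOn (fun x => |Ψ' x| • (-2 * Ψ x * hI (Ψ x)))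
      (fun x => (x + (x - 2)⁻¹) * (Real.sqrt (fcm x))⁻¹) S :=
    fun x hx => weight_posJ (hS2 x hx).1 (hS2 x hx).2.1 (hS2 x hx).2.2
  have key := integral_image_eq_integral_abs_deriv_smul hS hder hinj (fun w => -2 * w * hI w)
  rw [himg, integral_G₂, setIntegral_congr_fun hS hw] at key
  have hint := integrableOn_image_iff_integrableOn_abs_deriv_smul hS hder hinj (fun w => -2 * w * hI w)
  rw [himg] at hint
  exact ⟨key.symm, (hint.mp integrableOn_G₂).congr_fun hw hS⟩

/-- the J-side substitution: `∫_oval (x + 1/(x−2)) dx/√f = −4M₄` (2:1 cover of `(−4,0)`). -/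
theorem integral_Jside : ∫ x in Ioo e₃ e₂, (x + (x - 2)⁻¹) * (Real.sqrt (fcm x))⁻¹ = -4 * M₄ := by
  obtain ⟨hI₂, hi₂⟩ := integral_Jside_half measurableSet_Ioo Ψ_image₂ Ψ_injOn₂
    (fun x hx => ⟨hx.1, hx.2.trans one_lt_e₂, hx.2.ne⟩)
  obtain ⟨hI₃, hi₃⟩ := integral_Jside_half measurableSet_Ioo Ψ_image₃ Ψ_injOn₃
    (fun x hx => ⟨e₃_lt_one.trans hx.1, hx.2, hx.1.ne'⟩)
  have hsplit : Ioo e₃ e₂ \ {1} = Ioo e₃ 1 ∪ Ioo 1 e₂ := by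
    ext x
    simp only [mem_sdiff, mem_Ioo, mem_singleton_iff, mem_union]
    constructor
    · rintro ⟨⟨h1, h2⟩, h3⟩
      rcases lt_or_gt_of_ne h3 with h | h
      · exact Or.inl ⟨h1, h⟩
      · exact Or.inr ⟨h, h2⟩
    · rintro (⟨h1, h2⟩ | ⟨h1, h2⟩)
      · exact ⟨⟨h1, h2.trans one_lt_e₂⟩, h2.ne⟩
      · exact ⟨⟨e₃_lt_one.trans h1, h2⟩, h1.ne'⟩
  have hae : (Ioo e₃ e₂ \ {1} : Set ℝ) =ᵐ[volume] Ioo e₃ e₂ := sdiff_null_ae_eq_self (by simp)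
  rw [← setIntegral_congr_set hae, hsplit,
    setIntegral_union (Set.disjoint_left.mpr fun x hx hx' => lt_irrefl x (hx.2.trans hx'.1))
      measurableSet_Ioo hi₂ hi₃, hI₂, hI₃]
  ring

/-- `J₁ = J₀ − 2M₄`. -/
theorem integral_J1_cm : ∫ x in Ioo e₃ e₂, x * (Real.sqrt (fcm x))⁻¹ = lemHalf - 2 * M₄ := by
  have h := integral_Jside
  have hpt : EqOn (fun x => (x + (x - 2)⁻¹) * (Real.sqrt (fcm x))⁻¹)
      (fun x => x * (Real.sqrt (fcm x))⁻¹ + (x - 2)⁻¹ * (Real.sqrt (fcm x))⁻¹) (Ioo e₃ e₂) := by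
    intro x _; ring
  have hi1 : IntegrableOn (fun x => x * (Real.sqrt (fcm x))⁻¹) (Ioo e₃ e₂) :=
    integrableOn_mul_invSqrt_pos (by fun_prop)
  have hi2 : IntegrableOn (fun x => (x - 2)⁻¹ * (Real.sqrt (fcm x))⁻¹) (Ioo e₃ e₂) :=
    integrableOn_mul_invSqrt_pos (ContinuousOn.inv₀ (by fun_prop) (fun x hx => by linarith [hx.2, e₂_lt_two]))
  rw [setIntegral_congr_fun measurableSet_Ioo hpt, integral_add hi1 hi2, integral_inv_sub_two,
    integral_J_cm] at h
  linarith

/-- **The second integer period relation at `j = 66³`: `2J₀ − J₁ − 2K₁ = 0`.** -/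
theorem second_relation_cm :
    2 * (∫ x in Ioo e₃ e₂, (Real.sqrt (fcm x))⁻¹) - (∫ x in Ioo e₃ e₂, x * (Real.sqrt (fcm x))⁻¹)
      - 2 * (∫ x in Ioo e₂ 2, x * (Real.sqrt (-fcm x))⁻¹) = 0 := by
  rw [integral_J_cm, integral_J1_cm, integral_K1_cm]; ring


end CM66

/-- Transfer of integrability from `ℝ` to `ℝ¹`. -/
theorem integrableOn_fin_one {g : ℝ → ℝ} {S : Set ℝ} (h : IntegrableOn g S) :
    IntegrableOn (fun p : Fin 1 → ℝ => g (p 0)) {p | p 0 ∈ S} := by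
  have hmp := MeasureTheory.volume_preserving_funUnique (Fin 1) ℝ
  have hpre : {p : Fin 1 → ℝ | p 0 ∈ S} = MeasurableEquiv.funUnique (Fin 1) ℝ ⁻¹' S := by
    ext x; rfl
  rw [hpre]
  exact (hmp.integrableOn_comp_preimage (MeasurableEquiv.measurableEmbedding _)).mpr h


/-- `x/√f` is `ℚ`-semialgebraic on the root-free oval `σ` (every curve). [cite: BochnakCosteRoy1998, Prop. 2.2.6] -/
theorem isSemialgebraicFunOn_x_div_sqrt_cubic (q₂ q₃ : ℚ) :
    IsSemialgebraicFunOn ℚ (σ₁ q₂ q₃) (fun p => p 0 / Real.sqrt (cubic q₂ q₃ (p 0))) := by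
  have h1 : IsSemialgebraicFunOn ℚ (σ₁ q₂ q₃) (fun p => MvPolynomial.aeval p (MvPolynomial.X 0 : MvPolynomial (Fin 1) ℚ)) :=
    isSemialgebraicFunOn_aeval (isSemialgebraic_σ₁ q₂ q₃) _
  have h2 := IsSemialgebraicFunOn.mul_holds h1 (isSemialgebraicFunOn_inv_sqrt_cubic q₂ q₃)
  refine h2.congr (fun p _ => ?_)
  simp only [MvPolynomial.aeval_X, Pi.mul_apply]
  ring

/-- `x/√(−f)` is `ℚ`-semialgebraic on the root-free interval `σ'` (every curve). [cite: BochnakCosteRoy1998, Prop. 2.2.6] -/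
theorem isSemialgebraicFunOn_x_div_sqrt_neg_cubic (q₂ q₃ : ℚ) :
    IsSemialgebraicFunOn ℚ (σ₂ q₂ q₃) (fun p => p 0 / Real.sqrt (-cubic q₂ q₃ (p 0))) := by
  have h1 : IsSemialgebraicFunOn ℚ (σ₂ q₂ q₃) (fun p => MvPolynomial.aeval p (MvPolynomial.X 0 : MvPolynomial (Fin 1) ℚ)) :=
    isSemialgebraicFunOn_aeval (isSemialgebraic_σ₂ q₂ q₃) _
  have h2 := IsSemialgebraicFunOn.mul_holds h1 (isSemialgebraicFunOn_inv_sqrt_neg_cubic q₂ q₃)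
  refine h2.congr (fun p _ => ?_)
  simp only [MvPolynomial.aeval_X, Pi.mul_apply]
  ring

/-- **(F9b)** `J₁(44,−56) = Λ/2 − 2M₄` (`M₄ = ∫₀¹ w dw/√(4w−4w³)`). [folklore] -/
theorem J₁_cm : J₁ 44 (-56) = CM66.lemHalf - 2 * CM66.M₄ := by
  unfold J₁
  rw [σ₁_cm]
  have h := setIntegral_fin_one (fun x => x / Real.sqrt (CM66.fcm x)) (Ioo CM66.e₃ CM66.e₂)
  simp only [mem_Ioo] at h
  simp only [cubic_cm]
  rw [h, ← CM66.integral_J1_cm]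
  refine integral_congr_ae (Filter.Eventually.of_forall fun x => ?_)
  simp only [div_eq_mul_inv]

/-- **(F9b)** `K₁(44,−56) = Λ/4 + M₄`. [folklore] -/
theorem K₁_cm : K₁ 44 (-56) = CM66.lemHalf / 2 + CM66.M₄ := by
  unfold K₁
  rw [σ₂_cm]
  have h := setIntegral_fin_one (fun x => x / Real.sqrt (-CM66.fcm x)) (Ioo CM66.e₂ 2)
  simp only [mem_Ioo] at h
  simp only [cubic_cm]
  rw [h, ← CM66.integral_K1_cm]
  refine integral_congr_ae (Filter.Eventually.of_forall fun x => ?_)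
  simp only [div_eq_mul_inv]

/-- **(F9b) The second integer period relation at `j = 66³`: `2J₀ − J₁ − 2K₁ = 0`** (quasi-period
CM relation with RATIONAL coefficients; proved by the same rational 2-isogeny — first kind on the
oval for `J₁`, the form `(2−x)/((x−1)²√(−f))` on `σ'` for `K₁` — plus two Newton–Leibniz steps).
[cite: Masser1975, Lemma 3.1] -/
theorem two_J₀_sub_J₁_sub_two_K₁_cm : 2 * J₀ 44 (-56) - J₁ 44 (-56) - 2 * K₁ 44 (-56) = 0 := by
  rw [J₀_cm, J₁_cm, K₁_cm]; ring

/-- **(F9b)** A second, independent failure of the `ℚ`-rigidity at `(44,−56)`: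
`(b,c,d,e) = (2,−1,0,−2)`. [folklore] -/
theorem not_qRigidity_cm₂ :
    ¬ ∀ b c d e : ℚ, (b : ℝ) * J₀ 44 (-56) + (c : ℝ) * J₁ 44 (-56) + (d : ℝ) * K₀ 44 (-56) +
      (e : ℝ) * K₁ 44 (-56) = 0 → b = 0 ∧ c = 0 ∧ d = 0 ∧ e = 0 := by
  intro h
  have := h 2 (-1) 0 (-2) (by
    have := two_J₀_sub_J₁_sub_two_K₁_cm
    push_cast; linarith)
  norm_num at this

/-- The generator `[σ, x/√f]` at `(44,−56)` as an honest representation. [cite: KontsevichZagier2001, §1.1] -/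
def genσxCM : KZ.IntegralRep 1 where
  domain := σ₁ 44 (-56)
  integrand := fun p => p 0 / Real.sqrt (cubic 44 (-56) (p 0))
  isSemialgebraic_domain := isSemialgebraic_σ₁ 44 (-56)
  isSemialgebraicFunOn_integrand := isSemialgebraicFunOn_x_div_sqrt_cubic 44 (-56)
  integrableOn := by
    have h := integrableOn_fin_one (CM66.integrableOn_mul_invSqrt_pos (φ := fun x => x) (by fun_prop))
    have h2 : IntegrableOn (fun p : Fin 1 → ℝ => p 0 / Real.sqrt (cubic 44 (-56) (p 0)))
        {p | p 0 ∈ Ioo CM66.e₃ CM66.e₂} :=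
      h.congr_fun (fun p _ => by simp only [cubic_cm, div_eq_mul_inv])
        (measurableSet_Ioo.preimage (measurable_pi_apply 0))
    rw [σ₁_cm]
    exact h2

/-- The generator `[σ', x/√(−f)]` at `(44,−56)` as an honest representation. [cite: KontsevichZagier2001, §1.1] -/
def genσ'xCM : KZ.IntegralRep 1 where
  domain := σ₂ 44 (-56)
  integrand := fun p => p 0 / Real.sqrt (-cubic 44 (-56) (p 0))
  isSemialgebraic_domain := isSemialgebraic_σ₂ 44 (-56)
  isSemialgebraicFunOn_integrand := isSemialgebraicFunOn_x_div_sqrt_neg_cubic 44 (-56)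
  integrableOn := by
    have h := integrableOn_fin_one (CM66.integrableOn_mul_invSqrt_neg (φ := fun x => x) (by fun_prop))
    have h2 : IntegrableOn (fun p : Fin 1 → ℝ => p 0 / Real.sqrt (-cubic 44 (-56) (p 0)))
        {p | p 0 ∈ Ioo CM66.e₂ 2} :=
      h.congr_fun (fun p _ => by simp only [cubic_cm, div_eq_mul_inv])
        (measurableSet_Ioo.preimage (measurable_pi_apply 0))
    rw [σ₂_cm]
    exact h2

/-- Value of `[σ, x/√f]`. [folklore] -/
theorem genσxCM_value : genσxCM.value = CM66.lemHalf - 2 * CM66.M₄ := J₁_cm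
/-- Value of `[σ', x/√(−f)]`. [folklore] -/
theorem genσ'xCM_value : genσ'xCM.value = CM66.lemHalf / 2 + CM66.M₄ := K₁_cm

/-- **The second CM kernel element** `u₁ = 2[σ,1/√f] − [σ,x/√f] − 2[σ',x/√(−f)]` at `(44,−56)`.
[cite: KontsevichZagier2001, §1.2] -/
def cmElem₂ : KZ.FormalRep := 2 • KZ.of genσCM - KZ.of genσxCM - 2 • KZ.of genσ'xCM

/-- `[σ, x/√f] ∈ S` (`m = 1`). [folklore] -/
theorem genσxCM_mem_gens : KZ.of genσxCM ∈ Gens 44 (-56) :=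
  Or.inl (Or.inl ⟨genσxCM, 1, rfl, fun p _ => by simp [genσxCM], rfl⟩)

/-- `[σ', x/√(−f)] ∈ S` (`m = 1`). [folklore] -/
theorem genσ'xCM_mem_gens : KZ.of genσ'xCM ∈ Gens 44 (-56) :=
  Or.inl (Or.inr ⟨genσ'xCM, 1, rfl, fun p _ => by simp [genσ'xCM], rfl⟩)

/-- `u₁ ∈ closure S`. [folklore] -/
theorem cmElem₂_mem_closure : cmElem₂ ∈ AddSubgroup.closure (Gens 44 (-56)) :=
  sub_mem (sub_mem (AddSubgroup.nsmul_mem _ (AddSubgroup.subset_closure genσCM_mem_gens) 2)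
    (AddSubgroup.subset_closure genσxCM_mem_gens))
    (AddSubgroup.nsmul_mem _ (AddSubgroup.subset_closure genσ'xCM_mem_gens) 2)

/-- **(F9b)** `eval u₁ = 2J₀ − J₁ − 2K₁ = 0`: a second honest kernel element at the CM curve, involving
the periods of the SECOND kind — the `ℤ`-kernel of this sector has rank ≥ 2. [folklore] -/
theorem eval_cmElem₂ : KZ.eval cmElem₂ = 0 := by
  have h := two_J₀_sub_J₁_sub_two_K₁_cm
  rw [J₀_cm, J₁_cm, K₁_cm] at h
  simp only [cmElem₂, map_sub, map_nsmul, KZ.eval_of, genσCM_value, genσxCM_value, genσ'xCM_value]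
  simp only [nsmul_eq_mul, Nat.cast_ofNat]
  linarith

/-- `u₁` has coefficient sum `−1`: every derivation uses an additivity move. [folklore] -/
theorem cmElem₂_not_mem_closure_cov_nl :
    cmElem₂ ∉ AddSubgroup.closure (KZ.changeOfVariablesRel ∪ KZ.newtonLeibnizRel) := by
  intro h
  have h0 := KZ.closure_cov_nl_le_ker_coeffSum h
  rw [AddMonoidHom.mem_ker] at h0
  simp [cmElem₂, map_sub, map_nsmul, KZ.coeffSum_of] at h0

/-- The summit predicts `u₁ ∈ relations`: a quasi-period isogeny transfer (the analogue of the
route's `CMTwistQuasiPeriodTransfer` at `j = 8000`) that the route does not have. [cite: KontsevichZagier2001, §1.2] -/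
theorem cmElem₂_mem_relations_of_summit (h : _root_.KontsevichZagierPeriods) :
    cmElem₂ ∈ KZ.relations :=
  (kzKernelConjecture_iff_isRational.mpr h) cmElem₂ eval_cmElem₂


/-! ### §10 (F10, cycle 2) The two-torsion element at the model curve `(4,0)`:
honest, not a scissors congruence, and ONE legal rule-2 move

At `(q₂,q₃) = (4,0)` (`f = 4x³ − 4x`, roots `−1, 0, 1`) the 2-torsion translation by `(e₂,0) = (0,0)`
is the RATIONAL map `x ↦ −1/x`, carrying `σ'' = (1,∞)` onto `σ = (−1,0)` with
`f(−1/x)·x⁻⁴ = f(x)… ` i.e. weight `|d(−1/x)/dx|/√f(−1/x) = 1/√f(x)`. Hence: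
`t₀ = [σ'', 1/√f] − [σ, 1/√f]` is an honest kernel element (`eval_twoTorsionElem`), it is NOT in
the subgroup generated by the additivity moves (`twoTorsionElem_not_mem_closure_add`, window
`{x > 1}`), and it IS a single `changeOfVariablesRel` instance (`twoTorsionElem_mem_cov`: the
planner's "why it might fail" — rule 2's side conditions on the UNBOUNDED domain `(e₁,∞)`:
`ℚ`-semialgebraic map, `HasFDerivWithinAt`, injectivity, exact image, exact Jacobian weight — all
discharged in the tree's own `KZ.changeOfVariablesRel` format). `twoTorsionTransfer_four_zero` is
the `(4,0)` instance of the support item `TwoTorsionTransfer` (3413), PROVED (positive control; the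
general curve needs the cubic-irrational `eᵢ`, i.e. Tarski–Seidenberg for the graph, nothing else). -/

/-- `σ = (−1, 0)` at `(4,0)`. -/
theorem σ₁_four_zero : σ₁ 4 0 = {p | -1 < p 0 ∧ p 0 < 0} := by
  ext p
  simp only [σ₁, cubic, mem_setOf_eq, Rat.cast_ofNat, Rat.cast_zero, sub_zero]
  constructor
  · rintro ⟨h0, t, hpt, ht⟩
    -- `f t < 0 ⇒ t < 1`; `f x > 0 ∧ x < 1 ⇒ -1 < x < 0`
    have ht1 : t < 1 := by
      by_contra h; push Not at h
      nlinarith [mul_nonneg (mul_nonneg (by linarith : (0:ℝ) ≤ t) (by linarith : (0:ℝ) ≤ t - 1))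
        (by linarith : (0:ℝ) ≤ t + 1)]
    have hx1 : p 0 < 1 := hpt.trans ht1
    have key : 0 < p 0 * (p 0 - 1) * (p 0 + 1) := by nlinarith
    constructor
    · by_contra h; push Not at h
      have : p 0 * (p 0 - 1) * (p 0 + 1) ≤ 0 :=
        mul_nonpos_of_nonneg_of_nonpos (mul_nonneg_of_nonpos_of_nonpos (by linarith) (by linarith))
          (by linarith)
      linarith
    · by_contra h; push Not at h
      have : p 0 * (p 0 - 1) * (p 0 + 1) ≤ 0 :=
        mul_nonpos_of_nonpos_of_nonneg (mul_nonpos_of_nonneg_of_nonpos h (by linarith)) (by linarith)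
      linarith
  · rintro ⟨h1, h0⟩
    refine ⟨by nlinarith [mul_pos (neg_pos.mpr h0) (by nlinarith : (0:ℝ) < 1 - p 0 ^ 2)],
      1 / 2, by linarith, by norm_num⟩

/-- `∫_{(−1,0)} dx/√(4x³ − 4x) = Γ(1/4)²/(4√(2π))` over `ℝ¹` (reflection + inversion from the
`(1,∞)` value; `CM66.integral_gI_Ioo_neg`). -/
theorem setIntegral_Ioo_neg_one_zero_eq :
    ∫ p in {p : Fin 1 → ℝ | -1 < p 0 ∧ p 0 < 0}, 1 / Real.sqrt (cubic 4 0 (p 0)) = CM66.lemHalf := by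
  have h := setIntegral_fin_one (fun x => 1 / Real.sqrt (cubic 4 0 x)) (Ioo (-1) 0)
  simp only [mem_Ioo] at h
  rw [h, ← CM66.integral_gI_Ioo_neg]
  refine integral_congr_ae (Filter.Eventually.of_forall fun x => ?_)
  simp only [cubic, CM66.gI, Rat.cast_ofNat, Rat.cast_zero, sub_zero, one_div]

/-- The generator `[σ, 1/√(4x³−4x)]`, `σ = (−1,0)`, as an honest representation. -/
def genσ40 : KZ.IntegralRep 1 where
  domain := σ₁ 4 0
  integrand := fun p => 1 / Real.sqrt (cubic 4 0 (p 0))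
  isSemialgebraic_domain := isSemialgebraic_σ₁ 4 0
  isSemialgebraicFunOn_integrand := isSemialgebraicFunOn_inv_sqrt_cubic 4 0
  integrableOn := by
    rw [σ₁_four_zero]
    by_contra h
    have h0 := integral_undef h
    rw [setIntegral_Ioo_neg_one_zero_eq] at h0
    exact absurd h0 (ne_of_gt CM66.lemHalf_pos)

theorem genσ40_value : genσ40.value = CM66.lemHalf := by
  show ∫ p in σ₁ 4 0, 1 / Real.sqrt (cubic 4 0 (p 0)) = _
  rw [σ₁_four_zero, setIntegral_Ioo_neg_one_zero_eq]

theorem genIoi_value' : genIoi.value = CM66.lemHalf := genIoi_value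

theorem genσ40_mem_gens : KZ.of genσ40 ∈ Gens 4 0 :=
  Or.inl (Or.inl ⟨genσ40, 0, rfl, fun p _ => by simp [genσ40], rfl⟩)

/-- **The two-torsion element** `t₀ = [σ'', 1/√f] − [σ, 1/√f]` at `(4,0)`. -/
def twoTorsionElem : KZ.FormalRep := KZ.of genIoi - KZ.of genσ40

theorem twoTorsionElem_mem_closure : twoTorsionElem ∈ AddSubgroup.closure (Gens 4 0) :=
  sub_mem (AddSubgroup.subset_closure genIoi_mem_gens) (AddSubgroup.subset_closure genσ40_mem_gens)

/-- **(F10)** `eval t₀ = 0` — the VALUE form of the two-torsion coincidence, here elementary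
(no AGM, no `℘`). -/
theorem eval_twoTorsionElem : KZ.eval twoTorsionElem = 0 := by
  simp [twoTorsionElem, map_sub, KZ.eval_of, genIoi_value', genσ40_value]

/-- `coeffSum t₀ = 0`: consistent with `t₀` being ONE rule-2 move (it is: `twoTorsionElem_mem_cov`). -/
theorem coeffSum_twoTorsionElem : KZ.coeffSum twoTorsionElem = 0 := by
  simp [twoTorsionElem]

/-- **(F10)** `t₀` is NOT in the subgroup generated by the additivity moves (1a) + (1b): its
restricted value over the window `{x > 1}` is the full lemniscatic half-period. Every derivation of
the two-torsion coincidence uses a change of variables or a Newton–Leibniz move. -/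
theorem twoTorsionElem_not_mem_closure_add :
    twoTorsionElem ∉ AddSubgroup.closure (KZ.domainAddRel ∪ KZ.integrandAddRel) := by
  intro h
  set A : (n : ℕ) → Set (Fin n → ℝ) := fun n => {p | ∀ i, 1 < p i} with hA
  have hAm : ∀ n, MeasurableSet (A n) := by
    intro n
    have : A n = ⋂ i, {p : Fin n → ℝ | 1 < p i} := by ext p; simp [hA]
    rw [this]
    exact MeasurableSet.iInter fun i => measurableSet_lt measurable_const (measurable_pi_apply i)
  have h0 := KZ.closure_add_le_ker_restrictedEval A hAm h
  rw [AddMonoidHom.mem_ker] at h0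
  have h1 : genIoi.domain ∩ A 1 = genIoi.domain := by
    refine inter_eq_left.mpr fun p hp i => ?_
    rw [Fin.fin_one_eq_zero i]; exact hp
  have h2 : genσ40.domain ∩ A 1 = ∅ := by
    ext p
    simp only [mem_inter_iff, mem_empty_iff_false, iff_false, not_and]
    intro hp hA1
    have hp' : p ∈ σ₁ 4 0 := hp
    rw [σ₁_four_zero] at hp'
    linarith [hA1 0, hp'.2]
  simp only [twoTorsionElem, map_sub, KZ.restrictedEval_of, h1, h2, Measure.restrict_empty,
    integral_zero_measure, sub_zero] at h0
  have h3 : genIoi.value = 0 := h0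
  rw [genIoi_value'] at h3
  exact absurd h3 (ne_of_gt CM66.lemHalf_pos)

/-! #### Positive control: `t₀` is ONE change-of-variables move -/

/-- The two-torsion translation at `(4,0)`: `x ↦ −1/x` on `ℝ¹`. -/
def invMap (p : Fin 1 → ℝ) : Fin 1 → ℝ := fun _ => -(p 0)⁻¹

/-- Its derivative `x⁻² • id`. -/
def invMapDeriv (p : Fin 1 → ℝ) : (Fin 1 → ℝ) →L[ℝ] (Fin 1 → ℝ) :=
  ((p 0) ^ 2)⁻¹ • ContinuousLinearMap.id ℝ (Fin 1 → ℝ)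

theorem hasFDerivAt_invMap {p : Fin 1 → ℝ} (hp : p 0 ≠ 0) :
    HasFDerivAt invMap (invMapDeriv p) p := by
  have h1 : HasFDerivAt (fun q : Fin 1 → ℝ => q 0) (ContinuousLinearMap.proj 0) p :=
    hasFDerivAt_apply (𝕜 := ℝ) 0 p
  have h2 : HasFDerivAt (fun q : Fin 1 → ℝ => -(q 0)⁻¹)
      (-((-(p 0 ^ 2)⁻¹) • ContinuousLinearMap.proj (R := ℝ) (φ := fun _ : Fin 1 => ℝ) 0)) p :=
    ((hasDerivAt_inv hp).comp_hasFDerivAt p h1).neg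
  rw [hasFDerivAt_pi']
  intro i
  have h3 : (ContinuousLinearMap.proj i).comp (invMapDeriv p) =
      -((-(p 0 ^ 2)⁻¹) • ContinuousLinearMap.proj (R := ℝ) (φ := fun _ : Fin 1 => ℝ) 0) := by
    ext v
    simp [invMapDeriv, Fin.fin_one_eq_zero i]
  rw [h3]
  exact h2

theorem det_invMapDeriv (p : Fin 1 → ℝ) : (invMapDeriv p).det = ((p 0) ^ 2)⁻¹ := by
  have h1 : ((invMapDeriv p : (Fin 1 → ℝ) →L[ℝ] (Fin 1 → ℝ)) : (Fin 1 → ℝ) →ₗ[ℝ] (Fin 1 → ℝ)) =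
      ((p 0) ^ 2)⁻¹ • LinearMap.id := by
    ext x i; simp [invMapDeriv]
  unfold ContinuousLinearMap.det
  rw [h1, LinearMap.det_smul, LinearMap.det_id, Module.finrank_fin_fun]
  simp

theorem invMap_injOn : InjOn invMap {p : Fin 1 → ℝ | 1 < p 0} := by
  intro p _ q _ h
  have h0 : -(p 0)⁻¹ = -(q 0)⁻¹ := congr_fun h 0
  have h1 : p 0 = q 0 := inv_injective (neg_injective h0)
  funext i
  rw [Fin.fin_one_eq_zero i]; exact h1

theorem invMap_image : invMap '' {p : Fin 1 → ℝ | 1 < p 0} = {p | -1 < p 0 ∧ p 0 < 0} := by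
  ext q
  simp only [mem_image, mem_setOf_eq]
  constructor
  · rintro ⟨p, hp, rfl⟩
    have hp0 : 0 < p 0 := by linarith
    refine ⟨?_, ?_⟩
    · show -1 < -(p 0)⁻¹
      have := inv_lt_one_of_one_lt₀ hp
      linarith
    · show -(p 0)⁻¹ < 0
      have := inv_pos.mpr hp0
      linarith
  · rintro ⟨h1, h0⟩
    refine ⟨fun _ => -(q 0)⁻¹, ?_, ?_⟩
    · show 1 < -(q 0)⁻¹
      rw [← inv_neg]
      exact (one_lt_inv₀ (by linarith)).mpr (by linarith)
    · funext i
      rw [Fin.fin_one_eq_zero i]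
      simp [invMap]

theorem isSemialgebraicMapOn_invMap : IsSemialgebraicMapOn ℚ {p : Fin 1 → ℝ | 1 < p 0} invMap := by
  refine IsSemialgebraicMapOn.of_forall isSemialgebraic_Ioi_one fun j => ?_
  have hne : ∀ p ∈ {p : Fin 1 → ℝ | 1 < p 0}, MvPolynomial.aeval p (MvPolynomial.X 0 : MvPolynomial (Fin 1) ℚ) ≠ 0 := by
    intro p hp
    have hp : 1 < p 0 := hp
    simp only [MvPolynomial.aeval_X]
    linarith
  refine (isSemialgebraicFunOn_aeval_div_aeval isSemialgebraic_Ioi_one (-1 : MvPolynomial (Fin 1) ℚ)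
    (MvPolynomial.X 0) hne).congr fun p _ => ?_
  simp [invMap, neg_div]

/-- The Jacobian weight of `x ↦ −1/x` on `4x³ − 4x`: `1/√f(x) = (1/√f(−1/x))·x⁻²` for `x > 1`. -/
theorem invMap_weight {v : ℝ} (hv : 1 < v) :
    1 / Real.sqrt (cubic 4 0 v) = 1 / Real.sqrt (cubic 4 0 (-v⁻¹)) * |(v ^ 2)⁻¹| := by
  have hv0 : 0 < v := by linarith
  have hv2 : 0 < v ^ 2 := by positivity
  simp only [cubic, Rat.cast_ofNat, Rat.cast_zero, sub_zero, one_div]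
  have hq : 4 * (-v⁻¹) ^ 3 - 4 * (-v⁻¹) = (4 * v ^ 3 - 4 * v) / (v ^ 2) ^ 2 := by
    field_simp
    ring
  rw [hq, Real.sqrt_div' _ (by positivity), Real.sqrt_sq hv2.le, abs_of_pos (inv_pos.mpr hv2)]
  have hpos : 0 < 4 * v ^ 3 - 4 * v := by nlinarith
  have hs : 0 < Real.sqrt (4 * v ^ 3 - 4 * v) := Real.sqrt_pos.mpr hpos
  field_simp

/-- **(F10) Positive control**: `t₀` is literally ONE `KZ.changeOfVariablesRel` instance
(`Φ = −1/x` on the unbounded domain `(1,∞)`: `ℚ`-semialgebraic map, derivative within the domain,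
injective, image exactly `σ`, weight exactly `1/√f`). -/
theorem twoTorsionElem_mem_cov : twoTorsionElem ∈ KZ.changeOfVariablesRel := by
  refine ⟨1, genIoi, genσ40, invMap, invMapDeriv, isSemialgebraicMapOn_invMap,
    fun p hp => (hasFDerivAt_invMap ?_).hasFDerivWithinAt, invMap_injOn, ?_, fun p hp => ?_, rfl⟩
  · have hp : 1 < p 0 := hp
    exact ne_of_gt (by linarith)
  · show σ₁ 4 0 = invMap '' {p : Fin 1 → ℝ | 1 < p 0}
    rw [σ₁_four_zero, invMap_image]
  · have hp : 1 < p 0 := hp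
    rw [det_invMapDeriv]
    exact invMap_weight hp

/-- Hence `t₀ ∈ relations`. -/
theorem twoTorsionElem_mem_relations : twoTorsionElem ∈ KZ.relations :=
  KZ.changeOfVariablesRel_subset_relations twoTorsionElem_mem_cov

/-- **(F10)** The `(4,0)` instance of the support item `TwoTorsionTransfer` (3413), for ARBITRARY
presentations `r, r'` of the two generators (the `EqOn` junk is absorbed by `equivalent_of_eqOn`). -/
theorem twoTorsionTransfer_four_zero (r r' : KZ.IntegralRep 1) (hr : r.domain = σ₃ 4 0)
    (hri : EqOn r.integrand (fun p => 1 / Real.sqrt (cubic 4 0 (p 0))) (σ₃ 4 0))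
    (hr' : r'.domain = σ₁ 4 0)
    (hri' : EqOn r'.integrand (fun p => 1 / Real.sqrt (cubic 4 0 (p 0))) (σ₁ 4 0)) :
    KZ.Equivalent r r' := by
  have e1 : KZ.Equivalent r genIoi := by
    refine equivalent_of_eqOn ?_ ?_
    · show {p : Fin 1 → ℝ | 1 < p 0} = r.domain
      rw [hr, σ₃_four_zero]
    · rw [hr]; intro p hp; rw [hri hp]; rfl
  have e2 : KZ.Equivalent genσ40 r' :=
    (equivalent_of_eqOn (by rw [hr']; rfl) (by rw [hr']; intro p hp; rw [hri' hp]; rfl)).symm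
  exact e1.trans ((show KZ.Equivalent genIoi genσ40 from twoTorsionElem_mem_relations).trans e2)


/-! ### §11 (F12, cycle 3) The complete period-relation module at `(44,−56)`: Euler's Beta integral
(`Λ·M₄ = π/4`), Masser's Theorem III for `ϖ₀(ℤi + ℤ)` (a tree THEOREM, from Chudnovsky), the exact
2-dimensional relation space, EMK's hypothesis PROVED there, and the exact remaining content of the
crux's conclusion (two isogeny transfers). Landing twin: `Negative/TranscendenceCM66.lean`. -/

namespace CM66

open Real

/-- **Euler's Beta integral at `(3/4, 1/2)`**: `∫₀¹ x^{-1/4}(1 − x)^{-1/2} dx = Γ(3/4)Γ(1/2)/Γ(5/4)`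
(real form of Mathlib's `Complex.betaIntegral_eq_Gamma_mul_div`). [folklore] -/
theorem integral_rpow_neg_quarter_mul_rpow_neg_half :
    ∫ x in (0 : ℝ)..1, x ^ (-(1 / 4 : ℝ)) * (1 - x) ^ (-(1 / 2 : ℝ)) =
      Real.Gamma (3 / 4) * Real.Gamma (1 / 2) / Real.Gamma (5 / 4) := by
  have hB := Complex.betaIntegral_eq_Gamma_mul_div (3 / 4 : ℂ) (1 / 2 : ℂ) (by norm_num)
    (by norm_num)
  have hlhs : Complex.betaIntegral (3 / 4 : ℂ) (1 / 2 : ℂ) =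
      ((∫ x in (0 : ℝ)..1, x ^ (-(1 / 4 : ℝ)) * (1 - x) ^ (-(1 / 2 : ℝ)) : ℝ) : ℂ) := by
    unfold Complex.betaIntegral
    rw [← intervalIntegral.integral_ofReal]
    refine intervalIntegral.integral_congr (fun x hx => ?_)
    rw [uIcc_of_le zero_le_one] at hx
    have h1 : (x : ℂ) ^ ((3 / 4 : ℂ) - 1) = ((x ^ (-(1 / 4 : ℝ)) : ℝ) : ℂ) := by
      rw [Complex.ofReal_cpow hx.1]; push_cast; ring_nf
    have h2 : (1 - (x : ℂ)) ^ ((1 / 2 : ℂ) - 1) = (((1 - x) ^ (-(1 / 2 : ℝ)) : ℝ) : ℂ) := by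
      rw [Complex.ofReal_cpow (by linarith [hx.2])]; push_cast; ring_nf
    simp only [h1, h2]
    push_cast
    ring
  rw [hlhs] at hB
  have hrhs : Complex.Gamma (3 / 4 : ℂ) * Complex.Gamma (1 / 2 : ℂ) /
      Complex.Gamma ((3 / 4 : ℂ) + 1 / 2) =
      ((Real.Gamma (3 / 4) * Real.Gamma (1 / 2) / Real.Gamma (5 / 4) : ℝ) : ℂ) := by
    rw [show (3 / 4 : ℂ) + 1 / 2 = ((5 / 4 : ℝ) : ℂ) by push_cast; ring,
      show (3 / 4 : ℂ) = ((3 / 4 : ℝ) : ℂ) by push_cast; ring,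
      show (1 / 2 : ℂ) = ((1 / 2 : ℝ) : ℂ) by push_cast; ring,
      Complex.Gamma_ofReal, Complex.Gamma_ofReal, Complex.Gamma_ofReal]
    push_cast
    ring
  rw [hrhs] at hB
  exact_mod_cast hB

/-- `Γ(3/4)Γ(1/2)/Γ(5/4) = 4π√(2π)/Γ(1/4)²` (`Γ(5/4) = Γ(1/4)/4`, reflection
`Γ(1/4)Γ(3/4) = π√2`, `Γ(1/2) = √π`). [folklore] -/
theorem Gamma_three_quarters_mul_Gamma_half_div_Gamma_five_quarters :
    Real.Gamma (3 / 4) * Real.Gamma (1 / 2) / Real.Gamma (5 / 4) =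
      4 * π * Real.sqrt (2 * π) / Real.Gamma (1 / 4) ^ 2 := by
  have hrefl := Real.Gamma_mul_Gamma_one_sub (1 / 4 : ℝ)
  rw [show (1 : ℝ) - 1 / 4 = 3 / 4 by norm_num, show π * (1 / 4 : ℝ) = π / 4 by ring,
    Real.sin_pi_div_four] at hrefl
  have h54 : Real.Gamma (5 / 4) = 1 / 4 * Real.Gamma (1 / 4) := by
    rw [show (5 / 4 : ℝ) = 1 / 4 + 1 by norm_num, Real.Gamma_add_one (by norm_num)]
  have h14 : Real.Gamma (1 / 4) ≠ 0 := (Real.Gamma_pos_of_pos (by norm_num)).ne'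
  have hs2 : Real.sqrt 2 ≠ 0 := by positivity
  have hsπ : Real.sqrt π ≠ 0 := by positivity
  have h34eq : Real.Gamma (3 / 4) = π / (Real.sqrt 2 / 2) / Real.Gamma (1 / 4) := by
    rw [← hrefl]; field_simp
  rw [h54, h34eq, Real.Gamma_one_half_eq, Real.sqrt_mul' _ Real.pi_pos.le]
  have h22 : Real.sqrt 2 ^ 2 = 2 := Real.sq_sqrt (by norm_num : (0:ℝ) ≤ 2)
  field_simp
  linear_combination -h22


/-- Pointwise identity behind the substitution `x = w²` in `M₄`: for `0 < w < 1`,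
`2w · (w²)^{-1/4} (1 − w²)^{-1/2} = 4 · w/√(4w − 4w³)`. [folklore] -/
theorem M₄_subst_identity {w : ℝ} (hw0 : 0 < w) (hw1 : w < 1) :
    2 * w ^ ((2:ℝ) - 1) * ((w ^ (2:ℝ)) ^ (-(1 / 4 : ℝ)) * (1 - w ^ (2:ℝ)) ^ (-(1 / 2 : ℝ))) =
      4 * (w * hI w) := by
  have hb : 0 < 1 - w ^ 2 := by nlinarith
  have e0 : w ^ ((2:ℝ) - 1) = w := by norm_num
  have e1 : (w ^ (2:ℝ)) ^ (-(1 / 4 : ℝ)) = w ^ (-(1 / 2 : ℝ)) := by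
    rw [← Real.rpow_mul hw0.le]; norm_num
  have e2 : (1 - w ^ (2:ℝ)) = 1 - w ^ 2 := by rw [Real.rpow_two]
  have e3 : hI w = (2 * (w ^ (1 / 2 : ℝ) * (1 - w ^ 2) ^ (1 / 2 : ℝ)))⁻¹ := by
    unfold hI
    rw [show 4 * w - 4 * w ^ 3 = 4 * (w * (1 - w ^ 2)) by ring,
      Real.sqrt_mul (by norm_num : (0:ℝ) ≤ 4), show (4:ℝ) = 2 ^ 2 by norm_num,
      Real.sqrt_sq (by norm_num : (0:ℝ) ≤ 2), Real.sqrt_eq_rpow, Real.mul_rpow hw0.le hb.le]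
  rw [e0, e1, e2, e3, Real.rpow_neg hw0.le, Real.rpow_neg hb.le]
  have h1 : 0 < w ^ (1 / 2 : ℝ) := Real.rpow_pos_of_pos hw0 _
  have h2 : 0 < (1 - w ^ 2) ^ (1 / 2 : ℝ) := Real.rpow_pos_of_pos hb _
  field_simp
  ring

/-- **`4M₄ = B(3/4, 1/2)`** by the substitution `x = w²` (Mathlib `integral_comp_rpow_Ioi`, `p = 2`).
[folklore] -/
theorem four_mul_M₄_eq_beta :
    4 * M₄ = Real.Gamma (3 / 4) * Real.Gamma (1 / 2) / Real.Gamma (5 / 4) := by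
  set h : ℝ → ℝ := fun y => y ^ (-(1 / 4 : ℝ)) * (1 - y) ^ (-(1 / 2 : ℝ)) with hh
  have key := integral_comp_rpow_Ioi (indicator (Ioo 0 1) h) (p := 2) (by norm_num)
  rw [setIntegral_indicator measurableSet_Ioo,
    show Ioi (0 : ℝ) ∩ Ioo 0 1 = Ioo 0 1 from inter_eq_right.mpr Ioo_subset_Ioi_self,
    ← integral_Ioc_eq_integral_Ioo, ← intervalIntegral.integral_of_le zero_le_one] at key
  have hbeta : ∫ y in (0 : ℝ)..1, h y =
      Real.Gamma (3 / 4) * Real.Gamma (1 / 2) / Real.Gamma (5 / 4) := by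
    simp only [hh]
    rw [integral_rpow_neg_quarter_mul_rpow_neg_half]
  rw [hbeta] at key
  have hL : EqOn (fun x : ℝ => (|(2 : ℝ)| * x ^ ((2 : ℝ) - 1)) • indicator (Ioo 0 1) h (x ^ (2 : ℝ)))
      (indicator (Ioo 0 1) fun w => 4 * (w * hI w)) (Ioi 0) := by
    intro w hw
    have hw0 : 0 < w := hw
    simp only
    by_cases h1 : w < 1
    · have hmem : w ^ (2 : ℝ) ∈ Ioo (0 : ℝ) 1 := by
        rw [Real.rpow_two]
        exact ⟨by positivity, by nlinarith⟩
      rw [indicator_of_mem hmem, indicator_of_mem (show w ∈ Ioo (0 : ℝ) 1 from ⟨hw0, h1⟩),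
        smul_eq_mul, show |(2 : ℝ)| = 2 by norm_num, hh]
      exact M₄_subst_identity hw0 h1
    · have hnot : w ^ (2 : ℝ) ∉ Ioo (0 : ℝ) 1 := by
        rintro ⟨-, hlt⟩
        rw [Real.rpow_two] at hlt
        have hw1 : 1 ≤ w := not_lt.mp h1
        nlinarith
      rw [indicator_of_notMem hnot,
        indicator_of_notMem (show w ∉ Ioo (0 : ℝ) 1 from fun h' => h1 h'.2), smul_zero]
  rw [setIntegral_congr_fun measurableSet_Ioi hL, setIntegral_indicator measurableSet_Ioo,
    show Ioi (0 : ℝ) ∩ Ioo 0 1 = Ioo 0 1 from inter_eq_right.mpr Ioo_subset_Ioi_self,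
    integral_const_mul] at key
  exact key

/-- **`M₄ = π√(2π)/Γ(1/4)²`** (`= ¼B(3/4,1/2) = 0.59907…`). [folklore] -/
theorem M₄_eq : M₄ = π * Real.sqrt (2 * π) / Real.Gamma (1 / 4) ^ 2 := by
  have h := four_mul_M₄_eq_beta
  rw [Gamma_three_quarters_mul_Gamma_half_div_Gamma_five_quarters] at h
  have h14 : Real.Gamma (1 / 4) ≠ 0 := (Real.Gamma_pos_of_pos (by norm_num)).ne'
  field_simp at h ⊢
  linarith

/-- **Legendre's relation at the lemniscatic point, as a Beta-function identity**:
`lemHalf · M₄ = π/4`, i.e. `J₀(44,−56)·M₄ = π/4` (`lemHalf = Γ(1/4)²/(4√(2π))`). [folklore] -/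
theorem lemHalf_mul_M₄ : lemHalf * M₄ = π / 4 := by
  rw [M₄_eq, lemHalf]
  have h14 : Real.Gamma (1 / 4) ≠ 0 := (Real.Gamma_pos_of_pos (by norm_num)).ne'
  have hs : Real.sqrt (2 * π) ≠ 0 := by positivity
  field_simp

/-- `M₄ = π/(4·lemHalf)`. [folklore] -/
theorem M₄_eq_pi_div : M₄ = π / (4 * lemHalf) := by
  have h := lemHalf_mul_M₄
  have hl := lemHalf_pos
  field_simp
  linarith


/-! ### Part B: the scaled Gaussian lattice `ϖ₀(ℤi + ℤ)` (`g₂ = 4`, `g₃ = 0`, CM by `i`) and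
Masser's Theorem III (PROVED in the tree from Chudnovsky): `1, π, ϖ₀, π/ϖ₀` are `ℚ̄`-independent -/

open Complex in
/-- The lemniscatic constant `ϖ₀ = Γ(1/4)²/(2√(2π)) = 2·lemHalf` (real period of `y² = x³ − x`).
[folklore] -/
def varpi : ℝ := Real.Gamma (1 / 4) ^ 2 / (2 * Real.sqrt (2 * π))

/-- `ϖ₀ = 2·lemHalf`. [folklore] -/
theorem varpi_eq : varpi = 2 * lemHalf := by
  unfold varpi lemHalf
  have hs : Real.sqrt (2 * π) ≠ 0 := by positivity
  field_simp
  ring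

/-- `0 < ϖ₀`. [folklore] -/
theorem varpi_pos : 0 < varpi := by rw [varpi_eq]; exact mul_pos two_pos lemHalf_pos

/-- `(ϖ₀ : ℂ) ≠ 0`. [folklore] -/
theorem varpi_ne : ((varpi : ℝ) : ℂ) ≠ 0 := Complex.ofReal_ne_zero.mpr varpi_pos.ne'

/-- The period lattice `ϖ₀(ℤi + ℤ)` of `y² = 4x³ − 4x` as a Mathlib `PeriodPair`
(`ω₁ = ϖ₀ i`, `ω₂ = ϖ₀`). [folklore] -/
def gaussFour : PeriodPair :=
  (PeriodPair.ofUpperHalfPlane UpperHalfPlane.I).mulLeft ((varpi : ℝ) : ℂ) varpi_ne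

/-- `g₂(ϖ₀(ℤi+ℤ)) = 4` (from the tree's `g₂(ℤi + ℤ) = 4ϖ₀⁴`). [folklore] -/
theorem g₂_gaussFour : gaussFour.g₂ = 4 := by
  have h : ((varpi : ℝ) : ℂ) ≠ 0 := varpi_ne
  have e : (PeriodPair.ofUpperHalfPlane UpperHalfPlane.I).g₂ = 4 * ((varpi : ℝ) : ℂ) ^ 4 :=
    Literature.NumberTheory.EllipticCurves.GaussianLattice.g₂_eq_varpi'
  rw [gaussFour, PeriodPair.g₂_mulLeft, e]
  field_simp

/-- `g₃(ϖ₀(ℤi+ℤ)) = 0`. [folklore] -/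
theorem g₃_gaussFour : gaussFour.g₃ = 0 := by
  rw [gaussFour, PeriodPair.g₃_mulLeft, PeriodPair.g₃_ofUpperHalfPlane_I, mul_zero]

/-- The lattice `ϖ₀(ℤi + ℤ)` has complex multiplication (by `i`). [folklore] -/
theorem hasCM_gaussFour : gaussFour.HasCM := by
  refine ⟨Complex.I, fun n h => ?_, fun l hl => ?_⟩
  · have := congrArg Complex.im h
    simp at this
  · rw [gaussFour, PeriodPair.mem_mulLeft_lattice] at hl ⊢
    rw [show ((varpi : ℝ) : ℂ)⁻¹ * (Complex.I * l) = Complex.I * (((varpi : ℝ) : ℂ)⁻¹ * l) by ring]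
    exact (PeriodPair.I_mul_mem_lattice_ofUpperHalfPlane_I_iff _).mpr hl

/-- `ω₁ = ϖ₀ i`. [folklore] -/
theorem ω₁_gaussFour : gaussFour.ω₁ = ((varpi : ℝ) : ℂ) * Complex.I := by
  simp [gaussFour]

/-- `η₁ = −πi/ϖ₀` (tree: `η₁(ℤi + ℤ) = −πi`, homogeneity of degree `−1`). [folklore] -/
theorem η₁_gaussFour : gaussFour.η₁ = ((varpi : ℝ) : ℂ)⁻¹ * (-(π * Complex.I)) := by
  rw [gaussFour, PeriodPair.η₁_mulLeft _ varpi_ne,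
    Literature.NumberTheory.EllipticCurves.GaussianLattice.η₁_eq]

/-- **Masser's Theorem III at the lemniscatic lattice** (tree theorem
`masser_ellipticPeriods_cm_holds`, proved from Chudnovsky): `1, 2πi, ϖ₀i, −πi/ϖ₀` are linearly
independent over `ℚ̄`. [cite: Masser1975, Ch. III Thm. III] -/
theorem masser_gaussFour :
    Literature.NumberTheory.Transcendental.QbarLinearIndependent
      ![(1 : ℂ), 2 * π * Complex.I, ((varpi : ℝ) : ℂ) * Complex.I,
        ((varpi : ℝ) : ℂ)⁻¹ * (-(π * Complex.I))] := by
  have h2 : IsAlgebraic ℚ gaussFour.g₂ := by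
    rw [g₂_gaussFour]
    have : IsAlgebraic ℚ ((4 : ℚ) : ℂ) := isAlgebraic_algebraMap _
    simpa using this
  have h3 : IsAlgebraic ℚ gaussFour.g₃ := by rw [g₃_gaussFour]; exact isAlgebraic_zero
  have h := Literature.NumberTheory.Transcendental.masser_ellipticPeriods_cm_holds gaussFour h2 h3
    hasCM_gaussFour
  rwa [ω₁_gaussFour, η₁_gaussFour] at h

/-- `i` is algebraic. [folklore] -/
theorem isAlgebraic_I : IsAlgebraic ℚ Complex.I := by
  refine IsAlgebraic.of_pow two_pos ?_
  rw [Complex.I_sq]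
  exact isAlgebraic_one.neg

/-- A real algebraic number is algebraic as a complex number. [folklore] -/
theorem isAlgebraic_ofReal {a : ℝ} (ha : IsAlgebraic ℚ a) : IsAlgebraic ℚ (a : ℂ) := by
  have h := ha.algebraMap (A := ℂ)
  rwa [Complex.coe_algebraMap] at h

/-- **`1, lemHalf, M₄` are linearly independent over the real algebraic numbers**
(`lemHalf = ϖ₀/2 = J₀(44,−56)`, `M₄ = π/(2ϖ₀)`): the transcendence input for the complete list of
period relations at `j = 66³`. [cite: Masser1975, Ch. III Thm. III] -/
theorem qbarIndep_one_lemHalf_M₄ (a b c : ℝ) (ha : IsAlgebraic ℚ a) (hb : IsAlgebraic ℚ b)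
    (hc : IsAlgebraic ℚ c) (h : a + b * lemHalf + c * M₄ = 0) : a = 0 ∧ b = 0 ∧ c = 0 := by
  have hl : lemHalf = varpi / 2 := by rw [varpi_eq]; ring
  have hM : M₄ = π / (2 * varpi) := by rw [M₄_eq_pi_div, varpi_eq]; ring
  have hv : varpi ≠ 0 := varpi_pos.ne'
  -- coefficient vector on Masser's basis `(1, 2πi, ϖ₀ i, −πi/ϖ₀)`
  let β : Fin 4 → ℂ := ![(a : ℂ), 0, -(Complex.I * b) / 2, Complex.I * c / 2]
  have hβ : ∀ i, IsAlgebraic ℚ (β i) := by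
    have h2 : IsAlgebraic ℚ ((2 : ℚ) : ℂ) := isAlgebraic_algebraMap _
    have h2' : IsAlgebraic ℚ (2 : ℂ) := by simpa using h2
    have hinv : IsAlgebraic ℚ ((2 : ℂ)⁻¹) := h2'.inv
    intro i
    fin_cases i
    · exact isAlgebraic_ofReal ha
    · exact isAlgebraic_zero
    · show IsAlgebraic ℚ (-(Complex.I * (b : ℂ)) / 2)
      rw [div_eq_mul_inv]
      exact ((isAlgebraic_I.mul (isAlgebraic_ofReal hb)).neg).mul hinv
    · show IsAlgebraic ℚ (Complex.I * (c : ℂ) / 2)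
      rw [div_eq_mul_inv]
      exact (isAlgebraic_I.mul (isAlgebraic_ofReal hc)).mul hinv
  have hsum : ∑ i, β i * ![(1 : ℂ), 2 * π * Complex.I, ((varpi : ℝ) : ℂ) * Complex.I,
      ((varpi : ℝ) : ℂ)⁻¹ * (-(π * Complex.I))] i = 0 := by
    simp only [Fin.sum_univ_four, β, Matrix.cons_val_zero, Matrix.cons_val_one, Matrix.head_cons,
      Matrix.cons_val_two, Matrix.tail_cons, Matrix.cons_val_three]
    have key : (a : ℂ) + (b : ℂ) * (varpi / 2 : ℝ) + (c : ℂ) * (π / (2 * varpi) : ℝ) = 0 := by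
      rw [← hl, ← hM]; exact_mod_cast h
    push_cast at key
    linear_combination key + (-((b : ℂ) * varpi / 2 + (c : ℂ) * π / (2 * varpi))) * Complex.I_sq
  have hz := masser_gaussFour β hβ hsum
  have ha0 : (a : ℂ) = 0 := hz 0
  have hb0 : -(Complex.I * b) / 2 = (0 : ℂ) := hz 2
  have hc0 : Complex.I * c / 2 = (0 : ℂ) := hz 3
  refine ⟨by exact_mod_cast ha0, ?_, ?_⟩
  · have : (b : ℂ) = 0 := by simpa [Complex.I_ne_zero] using hb0
    exact_mod_cast this
  · have : (c : ℂ) = 0 := by simpa [Complex.I_ne_zero] using hc0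
    exact_mod_cast this

end CM66



/-- A rational integer is a real algebraic number. [folklore] -/
theorem isAlgebraic_intCast (n : ℤ) : IsAlgebraic ℚ (n : ℝ) := by
  have h : IsAlgebraic ℚ ((n : ℚ) : ℝ) := isAlgebraic_algebraMap _
  simpa using h

/-- **(F12) `J₁(44,−56) = Λ/2 − π/Λ`** in closed form (`Λ/2 = lemHalf = Γ(1/4)²/(4√(2π))`).
[folklore] -/
theorem J₁_cm_closed : J₁ 44 (-56) = CM66.lemHalf - Real.pi / (2 * CM66.lemHalf) := by
  rw [J₁_cm, CM66.M₄_eq_pi_div]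
  have hl := CM66.lemHalf_pos
  field_simp
  ring

/-- **(F12) `K₁(44,−56) = Λ/4 + π/(2Λ)`** in closed form. [folklore] -/
theorem K₁_cm_closed : K₁ 44 (-56) = CM66.lemHalf / 2 + Real.pi / (4 * CM66.lemHalf) := by
  rw [K₁_cm, CM66.M₄_eq_pi_div]

/-- **(F12) Legendre's relation at `(44,−56)`**: `J₀K₁ − J₁K₀ = π/2` — the only universal
(quadratic, `π`-valued) relation, here a checked identity. [cite: Lawden1989, §6.13] -/
theorem legendre_cm :
    J₀ 44 (-56) * K₁ 44 (-56) - J₁ 44 (-56) * K₀ 44 (-56) = Real.pi / 2 := by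
  rw [J₀_cm, K₀_cm, J₁_cm, K₁_cm]
  have h := CM66.lemHalf_mul_M₄
  linear_combination 2 * h

/-- **(F12) THE COMPLETE LIST OF `ℚ̄`-LINEAR RELATIONS among `1, J₀, J₁, K₀, K₁` at the rational CM
curve `y² = 4x³ − 44x + 56` (`j = 66³`)**: a relation with real algebraic coefficients
`a + bJ₀ + cJ₁ + dK₀ + eK₁ = 0` holds iff `a = 0`, `e = 2c`, `2b + 4c + d = 0` — a 2-dimensional
space spanned by `J₀ − 2K₀ = 0` (F9) and `2J₀ − J₁ − 2K₁ = 0` (F9b). Inputs: the rational 2-isogeny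
(F9/F9b: all four numbers in `ℚΛ + ℚM₄`), Euler's Beta integral (`ΛM₄ = π/2`), and Masser's
Theorem III for `ϖ₀(ℤi + ℤ)` (tree theorem, from Chudnovsky). So the crux's inlined hypothesis
fails at `(44,−56)` in EXACTLY two independent ways. [cite: Masser1975, Ch. III Thm. III, Lemma 3.1] -/
theorem relation_cm_iff (a b c d e : ℝ) (ha : IsAlgebraic ℚ a) (hb : IsAlgebraic ℚ b)
    (hc : IsAlgebraic ℚ c) (hd : IsAlgebraic ℚ d) (he : IsAlgebraic ℚ e) :
    a + b * J₀ 44 (-56) + c * J₁ 44 (-56) + d * K₀ 44 (-56) + e * K₁ 44 (-56) = 0 ↔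
      a = 0 ∧ e = 2 * c ∧ 2 * b + 4 * c + d = 0 := by
  rw [J₀_cm, K₀_cm, J₁_cm, K₁_cm]
  constructor
  · intro h
    have htwo : IsAlgebraic ℚ (2 : ℝ) := by simpa using isAlgebraic_ratCast 2
    have hhalf : IsAlgebraic ℚ ((2 : ℝ)⁻¹) := htwo.inv
    have h' : a + (b + c + d * 2⁻¹ + e * 2⁻¹) * CM66.lemHalf + (e - 2 * c) * CM66.M₄ = 0 := by
      linear_combination h
    have halg₁ : IsAlgebraic ℚ (b + c + d * 2⁻¹ + e * 2⁻¹) :=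
      ((hb.add hc).add (hd.mul hhalf)).add (he.mul hhalf)
    have halg₂ : IsAlgebraic ℚ (e - 2 * c) := he.sub (htwo.mul hc)
    obtain ⟨h0, h1, h2⟩ := CM66.qbarIndep_one_lemHalf_M₄ a _ _ ha halg₁ halg₂ h'
    refine ⟨h0, by linarith, by linarith⟩
  · rintro ⟨h0, h1, h2⟩
    have hd' : d = -(2 * b + 4 * c) := by linarith
    subst h0
    rw [h1, hd']
    ring

/-- **(F12) EllipticMomentKernel's inlined hypothesis HOLDS at `(44,−56)`**: `1, J₀, J₁` are linearly
independent over the real algebraic numbers (`d = e = 0` in `relation_cm_iff`) — unconditionally,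
in Lean. [cite: Masser1975, Ch. III Thm. III] -/
theorem rigid_one_J₀_J₁_cm (a b c : ℝ) (ha : IsAlgebraic ℚ a) (hb : IsAlgebraic ℚ b)
    (hc : IsAlgebraic ℚ c) (h : a + b * J₀ 44 (-56) + c * J₁ 44 (-56) = 0) :
    a = 0 ∧ b = 0 ∧ c = 0 := by
  have h5 := (relation_cm_iff a b c 0 0 ha hb hc isAlgebraic_zero isAlgebraic_zero).mp
    (by rw [zero_mul, zero_mul, add_zero, add_zero]; exact h)
  obtain ⟨h0, h1, h2⟩ := h5
  refine ⟨h0, by linarith, by linarith⟩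

/-- **(F12) … likewise `1, K₀, K₁`** (`b = c = 0`). [cite: Masser1975, Ch. III Thm. III] -/
theorem rigid_one_K₀_K₁_cm (a d e : ℝ) (ha : IsAlgebraic ℚ a) (hd : IsAlgebraic ℚ d)
    (he : IsAlgebraic ℚ e) (h : a + d * K₀ 44 (-56) + e * K₁ 44 (-56) = 0) :
    a = 0 ∧ d = 0 ∧ e = 0 := by
  have h5 := (relation_cm_iff a 0 0 d e ha isAlgebraic_zero isAlgebraic_zero hd he).mp
    (by rw [zero_mul, zero_mul, add_zero, add_zero]; exact h)
  obtain ⟨h0, h1, h2⟩ := h5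
  refine ⟨h0, by linarith, by linarith⟩

/-- **(F12) The sibling crux `EllipticMomentKernel` (stmt-…-10631) is NON-VACUOUS at a rational CM
curve, in Lean**: its inlined rigidity hypothesis `Rigid 44 (−56)` is a theorem. [cite: Masser1975, Ch. III Thm. III] -/
theorem ellipticMomentKernel_rigid_cm :
    Summit.KontsevichZagierPeriods.HermiteRigidity.EllipticMomentKernelNegative.Rigid 44 (-56) :=
  rigid_one_J₀_J₁_cm

/-- **(F12)** Hence `EllipticMomentKernel` predicts UNCONDITIONALLY that every value-`0` integer
combination of moment generators of `y² = 4x³ − 44x + 56` is a relation. [cite: KontsevichZagier2001, §1.2] -/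
theorem kernelClaim_cm_of_ellipticMomentKernel
    (h : Summit.KontsevichZagierPeriods.KontsevichZagierPeriods.Theses.HermiteRigidity.EllipticMomentKernel) :
    Summit.KontsevichZagierPeriods.HermiteRigidity.EllipticMomentKernelNegative.KernelClaim 44 (-56) :=
  (Summit.KontsevichZagierPeriods.HermiteRigidity.EllipticMomentKernelNegative.ellipticMomentKernel_iff.mp
    h) 44 (-56)
    (by norm_num [Summit.KontsevichZagierPeriods.HermiteRigidity.EllipticMomentKernelNegative.disc])
    ellipticMomentKernel_rigid_cm

/-- **(F12) THE INTEGER RELATION LATTICE at `(44,−56)`** is `ℤ(1,0,−2,0) ⊕ ℤ(2,−1,0,−2)` — exactly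
the coefficient vectors of the two CM kernel elements `cmElem` (F9) and `cmElem₂` (F9b): there is
no third independent integer (or rational, or real-algebraic) relation. [cite: Masser1975, Ch. III Thm. III] -/
theorem intRelation_cm_iff (b c d e : ℤ) :
    (b : ℝ) * J₀ 44 (-56) + (c : ℝ) * J₁ 44 (-56) + (d : ℝ) * K₀ 44 (-56) + (e : ℝ) * K₁ 44 (-56) = 0 ↔
      ∃ s t : ℤ, b = s + 2 * t ∧ c = -t ∧ d = -2 * s ∧ e = -2 * t := by
  have key := relation_cm_iff 0 b c d e isAlgebraic_zero (isAlgebraic_intCast b)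
    (isAlgebraic_intCast c) (isAlgebraic_intCast d) (isAlgebraic_intCast e)
  rw [zero_add] at key
  rw [key]
  constructor
  · rintro ⟨-, h1, h2⟩
    have h1' : e = 2 * c := by exact_mod_cast h1
    have h2' : 2 * b + 4 * c + d = 0 := by exact_mod_cast h2
    exact ⟨b + 2 * c, -c, by ring, by ring, by linarith, by linarith⟩
  · rintro ⟨s, t, rfl, rfl, rfl, rfl⟩
    refine ⟨rfl, ?_, ?_⟩ <;> push_cast <;> ring

/-- **(F12) `QRigidity` fails at `(44,−56)` exactly on a rank-2 lattice**: restated for the `ℚ`-form of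
F4. [folklore] -/
theorem qRelation_cm_iff (b c d e : ℚ) :
    (b : ℝ) * J₀ 44 (-56) + (c : ℝ) * J₁ 44 (-56) + (d : ℝ) * K₀ 44 (-56) + (e : ℝ) * K₁ 44 (-56) = 0 ↔
      e = 2 * c ∧ 2 * b + 4 * c + d = 0 := by
  have key := relation_cm_iff 0 b c d e isAlgebraic_zero (isAlgebraic_ratCast b)
    (isAlgebraic_ratCast c) (isAlgebraic_ratCast d) (isAlgebraic_ratCast e)
  rw [zero_add] at key
  rw [key]
  constructor
  · rintro ⟨-, h1, h2⟩
    exact ⟨by exact_mod_cast h1, by exact_mod_cast h2⟩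
  · rintro ⟨h1, h2⟩
    refine ⟨rfl, by exact_mod_cast h1, by exact_mod_cast h2⟩

/-! #### What the crux's conclusion reduces to at `(44,−56)` -/

/-- **(F12) EXACT REMAINING CONTENT of `RealEllipticSectorKernel`'s conclusion at `j = 66³`.**
Hypothesis `hNF` is an INTEGER NORMAL FORM of the `(44,−56)` sector on four basis representations
`g₀ = [σ,1/√f]`, `g₁ = [σ,x/√f]`, `g₀' = [σ',1/√(−f)]`, `g₁' = [σ',x/√(−f)]` (every element of
`closure S` is, after a positive integer multiple, congruent modulo relations to an integer
combination of them) — precisely the OUTPUT of the route's reduction machinery (Hermite on `σ` and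
`σ'`, the two-torsion move for `σ''`, bookkeeping: the `Sharpened` / oval-hermite-engine normal
form). Given it, the kernel claim `Kernel 44 (−56)` holds iff
the two CM isogeny transfers hold: `u₀ = [g₀] − 2[g₀'] ∈ relations` (first kind, F9) and
`u₁ = 2[g₀] − [g₁] − 2[g₁'] ∈ relations` (second kind, F9b). Nothing else can hide at this curve:
by `intRelation_cm_iff` every integer relation is `s·u₀ + t·u₁`, and integer division is a derived
rule (`MzvKernelInKZ.Negative.mem_relations_of_nsmul_mem`). So the unconditional statement on this
sector = the `Sharpened` machinery + exactly TWO new support items. [cite: KontsevichZagier2001, §1.2] -/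
theorem kernel_cm_iff_transfers (g₀ g₁ g₀' g₁' : KZ.IntegralRep 1)
    (hv₀ : g₀.value = J₀ 44 (-56)) (hv₁ : g₁.value = J₁ 44 (-56))
    (hv₀' : g₀'.value = K₀ 44 (-56)) (hv₁' : g₁'.value = K₁ 44 (-56))
    (hm₀ : KZ.of g₀ ∈ AddSubgroup.closure (Gens 44 (-56)))
    (hm₁ : KZ.of g₁ ∈ AddSubgroup.closure (Gens 44 (-56)))
    (hm₀' : KZ.of g₀' ∈ AddSubgroup.closure (Gens 44 (-56)))
    (hm₁' : KZ.of g₁' ∈ AddSubgroup.closure (Gens 44 (-56)))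
    (hNF : ∀ x ∈ AddSubgroup.closure (Gens 44 (-56)), ∃ (N : ℕ) (b c d e : ℤ), 0 < N ∧
      N • x - (b • KZ.of g₀ + c • KZ.of g₁ + d • KZ.of g₀' + e • KZ.of g₁') ∈ KZ.relations) :
    Kernel 44 (-56) ↔
      (KZ.of g₀ - 2 • KZ.of g₀' ∈ KZ.relations ∧
        2 • KZ.of g₀ - KZ.of g₁ - 2 • KZ.of g₁' ∈ KZ.relations) := by
  have hJK := J₀_eq_two_mul_K₀_cm
  have hJK₂ := two_J₀_sub_J₁_sub_two_K₁_cm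
  constructor
  · intro hK
    refine ⟨hK _ (sub_mem hm₀ (AddSubgroup.nsmul_mem _ hm₀' 2)) ?_,
      hK _ (sub_mem (sub_mem (AddSubgroup.nsmul_mem _ hm₀ 2) hm₁) (AddSubgroup.nsmul_mem _ hm₁' 2)) ?_⟩
    · simp only [map_sub, map_nsmul, KZ.eval_of, hv₀, hv₀', nsmul_eq_mul, Nat.cast_ofNat]
      linarith
    · simp only [map_sub, map_nsmul, KZ.eval_of, hv₀, hv₁, hv₁', nsmul_eq_mul, Nat.cast_ofNat]
      linarith
  · rintro ⟨hu₀, hu₁⟩ x hx hx0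
    obtain ⟨N, b, c, d, e, hN, hnf⟩ := hNF x hx
    -- soundness: the normal form has the value of `N • x`, namely `0`
    have hsound : KZ.eval (N • x - (b • KZ.of g₀ + c • KZ.of g₁ + d • KZ.of g₀' + e • KZ.of g₁')) = 0 :=
      (AddMonoidHom.mem_ker).1 (KZ.relations_le_ker_eval_holds hnf)
    have hrel : (b : ℝ) * J₀ 44 (-56) + (c : ℝ) * J₁ 44 (-56) + (d : ℝ) * K₀ 44 (-56) +
        (e : ℝ) * K₁ 44 (-56) = 0 := by
      simp only [map_sub, map_add, map_nsmul, map_zsmul, KZ.eval_of, hv₀, hv₁, hv₀', hv₁', hx0,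
        smul_zero, zero_sub, neg_eq_zero, zsmul_eq_mul] at hsound
      linarith
    obtain ⟨s, t, rfl, rfl, rfl, rfl⟩ := (intRelation_cm_iff b c d e).mp hrel
    -- the integer combination is `s • u₀ + t • u₁`
    have hcomb : ((s + 2 * t : ℤ)) • KZ.of g₀ + (-t : ℤ) • KZ.of g₁ + ((-2 * s : ℤ)) • KZ.of g₀' +
        ((-2 * t : ℤ)) • KZ.of g₁' =
        s • (KZ.of g₀ - 2 • KZ.of g₀') + t • (2 • KZ.of g₀ - KZ.of g₁ - 2 • KZ.of g₁') := by
      simp only [add_smul, mul_smul, neg_smul, smul_sub, smul_add, two_smul, mul_comm (2:ℤ)]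
      abel_nf
    have hmem : ((s + 2 * t : ℤ)) • KZ.of g₀ + (-t : ℤ) • KZ.of g₁ + ((-2 * s : ℤ)) • KZ.of g₀' +
        ((-2 * t : ℤ)) • KZ.of g₁' ∈ KZ.relations := by
      rw [hcomb]
      exact add_mem (AddSubgroup.zsmul_mem _ hu₀ s) (AddSubgroup.zsmul_mem _ hu₁ t)
    have hNx : N • x ∈ KZ.relations := by
      have := add_mem hnf hmem
      rwa [sub_add_cancel] at this
    exact Summit.KontsevichZagierPeriods.MzvKernelInKZ.Negative.mem_relations_of_nsmul_mem hN hNx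

/-- **(F12)** The instance with the landed representations `genσCM, genσxCM, genσ'CM, genσ'xCM`:
given their integer normal form, `Kernel 44 (−56) ↔ (cmElem ∈ relations ∧ cmElem₂ ∈ relations)`.
[cite: KontsevichZagier2001, §1.2] -/
theorem kernel_cm_iff_cmElems
    (hNF : ∀ x ∈ AddSubgroup.closure (Gens 44 (-56)), ∃ (N : ℕ) (b c d e : ℤ), 0 < N ∧
      N • x - (b • KZ.of genσCM + c • KZ.of genσxCM + d • KZ.of genσ'CM + e • KZ.of genσ'xCM) ∈
        KZ.relations) :
    Kernel 44 (-56) ↔ (cmElem ∈ KZ.relations ∧ cmElem₂ ∈ KZ.relations) :=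
  kernel_cm_iff_transfers genσCM genσxCM genσ'CM genσ'xCM (genσCM_value.trans J₀_cm.symm)
    (genσxCM_value.trans J₁_cm.symm) (genσ'CM_value.trans K₀_cm.symm)
    (genσ'xCM_value.trans K₁_cm.symm) (AddSubgroup.subset_closure genσCM_mem_gens)
    (AddSubgroup.subset_closure genσxCM_mem_gens) (AddSubgroup.subset_closure genσ'CM_mem_gens)
    (AddSubgroup.subset_closure genσ'xCM_mem_gens) hNF

/-- CANDIDATE SUPPORT STATEMENT, second kind (not filed; planners only): the quasi-period isogeny
transfer at `j = 66³`, `2[σ,1/√f] − [σ,x/√f] − 2[σ',x/√(−f)] ∈ relations` on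
`y² = 4x³ − 44x + 56` — the analogue of the route's `CMTwistQuasiPeriodTransfer` (`j = 8000`).
Paper chain: the first-kind chain of `CMIsogenyTransfer` applied to the pulled-back forms of §9b
(`x dx/√f = dx/√f − 2·(isogeny pull-back of u du/Y′) − d(√f/(2(x−2)))` on the oval, cut at the fold
`x = 1`; `x dx/√(−f) = dx/√(−f) + (pull-back of dv/(8v√(4v³−4v))) + d(√(−f)/(1−x))/16`-type on
`σ'`), i.e. rational rule-2 moves, rule-1a cuts at the fold, and two Hermite rule-3 moves with the
primitives `G = √f/(2(x−2))` and `H = √(−f)/(1−x)` of §9b (both vanish at the endpoints). The VALUE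
identity is `two_J₀_sub_J₁_sub_two_K₁_cm`. [cite: Masser1975, Ch. III Lemma 3.1] -/
def CMIsogenyTransfer₂ : Prop :=
  ∀ r s t : KZ.IntegralRep 1, r.domain = σ₁ 44 (-56) →
    EqOn r.integrand (fun p => 1 / Real.sqrt (cubic 44 (-56) (p 0))) (σ₁ 44 (-56)) →
    s.domain = σ₁ 44 (-56) →
    EqOn s.integrand (fun p => p 0 / Real.sqrt (cubic 44 (-56) (p 0))) (σ₁ 44 (-56)) →
    t.domain = σ₂ 44 (-56) →
    EqOn t.integrand (fun p => p 0 / Real.sqrt (-cubic 44 (-56) (p 0))) (σ₂ 44 (-56)) →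
    2 • KZ.of r - KZ.of s - 2 • KZ.of t ∈ KZ.relations

/-- The second candidate support also follows from the summit. [cite: KontsevichZagier2001, §1.2] -/
theorem cmIsogenyTransfer₂_of_summit (h : _root_.KontsevichZagierPeriods) : CMIsogenyTransfer₂ := by
  intro r s t hr hri hs hsi ht hti
  refine (kzKernelConjecture_iff_isRational.mpr h) _ ?_
  have e1 : KZ.Equivalent r genσCM := equivalent_of_eqOn (by simp [genσCM, hr])
    (by rw [hr]; intro p hp; rw [hri hp]; rfl)
  have e2 : KZ.Equivalent s genσxCM := equivalent_of_eqOn (by simp [genσxCM, hs])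
    (by rw [hs]; intro p hp; rw [hsi hp]; rfl)
  have e3 : KZ.Equivalent t genσ'xCM := equivalent_of_eqOn (by simp [genσ'xCM, ht])
    (by rw [ht]; intro p hp; rw [hti hp]; rfl)
  have v1 := KZ.relations_le_ker_eval_holds e1
  have v2 := KZ.relations_le_ker_eval_holds e2
  have v3 := KZ.relations_le_ker_eval_holds e3
  rw [AddMonoidHom.mem_ker, map_sub, KZ.eval_of, KZ.eval_of, sub_eq_zero] at v1 v2 v3
  have h0 := two_J₀_sub_J₁_sub_two_K₁_cm
  rw [J₀_cm, J₁_cm, K₁_cm] at h0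
  simp only [map_sub, map_nsmul, KZ.eval_of, v1, v2, v3, genσCM_value, genσxCM_value, genσ'xCM_value]
  simp only [nsmul_eq_mul, Nat.cast_ofNat]
  linarith

/-- **(F12) PLANNER-FACING FORM of the exact remaining content at `j = 66³`**: given the integer
normal form of the route's reduction half, the two candidate supports `CMIsogenyTransfer` (§9, first
kind) and `CMIsogenyTransfer₂` (second kind) IMPLY the crux's conclusion `Kernel 44 (−56)`
unconditionally (no rigidity hypothesis — it is false there); and both follow from the summit. So the
unconditional `(44,−56)` sector = `Sharpened` machinery + these two supports, exactly.
[cite: KontsevichZagier2001, §1.2] -/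
theorem kernel_cm_of_isogenyTransfers
    (hNF : ∀ x ∈ AddSubgroup.closure (Gens 44 (-56)), ∃ (N : ℕ) (b c d e : ℤ), 0 < N ∧
      N • x - (b • KZ.of genσCM + c • KZ.of genσxCM + d • KZ.of genσ'CM + e • KZ.of genσ'xCM) ∈
        KZ.relations)
    (h₁ : CMIsogenyTransfer) (h₂ : CMIsogenyTransfer₂) : Kernel 44 (-56) :=
  (kernel_cm_iff_cmElems hNF).mpr
    ⟨h₁ genσCM genσ'CM rfl (fun p _ => by simp [genσCM]) rfl (fun p _ => by simp [genσ'CM]),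
     h₂ genσCM genσxCM genσ'xCM rfl (fun p _ => by simp [genσCM]) rfl (fun p _ => rfl) rfl
       (fun p _ => rfl)⟩



/-! ### §§12–13 (F13–F14, cycle 3) — MOVED to the companion workfile `DisproofCM8000.lean` (same
directory; the crux dir caps a workfile at 200 kB). Headline theorems there (namespace
`Summit.KontsevichZagierPeriods.RealEllipticSectorKernel.{CM8000, CMPoint8000}`, all sorry-free,
axioms standard; landing twins `Negative/RootsCM8000.lean`, `Negative/IsogenyCM8000.lean`,
`Negative/CMPoint8000.lean`, `Negative/SecondKindCM8000.lean`, `Negative/CMPoint8000SecondKind.lean`):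

* `CM8000.Φ_key : f8 (Φ x) = -(f8 x) * Φ' x ^ 2 / 2` (`Φ x = -x/2 - 9/(x-4)`, the real rational
  CM isogeny of `y² = 4x³ − 120x + 224`), `CM8000.Φ_sub_r₂ : Φ x - r₂ = -((x - xs)^2)/(2(x-4))`
  (fold at `xs = 4 − 3√2`), `CM8000.Φ_image₁/₂`, `CM8000.Φ_injOn₁/₂`, `CM8000.weight`;
* `CM8000.J_eq_sqrt2_mul_K : ∫_{(r₃,r₂)} (√f8)⁻¹ = √2 · ∫_{(r₂,4)} (√(−f8))⁻¹` and
  `CMPoint8000.J₀_eq_sqrt2_mul_K₀ : J₀ 120 (-224) = √2 * K₀ 120 (-224)`;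
* `CMPoint8000.not_rigidity_8000 : ¬ Rigidity 120 (-224)` (vector `(0,1,0,−√2,0)`),
  `CMPoint8000.intIndependent_J₀_K₀_8000` (no INTEGER relation between `J₀, K₀`: `√2 ∉ ℚ`, `K₀ > 0`);
* `CM8000.integral_Gder = 0` (Hermite primitive `G = √f/(x−4)` across the branch points),
  `CM8000.integral_inv_sub_four`, `CM8000.K1_eq` and
  `CMPoint8000.K₁_eq_8000 : K₁ 120 (-224) = √2 * J₀ 120 (-224) - √2/2 * J₁ 120 (-224)`,
  `CMPoint8000.not_rigid_one_J₁_K₀_K₁_8000` (second independent algebraic relation);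
* `CMPoint8000.cmTwist_value_eq` / `cmTwist_of_summit` / `not_summit_of_not_cmTwistPeriodTransfer`
  (item 3415) and `cmTwistQuasi_value_eq` / `cmTwistQuasi_of_summit` /
  `not_summit_of_not_cmTwistQuasiPeriodTransfer` (item 3416): both CMTwist supports of the route are
  summit corollaries, their value identities now theorems. -/



/-! ### §14 (F15, cycle 3) The mirror `x ↦ −x`: `K₀(q₂,q₃) = J₀(q₂,−q₃)`, `K₁(q₂,q₃) = −J₁(q₂,−q₃)` for
ALL parameters (measure-preserving reflection of `ℝ¹`; one rule-2 move in the calculus), hence the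
inlined hypothesis is TWIST-INVARIANT and every finding transfers to the twist: `¬Rigidity 44 56`,
EMK's hypothesis holds at `(44,56)` too. Landing twin: `Negative/Mirror.lean`. -/

namespace Mirror

/-- `f_{q₂,q₃}(−x) = −f_{q₂,−q₃}(x)`. [folklore] -/
theorem cubic_neg (q₂ q₃ : ℚ) (x : ℝ) : cubic q₂ q₃ (-x) = -cubic q₂ (-q₃) x := by
  simp only [cubic, Rat.cast_neg]; ring

/-- `f_{q₂,−q₃}(−x) = −f_{q₂,q₃}(x)`. [folklore] -/
theorem cubic_twist_neg (q₂ q₃ : ℚ) (x : ℝ) : cubic q₂ (-q₃) (-x) = -cubic q₂ q₃ x := by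
  rw [cubic_neg, neg_neg]

/-- `σ'(q₂,q₃) = −σ(q₂,−q₃)` (as the preimage under `p ↦ −p`). [folklore] -/
theorem σ₂_eq_preimage_neg (q₂ q₃ : ℚ) : σ₂ q₂ q₃ = (fun p => -p) ⁻¹' σ₁ q₂ (-q₃) := by
  ext p
  simp only [σ₁, σ₂, mem_preimage, mem_setOf_eq, Pi.neg_apply, cubic_twist_neg]
  constructor
  · rintro ⟨h1, t, ht, h2⟩
    refine ⟨by linarith, -t, by linarith, ?_⟩
    rw [cubic_twist_neg]; linarith
  · rintro ⟨h1, t, ht, h2⟩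
    refine ⟨by linarith, -t, by linarith, ?_⟩
    rw [cubic_neg]; linarith

/-- Reflection of a set integral on `ℝ¹` (Lebesgue measure is invariant under `p ↦ −p`). [folklore] -/
theorem setIntegral_comp_neg (g : (Fin 1 → ℝ) → ℝ) (S : Set (Fin 1 → ℝ)) :
    ∫ p in (fun p => -p) ⁻¹' S, g (-p) = ∫ p in S, g p := by
  haveI : (volume : Measure (Fin 1 → ℝ)).IsNegInvariant :=
    Measure.IsAddHaarMeasure.isNegInvariant_of_regular _
  have hN : MeasurePreserving (fun p : Fin 1 → ℝ => -p) volume volume :=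
    Measure.measurePreserving_neg _
  have hemb : MeasurableEmbedding (fun p : Fin 1 → ℝ => -p) :=
    (MeasurableEquiv.neg (Fin 1 → ℝ)).measurableEmbedding
  exact hN.setIntegral_preimage_emb hemb g S

/-- **`K₀(q₂,q₃) = J₀(q₂,−q₃)`** for all parameters. [folklore] -/
theorem K₀_eq_J₀_twist (q₂ q₃ : ℚ) : K₀ q₂ q₃ = J₀ q₂ (-q₃) := by
  unfold K₀ J₀
  rw [σ₂_eq_preimage_neg,
    ← setIntegral_comp_neg (fun p => 1 / Real.sqrt (cubic q₂ (-q₃) (p 0))) (σ₁ q₂ (-q₃))]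
  refine integral_congr_ae (Filter.Eventually.of_forall fun p => ?_)
  simp only [Pi.neg_apply, cubic_twist_neg]

/-- **`K₁(q₂,q₃) = −J₁(q₂,−q₃)`** for all parameters. [folklore] -/
theorem K₁_eq_neg_J₁_twist (q₂ q₃ : ℚ) : K₁ q₂ q₃ = -J₁ q₂ (-q₃) := by
  unfold K₁ J₁
  rw [σ₂_eq_preimage_neg,
    ← setIntegral_comp_neg (fun p => p 0 / Real.sqrt (cubic q₂ (-q₃) (p 0))) (σ₁ q₂ (-q₃)),
    ← integral_neg]
  refine integral_congr_ae (Filter.Eventually.of_forall fun p => ?_)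
  simp only [Pi.neg_apply, cubic_twist_neg]
  ring

/-- `J₀(q₂,q₃) = K₀(q₂,−q₃)`. [folklore] -/
theorem J₀_eq_K₀_twist (q₂ q₃ : ℚ) : J₀ q₂ q₃ = K₀ q₂ (-q₃) := by
  rw [K₀_eq_J₀_twist, neg_neg]

/-- `J₁(q₂,q₃) = −K₁(q₂,−q₃)`. [folklore] -/
theorem J₁_eq_neg_K₁_twist (q₂ q₃ : ℚ) : J₁ q₂ q₃ = -K₁ q₂ (-q₃) := by
  rw [K₁_eq_neg_J₁_twist, neg_neg, neg_neg]

/-- One direction of twist-invariance. [folklore] -/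
theorem rigidity_twist {q₂ q₃ : ℚ} (h : Rigidity q₂ q₃) : Rigidity q₂ (-q₃) := by
  intro a b c d e ha hb hc hd he hrel
  rw [← K₀_eq_J₀_twist, K₀_eq_J₀_twist q₂ (-q₃), neg_neg, K₁_eq_neg_J₁_twist q₂ (-q₃), neg_neg]
    at hrel
  -- hrel : a + b K₀ + c J₁(q₂,-q₃) + d J₀ + e (−J₁) = 0, with J₁(q₂,-q₃) = −K₁(q₂,q₃)
  rw [show J₁ q₂ (-q₃) = -K₁ q₂ q₃ by rw [K₁_eq_neg_J₁_twist, neg_neg]] at hrel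
  have := h a d (-e) b (-c) ha hd he.neg hb hc.neg (by linear_combination hrel)
  obtain ⟨h0, h1, h2, h3, h4⟩ := this
  exact ⟨h0, h3, by linarith, h1, by linarith⟩

/-- **The crux's inlined hypothesis is twist-invariant**: `Rigidity q₂ q₃ ↔ Rigidity q₂ (−q₃)`.
[folklore] -/
theorem rigidity_iff_twist (q₂ q₃ : ℚ) : Rigidity q₂ q₃ ↔ Rigidity q₂ (-q₃) :=
  ⟨rigidity_twist, fun h => by simpa using rigidity_twist h⟩

/-- **(F15 ∘ F9) The hypothesis also fails at the mirror curve `(44, 56)`** (`K₀(44,56) = 2J₀(44,56)`).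
[folklore] -/
theorem not_rigidity_44_56 : ¬ Rigidity 44 56 := fun h =>
  not_rigidity_cm (by simpa using rigidity_twist h)

/-- `K₀(44,56) = 2·J₀(44,56)` (mirror of F9's `J₀(44,−56) = 2K₀(44,−56)`). [folklore] -/
theorem K₀_eq_two_mul_J₀_44_56 : K₀ 44 56 = 2 * J₀ 44 56 := by
  rw [K₀_eq_J₀_twist 44 56, J₀_eq_K₀_twist 44 56]
  exact J₀_eq_two_mul_K₀_cm


/-- **(F15 ∘ F12) EMK's hypothesis also HOLDS at the mirror curve `(44, 56)`**: `1, J₀(44,56), J₁(44,56)`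
= `1, K₀(44,−56), −K₁(44,−56)` are independent (`rigid_one_K₀_K₁_cm`). [cite: Masser1975, Ch. III Thm. III] -/
theorem rigid_one_J₀_J₁_44_56 (a b c : ℝ) (ha : IsAlgebraic ℚ a) (hb : IsAlgebraic ℚ b)
    (hc : IsAlgebraic ℚ c) (h : a + b * J₀ 44 56 + c * J₁ 44 56 = 0) : a = 0 ∧ b = 0 ∧ c = 0 := by
  rw [J₀_eq_K₀_twist 44 56, J₁_eq_neg_K₁_twist 44 56] at h
  have h' : a + b * K₀ 44 (-56) + (-c) * K₁ 44 (-56) = 0 := by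
    have e : ((-56 : ℚ)) = -(56 : ℚ) := by norm_num
    rw [e]; linear_combination h
  obtain ⟨h0, h1, h2⟩ := rigid_one_K₀_K₁_cm a b (-c) ha hb hc.neg h'
  exact ⟨h0, h1, by linarith⟩

/-- … and `1, K₀(44,56), K₁(44,56)` are independent (mirror of `rigid_one_J₀_J₁_cm`). [cite: Masser1975, Ch. III Thm. III] -/
theorem rigid_one_K₀_K₁_44_56 (a d e : ℝ) (ha : IsAlgebraic ℚ a) (hd : IsAlgebraic ℚ d)
    (he : IsAlgebraic ℚ e) (h : a + d * K₀ 44 56 + e * K₁ 44 56 = 0) : a = 0 ∧ d = 0 ∧ e = 0 := by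
  rw [K₀_eq_J₀_twist 44 56, K₁_eq_neg_J₁_twist 44 56] at h
  have h' : a + d * J₀ 44 (-56) + (-e) * J₁ 44 (-56) = 0 := by
    have e' : ((-56 : ℚ)) = -(56 : ℚ) := by norm_num
    rw [e']; linear_combination h
  obtain ⟨h0, h1, h2⟩ := rigid_one_J₀_J₁_cm a d (-e) ha hd he.neg h'
  exact ⟨h0, h1, by linarith⟩

end Mirror

end Summit.KontsevichZagierPeriods.KontsevichZagierPeriods.Cruxes.RealEllipticSectorKernel.Disproof

end
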